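import Literature.Analysis.FluidPDE.NewtonLocalPotential
import Literature.Analysis.FluidPDE.TsaiHeadPressure
import Literature.Analysis.FluidPDE.SolenoidalTruncation
import HarnessLib

/-!
# Galdi's `L^{9/2}` Liouville theorem for steady D-solutions on `ℝ³` — a pressure-free proof

G. P. Galdi, *An Introduction to the Mathematical Theory of the Navier–Stokes Equations.
Steady-State Problems*, 2nd ed. (2011), Theorem X.9.5 (p. 729; restated in Wang 2025, Thm 2.2, and
in Seregin–Wang, St. Petersburg Math. J. 31 (2020), §1 and Remark 1.2 (i)):

  if `(u, p)` is a smooth solution of `−Δu + (u·∇)u + ∇p = 0`, `div u = 0` on `ℝ³` with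
  `u(x) → 0` as `|x| → ∞`, `∫ |∇u|² < ∞` and `u ∈ L^{9/2}(ℝ³)`, then `u ≡ 0`.

Main result: `eq_zero_of_steadyNS_memLp_nineHalves` (at the end of the file; `ν = 1`, the
rendering `IsLerayProfile 1 0 u p` + `u ∈ C^∞` of the route file `SteadyNSLiouville.lean`).
Everything else lives in the grouping namespace `Literature.Analysis.FluidPDE.SteadyLiouvilleL9half`.

**Status with respect to the tree.** The named fact `galdi_liouville_nineHalves`
(`SteadyLiouvilleCriteria.lean`, every `ν > 0`) is discharged in
`SteadyLiouvilleCriteriaProofs.lean` (`galdi_liouville_nineHalves_holds`) along the PRINTED route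
(Calderón–Zygmund pressure `RᵢRⱼ(uᵢuⱼ) ∈ L^{9/4}` via `nrs1996_rieszPressure_holds`, identification
of the pressure by a Liouville argument, Caccioppoli inequality with pressure); the `ν = 1` copy
`galdi_liouville_L9half` that this file was written to discharge has meanwhile been removed from
`SteadyNSLiouville.lean` (rev. 3) as a duplicate.  This file is therefore NOT a discharge; it is kept
as an independent second proof whose point is the METHOD: it never touches the pressure (no
representation formula, no singular integrals, no Bogovskiĭ operator), using instead a
divergence-free localisation of `u` with purely `L²` bounds.  That toolkit — the tested identity
`tested_identity`, the solenoidal localisation `test`/`test_eq`/`sum_pderiv_test_eq_zero`, the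
localised energy identity `energy_identity` and bound `energy_bound` — is what pressure-free
Caccioppoli inequalities for the open items of route `GaldiLiouvilleGate` (Seregin–Wang-type annular
criteria, `sereginWang_liouville_L3_annulus`) require, and is stated for reuse.

## The printed proof and the variant formalised here

Galdi's proof (X.9.5; Wang 2025, (2.11)) tests the momentum equation with `ψ_R u`, `ψ_R` a cut-off
of the ball `B_R`: `∫ ψ_R |∇u|² = ∫ ½|u|² Δψ_R + ∫ (½|u|² + p) u·∇ψ_R`, and lets `R → ∞`; the three
terms on the right are `o(1)` by Hölder's inequality on the annulus `A_R = {R ≤ |x| ≤ 2R}` once one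
knows `p ∈ L^{9/4}` — which is where the printed argument uses the representation
`p = RᵢRⱼ(uᵢuⱼ) + const` and the Calderón–Zygmund `L^{9/4}` bound for the Riesz transforms (the
route taken by the tree's `galdi_liouville_nineHalves_holds`). Here both the identification of the
pressure and the `L^q` Calderón–Zygmund theory are avoided: the pressure term is removed at the
source by testing with a **divergence-free compactly supported** field instead of `ψ_R u`, for
which `∫ ∇p · w = 0` exactly (`sum_integral_pderiv_mul_eq_zero`). The field is the solenoidal
localisation

  `wᵢ = ∑ⱼ ∂ⱼ(ψ_R Tᵢⱼ)`,  `Tᵢⱼ = ∂ⱼΦᵢ − ∂ᵢΦⱼ`,  `Φᵢ = N_{ρ,2ρ}[χ_{2R} uᵢ]`,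

with `N_{ρ,2ρ}` the tree's truncated Newtonian potential at scale `ρ` (`newtonNearPotential`,
`FluidPDE/NewtonLocalPotential`: `ΔN[g] = g − Λ[g]`, `Λ` a unit-mass smoothing at scale `ρ`, and the
`L²` Hessian bound `∫ (∂ⱼ∂ₖN[g])² ≤ C_H ∫ g²` from the Hessian–Laplacian identity — the `p = 2`
Calderón–Zygmund inequality, which is all that is needed here) and `χ_{2R}` a cut-off equal to `1`
on `supp ψ_R`. Antisymmetry of `T` makes `w` divergence free (`sum_pderiv_test_eq_zero`), and Green's
representation gives, on all of `ℝ³` (`test_eq`),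

  `w = ψ_R u − ψ_R Λ[g] − ψ_R ∇h + ∇ψ_R · T`,  `h = div Φ = N[∑ₖ ∂ₖχ_{2R} uₖ]` (as `div u = 0`).

Testing the momentum equation in coordinates (`tested_identity`: `∑ᵢⱼ ∫ ∂ⱼuᵢ ∂ⱼwᵢ + ∑ᵢⱼ ∫ uⱼ ∂ⱼuᵢ wᵢ = 0`)
and expanding `w` yields the localised energy identity (`energy_identity`)

  `∫ ψ_R |∇u|² = −∑ᵢⱼ ∫ ∂ⱼuᵢ ∂ⱼψ_R uᵢ − C(ψ_R u) + (V + C)(ψ_R Λ) + (V + C)(ψ_R ∇h) − (V + C)(∇ψ_R · T)`,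

whose first two terms are Galdi's (`2C(ψ_R u) = −∫ ∇ψ_R · u |u|²`, `two_mul_Cf_w1`), while the
pressure term is replaced by the three correction terms. Every term is then bounded by
Cauchy–Schwarz against `‖∇u‖_{L²}` or `‖u‖²_{L⁴}` on the annulus / ball carrying it
(`abs_S_le`, `abs_K_le`, `abs_Vf_w2_add_abs_Cf_w2_le`, `abs_Vf_w3_add_abs_Cf_w3_le`,
`abs_Vf_w4_add_abs_Cf_w4_le`; `energy_bound`), using only `L²` information on the potentials:
the Hessian bound, Young's inequality `∫ N[g]² ≤ ‖Γ₀‖₁² ∫ g²` (`integral_sq_newtonNearPotential_le`),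
one integration by parts for the first derivatives (`integral_sq_pderiv_newtonNearPotential_le`),
the identity `h = N[d]` (`hfun_eq_newtonNearPotential_dloc`) and sup bounds for the smoothing
remainder obtained by scaling `λ_{ρ,2ρ}(z) = ρ⁻³ λ_{1,2}(z/ρ)` (`abs_rem_le`, `abs_pderiv_rem_le`).
With Hölder from `L^{9/2}` on sets of finite volume (`setIntegral_norm_pow_le`) and the choice
`R = s⁶`, `ρ = κ s⁶`, all volume factors become integer powers of `s` and the estimate reads
(`scale_bound`)

  `∫_{B̄(0,s⁶)} |∇u|² ≤ K κ (‖u‖_{L^{9/2}(|x| ≥ s⁶)} + ‖∇u‖_{L²(|x| ≥ s⁶)} + s⁻¹) + K₀ κ⁻³`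

for all `s, κ ≥ 1` — exactly Galdi's bookkeeping (the convective term is `O(‖u‖³_{L^{9/2}(A_R)})`,
critical), the only new feature being the smoothing remainder, which is not small in `R` but is
`O(κ⁻³)` in the free scale parameter. Letting `s → ∞` (tails of `L^{9/2}` and of the Dirichlet
integral, `tendsto_n92_ext`, `tendsto_setIntegral_ext`) and then `κ → ∞` gives `∫ |∇u|² = 0`
(`integral_gradSq_eq_zero`), so `u` is constant and, decaying at infinity, zero
(`eq_zero_of_memLp_nineHalves`). No new definitions of mathematical content are introduced beyond
the auxiliary objects of the construction (`gloc`, `pot`, `rem`, `tens`, `hfun`, `test`, `w1`–`w4`,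
`Vf`, `Cf`, `gradSq`, `annulus`, `volB`, `dloc`, `massΛ`, `hessC`, `massΓ`, `n92`, `v₁`, `ext`),
and no named facts.

## Mathlib / tree search

Tree (all used): `newtonNearPotential`, `newtonFarSmoothing`, `laplacian_newtonNearPotential`,
`fderiv_newtonNearPotential_apply`, `integral_sq_fderiv_fderiv_newtonNearPotential_le`,
`newtonFarSmoothing_eq_integral_kernel`, `fderiv_newtonFarSmoothing_eq_integral_kernel`,
`integrable_newtonNear`, `integral_abs_newtonNear_scale`, `newtonFarLaplacian_scale`,
`integral_abs_newtonFarLaplacian_scale` (`NewtonLocalPotential`, `NewtonPotential`, `NewtonKernel`);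
`convolution_lsmul_apply`, `eLpNorm_two_eq_ofReal_sqrt` (`NormalisedPressureL2Bound`);
`Literature.Analysis.UnboundedOperators.eLpNorm_convolution_le_lintegral_enorm_mul` (Young);
`cutoff`, `exists_norm_fderiv_cutoff_le` (`WholeSpaceIBP`), `exists_norm_fderiv_fderiv_cutoff_le`
(`SolenoidalTruncation`); `pderiv`, `pderiv_mul/sub/sum/comm`, `contDiff_pderiv`,
`abs_pderiv_le_norm_fderiv` (`CoordDerivatives`); `integral_mul_pderiv_eq_neg`,
`fderiv_apply_eq_sum_mul_pderiv`, `euclidean_fderiv_apply_comp` (`NSVorticityEnergy`);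
`IsLerayProfile.pderiv_pressure_eq`, `.contDiff_pressure_of_smooth`, `.sum_pderiv_pderiv_comp_eq_zero`,
`laplacian_eq_sum_pderiv_pderiv'` (`TsaiHeadPressure`); `frobeniusNormSq_eq_sum` (`VectorCalculus`).
Mathlib: `eLpNorm_le_eLpNorm_mul_rpow_measure_univ` (Hölder between exponents),
`MemLp.eLpNorm_eq_integral_rpow_norm`, `Measure.addHaar_closedBall`, `tendsto_setIntegral_of_monotone`,
`tendsto_setIntegral_of_antitone`, `tendsto_measure_iInter_atTop`, `is_const_of_fderiv_eq_zero`,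
`Continuous.ae_eq_iff_eq`. No Calderón–Zygmund theory, Riesz transform or Bogovskiĭ operator is used.

## References

* G. P. Galdi, *An Introduction to the Mathematical Theory of the Navier–Stokes Equations.
  Steady-State Problems*, 2nd ed., Springer (2011), Theorem X.9.5 (p. 729), Remark X.9.4.
  [Galdi2011] (not held; statement as restated in the two sources below, which agree.)
* G. Seregin, W. Wang, *Sufficient conditions on Liouville type theorems for the 3D steady
  Navier–Stokes equations*, St. Petersburg Math. J. 31 (2020) = arXiv:1805.02227, §1 ("Galdi proved
  the above Liouville type theorem under the assumption that `u ∈ L^{9/2}(ℝ³)`"), Remark 1.2 (i).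
  [SereginWang2020]
* W. Wang, *Liouville theorems for the steady Navier–Stokes equations* (Science Press, 2025),
  Thm 2.2 and (2.11). [Wang2025]
* D. Gilbarg, N. S. Trudinger, *Elliptic PDE of second order* (2001), (2.16)–(2.17), Thm 9.9
  (Green's representation; `‖D²u‖₂ = ‖Δu‖₂`). [GilbargTrudinger2001]
-/

noncomputable section

open _root_.MeasureTheory Set Filter _root_.Topology Function Metric
open scoped ENNReal NNReal ContDiff BigOperators Laplacian Convolution

namespace Literature.Analysis.FluidPDE

namespace SteadyLiouvilleL9half

section General

variable {ι : Type*} [Fintype ι] [DecidableEq ι]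

local notation "𝔼" => EuclideanSpace ℝ ι

/-! ### Integrability and support helpers -/

omit [DecidableEq ι] in
/-- A continuous function times a continuous compactly supported one is integrable. [folklore] -/
theorem integrable_mul_of_hasCompactSupport_right {f g : 𝔼 → ℝ} (hf : Continuous f)
    (hg : Continuous g) (hgc : HasCompactSupport g) : Integrable (fun x => f x * g x) :=
  (hf.mul hg).integrable_of_hasCompactSupport hgc.mul_left

omit [DecidableEq ι] in
/-- A continuous compactly supported function times a continuous one is integrable. [folklore] -/
theorem integrable_mul_of_hasCompactSupport_left {f g : 𝔼 → ℝ} (hf : Continuous f)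
    (hfc : HasCompactSupport f) (hg : Continuous g) : Integrable (fun x => f x * g x) :=
  (hf.mul hg).integrable_of_hasCompactSupport hfc.mul_right

omit [Fintype ι] in
/-- `∂ₗ` of a compactly supported function has compact support. [folklore] -/
theorem hasCompactSupport_pderiv {f : 𝔼 → ℝ} (hfc : HasCompactSupport f) (l : ι) :
    HasCompactSupport (pderiv l f) :=
  hfc.fderiv_apply (𝕜 := ℝ) (stdVec l)

/-- `∂ₗ` of a `C¹` function is continuous. [folklore] -/
theorem continuous_pderiv_one {f : 𝔼 → ℝ} (hf : ContDiff ℝ 1 f) (l : ι) :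
    Continuous (pderiv l f) :=
  continuous_pderiv hf one_ne_zero l

/-! ### The pressure term vanishes against divergence-free test components -/

/-- `∑ᵢ ∫ ∂ᵢP · wᵢ = 0` when `∑ᵢ ∂ᵢwᵢ = 0` and the `wᵢ` are `C¹` with compact support
(one integration by parts). [folklore] -/
theorem sum_integral_pderiv_mul_eq_zero {P : 𝔼 → ℝ} (hP : ContDiff ℝ 1 P) {w : ι → 𝔼 → ℝ}
    (hw : ∀ i, ContDiff ℝ 1 (w i)) (hwc : ∀ i, HasCompactSupport (w i))
    (hdiv : ∀ x, ∑ i, pderiv i (w i) x = 0) :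
    ∑ i, ∫ x, pderiv i P x * w i x = 0 := by
  have h1 : ∀ i, ∫ x, pderiv i P x * w i x = -∫ x, pderiv i (w i) x * P x := by
    intro i
    have := integral_mul_pderiv_eq_neg (hw i) (hwc i) hP i
    rw [← this]
    exact integral_congr_ae (Eventually.of_forall fun x => mul_comm _ _)
  simp_rw [h1]
  rw [Finset.sum_neg_distrib, neg_eq_zero, ← integral_finsetSum]
  · have : (fun x => ∑ i, pderiv i (w i) x * P x) = fun _ => 0 := by
      funext x
      rw [← Finset.sum_mul, hdiv x, zero_mul]
    rw [this, integral_zero]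
  · intro i _
    exact integrable_mul_of_hasCompactSupport_left (continuous_pderiv_one (hw i) i)
      (hasCompactSupport_pderiv (hwc i) i) hP.continuous

/-! ### The viscous term -/

/-- `∫ (∑ⱼ ∂ⱼ∂ⱼf) w = -∑ⱼ ∫ ∂ⱼf ∂ⱼw` for `f ∈ C^∞` and `w ∈ C¹_c`. [folklore] -/
theorem integral_sum_pderiv_pderiv_mul_eq {f : 𝔼 → ℝ} (hf : ContDiff ℝ ∞ f) {w : 𝔼 → ℝ}
    (hw : ContDiff ℝ 1 w) (hwc : HasCompactSupport w) :
    ∫ x, (∑ j, pderiv j (pderiv j f) x) * w x = -∑ j, ∫ x, pderiv j f x * pderiv j w x := by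
  have hfj : ∀ j, ContDiff ℝ 1 (pderiv j f) := fun j =>
    (contDiff_pderiv hf j).of_le (by norm_cast)
  have h1 : ∀ j, ∫ x, pderiv j (pderiv j f) x * w x = -∫ x, pderiv j f x * pderiv j w x := by
    intro j
    have := integral_mul_pderiv_eq_neg hw hwc (hfj j) j
    calc ∫ x, pderiv j (pderiv j f) x * w x = ∫ x, w x * pderiv j (pderiv j f) x :=
          integral_congr_ae (Eventually.of_forall fun x => mul_comm _ _)
      _ = -∫ x, pderiv j w x * pderiv j f x := this
      _ = -∫ x, pderiv j f x * pderiv j w x := by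
          rw [integral_congr_ae (Eventually.of_forall fun x => mul_comm (pderiv j w x) _)]
  calc ∫ x, (∑ j, pderiv j (pderiv j f) x) * w x = ∫ x, ∑ j, pderiv j (pderiv j f) x * w x :=
        integral_congr_ae (Eventually.of_forall fun x => Finset.sum_mul _ _ _)
    _ = ∑ j, ∫ x, pderiv j (pderiv j f) x * w x := by
        refine integral_finsetSum _ fun j _ => ?_
        exact integrable_mul_of_hasCompactSupport_right (continuous_pderiv_one (hfj j) j)
          hw.continuous hwc
    _ = -∑ j, ∫ x, pderiv j f x * pderiv j w x := by
        rw [← Finset.sum_neg_distrib]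
        exact Finset.sum_congr rfl fun j _ => h1 j

/-! ### The tested identity -/

variable {U : EuclideanSpace ℝ ι → EuclideanSpace ℝ ι} {P : EuclideanSpace ℝ ι → ℝ}

/-- **The momentum equation tested against a divergence-free compactly supported field**
(coordinate form): for a smooth steady solution (`IsLerayProfile 1 0 U P`, `U ∈ C^∞`) and
`C¹_c` components `wᵢ` with `∑ᵢ ∂ᵢwᵢ = 0`,
`∑ᵢⱼ ∫ ∂ⱼUᵢ ∂ⱼwᵢ + ∑ᵢⱼ ∫ Uⱼ ∂ⱼUᵢ wᵢ = 0` — the pressure drops out exactly. [folklore] -/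
theorem tested_identity (h : IsLerayProfile 1 0 U P) (hU : ContDiff ℝ ∞ U) {w : ι → 𝔼 → ℝ}
    (hw : ∀ i, ContDiff ℝ 1 (w i)) (hwc : ∀ i, HasCompactSupport (w i))
    (hdiv : ∀ x, ∑ i, pderiv i (w i) x = 0) :
    (∑ i, ∑ j, ∫ x, pderiv j (fun z => U z i) x * pderiv j (w i) x) +
      (∑ i, ∑ j, ∫ x, U x j * pderiv j (fun z => U z i) x * w i x) = 0 := by
  have hUi : ∀ i, ContDiff ℝ ∞ (fun z : 𝔼 => U z i) := fun i => contDiff_comp_euclidean hU i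
  have hP : ContDiff ℝ ∞ P := h.contDiff_pressure_of_smooth hU
  have hP1 : ContDiff ℝ 1 P := hP.of_le (by norm_cast)
  have hpress := sum_integral_pderiv_mul_eq_zero hP1 hw hwc hdiv
  -- the pressure gradient from the profile system
  have hgrad : ∀ i x, pderiv i P x = (∑ j, pderiv j (pderiv j fun z => U z i) x) -
      ∑ j, U x j * pderiv j (fun z => U z i) x := by
    intro i x
    have := congrFun (h.pderiv_pressure_eq i) x
    simp only [one_mul, zero_mul, sub_zero, add_zero] at this
    exact this
  have hcontUj : ∀ i j, Continuous fun x : 𝔼 => U x j * pderiv j (fun z => U z i) x := fun i j =>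
    (hUi j).continuous.mul (continuous_pderiv (hUi i) (by simp) j)
  have hI1 : ∀ i, Integrable fun x => (∑ j, pderiv j (pderiv j fun z => U z i) x) * w i x := by
    intro i
    refine integrable_mul_of_hasCompactSupport_right ?_ (hw i).continuous (hwc i)
    exact continuous_finsetSum _ fun j _ =>
      continuous_pderiv (contDiff_pderiv (hUi i) j) (by simp) j
  have hI2 : ∀ i, Integrable fun x => (∑ j, U x j * pderiv j (fun z => U z i) x) * w i x := by
    intro i
    refine integrable_mul_of_hasCompactSupport_right ?_ (hw i).continuous (hwc i)
    exact continuous_finsetSum _ fun j _ => hcontUj i j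
  have hsplit : ∀ i, ∫ x, pderiv i P x * w i x =
      (∫ x, (∑ j, pderiv j (pderiv j fun z => U z i) x) * w i x) -
        ∫ x, (∑ j, U x j * pderiv j (fun z => U z i) x) * w i x := by
    intro i
    rw [← integral_sub (hI1 i) (hI2 i)]
    refine integral_congr_ae (Eventually.of_forall fun x => ?_)
    simp only [hgrad i x, sub_mul]
  have hvisc : ∀ i, ∫ x, (∑ j, pderiv j (pderiv j fun z => U z i) x) * w i x =
      -∑ j, ∫ x, pderiv j (fun z => U z i) x * pderiv j (w i) x := fun i =>
    integral_sum_pderiv_pderiv_mul_eq (hUi i) (hw i) (hwc i)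
  have hconv : ∀ i, ∫ x, (∑ j, U x j * pderiv j (fun z => U z i) x) * w i x =
      ∑ j, ∫ x, U x j * pderiv j (fun z => U z i) x * w i x := by
    intro i
    calc ∫ x, (∑ j, U x j * pderiv j (fun z => U z i) x) * w i x
        = ∫ x, ∑ j, U x j * pderiv j (fun z => U z i) x * w i x :=
          integral_congr_ae (Eventually.of_forall fun x => Finset.sum_mul _ _ _)
      _ = ∑ j, ∫ x, U x j * pderiv j (fun z => U z i) x * w i x :=
          integral_finsetSum _ fun j _ =>
            integrable_mul_of_hasCompactSupport_right (hcontUj i j) (hw i).continuous (hwc i)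
  simp_rw [hsplit, hvisc, hconv] at hpress
  rw [Finset.sum_sub_distrib, Finset.sum_neg_distrib] at hpress
  linarith

/-- **The convective term, integrated by parts**: for `U ∈ C^∞` with `∑ⱼ ∂ⱼUⱼ = 0` and
`wᵢ ∈ C¹_c`, `∑ᵢⱼ ∫ Uⱼ ∂ⱼUᵢ wᵢ = -∑ᵢⱼ ∫ Uᵢ Uⱼ ∂ⱼwᵢ`. [folklore] -/
theorem convective_ibp (hU : ContDiff ℝ ∞ U) (hdivU : ∀ x, ∑ j, pderiv j (fun z => U z j) x = 0)
    {w : ι → 𝔼 → ℝ} (hw : ∀ i, ContDiff ℝ 1 (w i)) (hwc : ∀ i, HasCompactSupport (w i)) :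
    ∑ i, ∑ j, ∫ x, U x j * pderiv j (fun z => U z i) x * w i x =
      -∑ i, ∑ j, ∫ x, U x i * U x j * pderiv j (w i) x := by
  have hUi : ∀ i, ContDiff ℝ ∞ (fun z : 𝔼 => U z i) := fun i => contDiff_comp_euclidean hU i
  have hUi1 : ∀ i, ContDiff ℝ 1 (fun z : 𝔼 => U z i) := fun i =>
    (hUi i).of_le (by norm_cast)
  have hUd : ∀ i, Differentiable ℝ (fun z : 𝔼 => U z i) := fun i =>
    (hUi1 i).differentiable (by simp)
  have hwd : ∀ i, Differentiable ℝ (w i) := fun i => (hw i).differentiable (by simp)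
  -- one integration by parts per pair `(i, j)`
  have hij : ∀ i j, ∫ x, U x j * pderiv j (fun z => U z i) x * w i x =
      -∫ x, (pderiv j (fun z => U z j) x * w i x + U x j * pderiv j (w i) x) * U x i := by
    intro i j
    have hψ : ContDiff ℝ 1 fun x => U x j * w i x := (hUi1 j).mul (hw i)
    have hψc : HasCompactSupport fun x => U x j * w i x := (hwc i).mul_left
    have := integral_mul_pderiv_eq_neg hψ hψc (hUi1 i) j
    have hprod : pderiv j (fun x => U x j * w i x) =
        fun x => pderiv j (fun z => U z j) x * w i x + U x j * pderiv j (w i) x :=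
      pderiv_mul (hUd j) (hwd i) j
    rw [hprod] at this
    calc ∫ x, U x j * pderiv j (fun z => U z i) x * w i x
        = ∫ x, U x j * w i x * pderiv j (fun z => U z i) x :=
          integral_congr_ae (Eventually.of_forall fun x => by ring)
      _ = _ := this
  -- sum over `j` and use `∑ⱼ ∂ⱼUⱼ = 0`
  have hi : ∀ i, ∑ j, ∫ x, U x j * pderiv j (fun z => U z i) x * w i x =
      -∑ j, ∫ x, U x i * U x j * pderiv j (w i) x := by
    intro i
    simp_rw [hij i]
    rw [Finset.sum_neg_distrib]
    congr 1
    have hIa : ∀ j, Integrable fun x => pderiv j (fun z => U z j) x * w i x * U x i := by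
      intro j
      have : Continuous fun x => pderiv j (fun z => U z j) x * w i x * U x i :=
        ((continuous_pderiv (hUi j) (by simp) j).mul (hw i).continuous).mul (hUi i).continuous
      exact this.integrable_of_hasCompactSupport ((hwc i).mul_left.mul_right)
    have hIb : ∀ j, Integrable fun x => U x j * pderiv j (w i) x * U x i := by
      intro j
      have : Continuous fun x => U x j * pderiv j (w i) x * U x i :=
        ((hUi j).continuous.mul (continuous_pderiv_one (hw i) j)).mul (hUi i).continuous
      exact this.integrable_of_hasCompactSupport
        (((hasCompactSupport_pderiv (hwc i) j).mul_left).mul_right)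
    have hsplit : ∀ j, ∫ x, (pderiv j (fun z => U z j) x * w i x + U x j * pderiv j (w i) x) * U x i
        = (∫ x, pderiv j (fun z => U z j) x * w i x * U x i) +
          ∫ x, U x j * pderiv j (w i) x * U x i := by
      intro j
      rw [← integral_add (hIa j) (hIb j)]
      exact integral_congr_ae (Eventually.of_forall fun x => by ring)
    simp_rw [hsplit]
    rw [Finset.sum_add_distrib]
    have hzero : ∑ j, ∫ x, pderiv j (fun z => U z j) x * w i x * U x i = 0 := by
      rw [← integral_finsetSum _ fun j _ => hIa j]
      have : (fun x => ∑ j, pderiv j (fun z => U z j) x * w i x * U x i) = fun _ => 0 := by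
        funext x
        rw [← Finset.sum_mul, ← Finset.sum_mul, hdivU x, zero_mul, zero_mul]
      rw [this, integral_zero]
    rw [hzero, zero_add]
    exact Finset.sum_congr rfl fun j _ =>
      integral_congr_ae (Eventually.of_forall fun x => by ring)
  simp_rw [hi]
  rw [Finset.sum_neg_distrib]


end General

section Local

local notation "ℝ³" => EuclideanSpace ℝ (Fin 3)

/-! ### The objects -/

/-- The localised components `gᵢ = χ_{2R} uᵢ` (`χ_{2R} = cutoff (2R)`, `= 1` on `B_{2R}`, `= 0` off
`B_{4R}`). [folklore] -/
def gloc (u : ℝ³ → ℝ³) (R : ℝ) (i : Fin 3) : ℝ³ → ℝ := fun x => cutoff (2 * R) x * u x i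

/-- The potentials `Φᵢ = N_{ρ,2ρ}[gᵢ]` (truncated Newtonian potential at scale `ρ`). [folklore] -/
def pot (u : ℝ³ → ℝ³) (R ρ : ℝ) (i : Fin 3) : ℝ³ → ℝ :=
  newtonNearPotential ρ (2 * ρ) (gloc u R i)

/-- The smoothing remainders `Λᵢ = Λ_{ρ,2ρ}[gᵢ]` (`ΔΦᵢ = gᵢ - Λᵢ`). [folklore] -/
def rem (u : ℝ³ → ℝ³) (R ρ : ℝ) (i : Fin 3) : ℝ³ → ℝ :=
  newtonFarSmoothing ρ (2 * ρ) (gloc u R i)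

/-- The antisymmetric tensor `Tᵢⱼ = ∂ⱼΦᵢ - ∂ᵢΦⱼ`. [folklore] -/
def tens (u : ℝ³ → ℝ³) (R ρ : ℝ) (i j : Fin 3) : ℝ³ → ℝ := fun x =>
  pderiv j (pot u R ρ i) x - pderiv i (pot u R ρ j) x

/-- The scalar `h = ∑ₖ ∂ₖΦₖ`. [folklore] -/
def hfun (u : ℝ³ → ℝ³) (R ρ : ℝ) : ℝ³ → ℝ := fun x => ∑ k, pderiv k (pot u R ρ k) x

/-- The test components `wᵢ = ∑ⱼ ∂ⱼ(ψ_R Tᵢⱼ)`, `ψ_R = cutoff R`. [folklore] -/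
def test (u : ℝ³ → ℝ³) (R ρ : ℝ) (i : Fin 3) : ℝ³ → ℝ := fun x =>
  ∑ j, pderiv j (fun y => cutoff R y * tens u R ρ i j y) x

variable {u : ℝ³ → ℝ³} {R ρ : ℝ}

/-! ### Cutoff facts -/

/-- The cut-off is smooth (`∞` form). [folklore] -/
theorem contDiff_cutoff_infty (r : ℝ) : ContDiff ℝ ∞ (cutoff (E := ℝ³) r) :=
  contDiff_cutoff (n := ⊤) r

/-- `cutoff r` vanishes off the closed ball of radius `2r`. [folklore] -/
theorem cutoff_eq_zero_of_lt {r : ℝ} (hr : 0 < r) {x : ℝ³} (hx : 2 * r < ‖x‖) : cutoff r x = 0 :=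
  cutoff_eq_zero hr hx.le

/-- The derivative of `cutoff r` vanishes off the closed ball of radius `2r`. [folklore] -/
theorem fderiv_cutoff_eq_zero_of_lt {r : ℝ} (hr : 0 < r) {x : ℝ³} (hx : 2 * r < ‖x‖) :
    fderiv ℝ (cutoff (E := ℝ³) r) x = 0 := by
  have hopen : IsOpen {y : ℝ³ | 2 * r < ‖y‖} := isOpen_lt continuous_const continuous_norm
  have heq : (cutoff (E := ℝ³) r) =ᶠ[𝓝 x] fun _ => 0 :=
    Filter.eventuallyEq_of_mem (hopen.mem_nhds hx) fun y hy => cutoff_eq_zero_of_lt hr hy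
  rw [heq.fderiv_eq]
  exact fderiv_const_apply 0

/-- `∂ₗ (cutoff r)` vanishes off the closed ball of radius `2r`. [folklore] -/
theorem pderiv_cutoff_eq_zero_of_lt {r : ℝ} (hr : 0 < r) {x : ℝ³} (hx : 2 * r < ‖x‖) (l : Fin 3) :
    pderiv l (cutoff (E := ℝ³) r) x = 0 := by
  rw [pderiv_apply, fderiv_cutoff_eq_zero_of_lt hr hx]; rfl

/-- The derivative of `cutoff r` vanishes inside the open ball of radius `r`. [folklore] -/
theorem fderiv_cutoff_eq_zero_of_norm_lt {r : ℝ} (hr : 0 < r) {x : ℝ³} (hx : ‖x‖ < r) :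
    fderiv ℝ (cutoff (E := ℝ³) r) x = 0 := by
  have hopen : IsOpen {y : ℝ³ | ‖y‖ < r} := isOpen_lt continuous_norm continuous_const
  have heq : (cutoff (E := ℝ³) r) =ᶠ[𝓝 x] fun _ => 1 :=
    Filter.eventuallyEq_of_mem (hopen.mem_nhds hx) fun y hy => cutoff_eq_one hr (le_of_lt hy)
  rw [heq.fderiv_eq]
  exact fderiv_const_apply 1

/-- `∂ₗ (cutoff r)` vanishes inside the open ball of radius `r`. [folklore] -/
theorem pderiv_cutoff_eq_zero_of_norm_lt {r : ℝ} (hr : 0 < r) {x : ℝ³} (hx : ‖x‖ < r) (l : Fin 3) :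
    pderiv l (cutoff (E := ℝ³) r) x = 0 := by
  rw [pderiv_apply, fderiv_cutoff_eq_zero_of_norm_lt hr hx]; rfl

/-! ### Smoothness and support -/

/-- Components of a smooth field are smooth. [folklore] -/
theorem contDiff_comp (hu : ContDiff ℝ ∞ u) (i : Fin 3) : ContDiff ℝ ∞ fun x => u x i :=
  contDiff_comp_euclidean hu i

/-- The localised components `gᵢ` are smooth. [folklore] -/
theorem contDiff_gloc (hu : ContDiff ℝ ∞ u) (i : Fin 3) : ContDiff ℝ ∞ (gloc u R i) :=
  (contDiff_cutoff_infty (2 * R)).mul (contDiff_comp hu i)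

/-- The localised components `gᵢ` have compact support. [folklore] -/
theorem hasCompactSupport_gloc (hR : 0 < R) (i : Fin 3) : HasCompactSupport (gloc u R i) :=
  (hasCompactSupport_cutoff (by positivity : 0 < 2 * R)).mul_right

/-- The potentials `Φᵢ` are smooth. [folklore] -/
theorem contDiff_pot (hu : ContDiff ℝ ∞ u) (hρ : 0 < ρ) (i : Fin 3) : ContDiff ℝ ∞ (pot u R ρ i) :=
  contDiff_newtonNearPotential_top hρ.le (by linarith) (contDiff_gloc hu i)

/-- The potentials `Φᵢ` have compact support. [folklore] -/
theorem hasCompactSupport_pot (hR : 0 < R) (hρ : 0 < ρ) (i : Fin 3) :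
    HasCompactSupport (pot u R ρ i) :=
  hasCompactSupport_newtonNearPotential hρ.le (by linarith) (hasCompactSupport_gloc hR i)

/-- The smoothing remainders `Λᵢ` are `C¹`. [folklore] -/
theorem contDiff_rem_one (hu : ContDiff ℝ ∞ u) (hρ : 0 < ρ) (i : Fin 3) :
    ContDiff ℝ 1 (rem u R ρ i) :=
  contDiff_newtonFarSmoothing hρ (by linarith) 1 ((contDiff_gloc hu i).of_le (by norm_cast))

/-- The tensor `Tᵢⱼ` is smooth. [folklore] -/
theorem contDiff_tens (hu : ContDiff ℝ ∞ u) (hρ : 0 < ρ) (i j : Fin 3) :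
    ContDiff ℝ ∞ (tens u R ρ i j) :=
  (contDiff_pderiv (contDiff_pot hu hρ i) j).sub (contDiff_pderiv (contDiff_pot hu hρ j) i)

/-- The scalar `h` is smooth. [folklore] -/
theorem contDiff_hfun (hu : ContDiff ℝ ∞ u) (hρ : 0 < ρ) : ContDiff ℝ ∞ (hfun u R ρ) :=
  ContDiff.sum fun k _ => contDiff_pderiv (contDiff_pot hu hρ k) k

/-- `ψ Tᵢⱼ` is smooth. [folklore] -/
theorem contDiff_cutoff_mul_tens (hu : ContDiff ℝ ∞ u) (hρ : 0 < ρ) (i j : Fin 3) :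
    ContDiff ℝ ∞ fun y => cutoff R y * tens u R ρ i j y :=
  (contDiff_cutoff_infty R).mul (contDiff_tens hu hρ i j)

/-- The test components `wᵢ` are smooth. [folklore] -/
theorem contDiff_test (hu : ContDiff ℝ ∞ u) (hρ : 0 < ρ) (i : Fin 3) :
    ContDiff ℝ ∞ (test u R ρ i) :=
  ContDiff.sum fun j _ => contDiff_pderiv (contDiff_cutoff_mul_tens hu hρ i j) j

/-- The test components vanish off `B̄(0, 2R)`. [folklore] -/
theorem test_eq_zero_of_lt (hR : 0 < R) (i : Fin 3) {x : ℝ³} (hx : 2 * R < ‖x‖) :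
    test u R ρ i x = 0 := by
  refine Finset.sum_eq_zero fun j _ => ?_
  have hopen : IsOpen {y : ℝ³ | 2 * R < ‖y‖} := isOpen_lt continuous_const continuous_norm
  have heq : (fun y => cutoff R y * tens u R ρ i j y) =ᶠ[𝓝 x] fun _ => 0 :=
    Filter.eventuallyEq_of_mem (hopen.mem_nhds hx) fun y hy => by
      show cutoff R y * tens u R ρ i j y = 0
      rw [cutoff_eq_zero_of_lt hR hy, zero_mul]
  rw [pderiv_apply, heq.fderiv_eq, fderiv_const_apply]
  rfl

/-- The test components `wᵢ` have compact support. [folklore] -/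
theorem hasCompactSupport_test (hR : 0 < R) (i : Fin 3) : HasCompactSupport (test u R ρ i) :=
  HasCompactSupport.intro (isCompact_closedBall (0 : ℝ³) (2 * R)) fun x hx => by
    rw [mem_closedBall_zero_iff, not_le] at hx
    exact test_eq_zero_of_lt hR i hx

/-! ### The test field is divergence free -/

/-- Antisymmetry `Tⱼᵢ = -Tᵢⱼ`. [folklore] -/
theorem tens_swap (u : ℝ³ → ℝ³) (R ρ : ℝ) (i j : Fin 3) :
    tens u R ρ j i = fun x => -tens u R ρ i j x := by
  funext x; simp only [tens]; ring

/-- **`∑ᵢ ∂ᵢwᵢ = 0`**: `∑ᵢⱼ ∂ᵢ∂ⱼ(ψTᵢⱼ) = 0` by antisymmetry of `T` and symmetry of second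
derivatives. [folklore] -/
theorem sum_pderiv_test_eq_zero (hu : ContDiff ℝ ∞ u) (hρ : 0 < ρ) (x : ℝ³) :
    ∑ i, pderiv i (test u R ρ i) x = 0 := by
  set F : Fin 3 → Fin 3 → ℝ³ → ℝ := fun i j y => cutoff R y * tens u R ρ i j y with hF
  have hFs : ∀ i j, ContDiff ℝ ∞ (F i j) := fun i j => contDiff_cutoff_mul_tens hu hρ i j
  have hFanti : ∀ i j, F j i = fun y => -F i j y := by
    intro i j; funext y; simp only [hF, tens]; ring
  have htest : ∀ i, test u R ρ i = fun y => ∑ j, pderiv j (F i j) y := fun i => rfl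
  have hsum : ∀ i, pderiv i (test u R ρ i) x = ∑ j, pderiv i (pderiv j (F i j)) x := by
    intro i
    rw [htest i, pderiv_sum (f := fun j y => pderiv j (F i j) y) Finset.univ
      (fun j _ => (contDiff_pderiv (hFs i j) j).differentiable (by simp))]
  simp_rw [hsum]
  set Q := ∑ i, ∑ j, pderiv i (pderiv j (F i j)) x with hQ
  have hneg : Q = -Q := by
    calc Q = ∑ j, ∑ i, pderiv j (pderiv i (F j i)) x := rfl
      _ = ∑ i, ∑ j, pderiv j (pderiv i (F j i)) x := Finset.sum_comm
      _ = ∑ i, ∑ j, pderiv i (pderiv j (F j i)) x := by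
          refine Finset.sum_congr rfl fun i _ => Finset.sum_congr rfl fun j _ => ?_
          rw [pderiv_comm (hFs j i) j i]
      _ = ∑ i, ∑ j, -pderiv i (pderiv j (F i j)) x := by
          refine Finset.sum_congr rfl fun i _ => Finset.sum_congr rfl fun j _ => ?_
          rw [hFanti i j, pderiv_neg, pderiv_neg]
      _ = -Q := by
          rw [hQ]
          simp only [Finset.sum_neg_distrib]
  linarith

/-! ### The expansion of the test field -/

/-- `∑ⱼ ∂ⱼTᵢⱼ = gᵢ - Λᵢ - ∂ᵢh` (Green's representation `ΔΦᵢ = gᵢ - Λᵢ`, symmetry of second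
derivatives). [folklore] -/
theorem sum_pderiv_tens (hu : ContDiff ℝ ∞ u) (hρ : 0 < ρ) (i : Fin 3) (x : ℝ³) :
    ∑ j, pderiv j (tens u R ρ i j) x = gloc u R i x - rem u R ρ i x - pderiv i (hfun u R ρ) x := by
  have hΦ : ∀ k, ContDiff ℝ ∞ (pot u R ρ k) := fun k => contDiff_pot hu hρ k
  have hdΦ : ∀ k l, Differentiable ℝ (pderiv l (pot u R ρ k)) := fun k l =>
    (contDiff_pderiv (hΦ k) l).differentiable (by simp)
  have h1 : ∀ j, pderiv j (tens u R ρ i j) x =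
      pderiv j (pderiv j (pot u R ρ i)) x - pderiv j (pderiv i (pot u R ρ j)) x := by
    intro j
    have : tens u R ρ i j = fun y => pderiv j (pot u R ρ i) y - pderiv i (pot u R ρ j) y := rfl
    rw [this, pderiv_sub (hdΦ i j) (hdΦ j i)]
  simp_rw [h1]
  rw [Finset.sum_sub_distrib]
  have hlap : ∑ j, pderiv j (pderiv j (pot u R ρ i)) x = gloc u R i x - rem u R ρ i x := by
    rw [← laplacian_eq_sum_pderiv_pderiv' ((hΦ i).of_le (by norm_cast))]
    exact laplacian_newtonNearPotential hρ (by linarith) ((contDiff_gloc hu i).of_le (by norm_cast)) x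
  have hh : pderiv i (hfun u R ρ) x = ∑ j, pderiv j (pderiv i (pot u R ρ j)) x := by
    have : hfun u R ρ = fun y => ∑ j, pderiv j (pot u R ρ j) y := rfl
    rw [this, pderiv_sum (f := fun j y => pderiv j (pot u R ρ j) y) Finset.univ
      (fun j _ => hdΦ j j)]
    refine Finset.sum_congr rfl fun j _ => ?_
    rw [pderiv_comm (hΦ j) i j]
  rw [hlap, hh]

/-- `ψ_R gᵢ = ψ_R uᵢ`: where `ψ_R ≠ 0` the inner cut-off `χ_{2R}` equals `1`. [folklore] -/
theorem cutoff_mul_gloc (hR : 0 < R) (i : Fin 3) (x : ℝ³) :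
    cutoff R x * gloc u R i x = cutoff R x * u x i := by
  by_cases hx : ‖x‖ ≤ 2 * R
  · simp only [gloc, cutoff_eq_one (by positivity : 0 < 2 * R) hx, one_mul]
  · rw [not_le] at hx
    rw [cutoff_eq_zero_of_lt hR hx, zero_mul, zero_mul]

/-- **Expansion of the test field**:
`wᵢ = ψuᵢ - ψΛᵢ - ψ∂ᵢh + ∑ⱼ ∂ⱼψ Tᵢⱼ` everywhere. [folklore] -/
theorem test_eq (hu : ContDiff ℝ ∞ u) (hR : 0 < R) (hρ : 0 < ρ) (i : Fin 3) :
    test u R ρ i = fun x => cutoff R x * u x i - cutoff R x * rem u R ρ i x -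
      cutoff R x * pderiv i (hfun u R ρ) x + ∑ j, pderiv j (cutoff R) x * tens u R ρ i j x := by
  funext x
  have hψd : Differentiable ℝ (cutoff (E := ℝ³) R) :=
    (contDiff_cutoff_infty R).differentiable (by simp)
  have hTd : ∀ j, Differentiable ℝ (tens u R ρ i j) := fun j =>
    (contDiff_tens hu hρ i j).differentiable (by simp)
  have h1 : test u R ρ i x = ∑ j, (pderiv j (cutoff R) x * tens u R ρ i j x +
      cutoff R x * pderiv j (tens u R ρ i j) x) := by
    refine Finset.sum_congr rfl fun j _ => ?_
    rw [pderiv_mul hψd (hTd j)]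
  rw [h1, Finset.sum_add_distrib, ← Finset.mul_sum, sum_pderiv_tens hu hρ i x, mul_sub, mul_sub,
    cutoff_mul_gloc hR i x]
  ring


end Local


section Energy

local notation "ℝ³" => EuclideanSpace ℝ (Fin 3)

variable {u : ℝ³ → ℝ³} {p : ℝ³ → ℝ} {R ρ : ℝ}

/-! ### The four pieces of the test field -/

/-- Piece 1: `ψuᵢ`. [folklore] -/
def w1 (u : ℝ³ → ℝ³) (R : ℝ) (i : Fin 3) : ℝ³ → ℝ := fun x => cutoff R x * u x i

/-- Piece 2: `ψΛᵢ`. [folklore] -/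
def w2 (u : ℝ³ → ℝ³) (R ρ : ℝ) (i : Fin 3) : ℝ³ → ℝ := fun x => cutoff R x * rem u R ρ i x

/-- Piece 3: `ψ∂ᵢh`. [folklore] -/
def w3 (u : ℝ³ → ℝ³) (R ρ : ℝ) (i : Fin 3) : ℝ³ → ℝ := fun x =>
  cutoff R x * pderiv i (hfun u R ρ) x

/-- Piece 4: `∑ⱼ ∂ⱼψ Tᵢⱼ`. [folklore] -/
def w4 (u : ℝ³ → ℝ³) (R ρ : ℝ) (i : Fin 3) : ℝ³ → ℝ := fun x =>
  ∑ j, pderiv j (cutoff R) x * tens u R ρ i j x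

/-- The viscous pairing `V(w) = ∑ᵢⱼ ∫ ∂ⱼuᵢ ∂ⱼwᵢ`. [folklore] -/
def Vf (u : ℝ³ → ℝ³) (w : Fin 3 → ℝ³ → ℝ) : ℝ :=
  ∑ i, ∑ j, ∫ x, pderiv j (fun z => u z i) x * pderiv j (w i) x

/-- The convective pairing `C(w) = ∑ᵢⱼ ∫ uⱼ ∂ⱼuᵢ wᵢ`. [folklore] -/
def Cf (u : ℝ³ → ℝ³) (w : Fin 3 → ℝ³ → ℝ) : ℝ :=
  ∑ i, ∑ j, ∫ x, u x j * pderiv j (fun z => u z i) x * w i x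

/-- `w¹` is smooth. [folklore] -/
theorem contDiff_w1 (hu : ContDiff ℝ ∞ u) (i : Fin 3) : ContDiff ℝ ∞ (w1 u R i) :=
  (contDiff_cutoff_infty R).mul (contDiff_comp hu i)

/-- `w¹` has compact support. [folklore] -/
theorem hasCompactSupport_w1 (hR : 0 < R) (i : Fin 3) : HasCompactSupport (w1 u R i) :=
  (hasCompactSupport_cutoff hR).mul_right

/-- `w²` is `C¹`. [folklore] -/
theorem contDiff_w2 (hu : ContDiff ℝ ∞ u) (hρ : 0 < ρ) (i : Fin 3) : ContDiff ℝ 1 (w2 u R ρ i) :=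
  ((contDiff_cutoff_infty R).of_le (by norm_cast)).mul (contDiff_rem_one hu hρ i)

/-- `w²` has compact support. [folklore] -/
theorem hasCompactSupport_w2 (hR : 0 < R) (i : Fin 3) : HasCompactSupport (w2 u R ρ i) :=
  (hasCompactSupport_cutoff hR).mul_right

/-- `w³` is smooth. [folklore] -/
theorem contDiff_w3 (hu : ContDiff ℝ ∞ u) (hρ : 0 < ρ) (i : Fin 3) : ContDiff ℝ ∞ (w3 u R ρ i) :=
  (contDiff_cutoff_infty R).mul (contDiff_pderiv (contDiff_hfun hu hρ) i)

/-- `w³` has compact support. [folklore] -/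
theorem hasCompactSupport_w3 (hR : 0 < R) (i : Fin 3) : HasCompactSupport (w3 u R ρ i) :=
  (hasCompactSupport_cutoff hR).mul_right

/-- `w⁴` is smooth. [folklore] -/
theorem contDiff_w4 (hu : ContDiff ℝ ∞ u) (hρ : 0 < ρ) (i : Fin 3) : ContDiff ℝ ∞ (w4 u R ρ i) :=
  ContDiff.sum fun j _ => (contDiff_pderiv (contDiff_cutoff_infty R) j).mul (contDiff_tens hu hρ i j)

/-- `w⁴` vanishes off `B̄(0, 2R)`. [folklore] -/
theorem w4_eq_zero_of_lt (hR : 0 < R) (i : Fin 3) {x : ℝ³} (hx : 2 * R < ‖x‖) : w4 u R ρ i x = 0 :=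
  Finset.sum_eq_zero fun j _ => by rw [pderiv_cutoff_eq_zero_of_lt hR hx j, zero_mul]

/-- `w⁴` has compact support. [folklore] -/
theorem hasCompactSupport_w4 (hR : 0 < R) (i : Fin 3) : HasCompactSupport (w4 u R ρ i) :=
  HasCompactSupport.intro (isCompact_closedBall (0 : ℝ³) (2 * R)) fun x hx => by
    rw [mem_closedBall_zero_iff, not_le] at hx
    exact w4_eq_zero_of_lt hR i hx

/-- `w = w¹ - w² - w³ + w⁴`. [folklore] -/
theorem test_pieces (hu : ContDiff ℝ ∞ u) (hR : 0 < R) (hρ : 0 < ρ) (i : Fin 3) :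
    test u R ρ i = fun x => w1 u R i x - w2 u R ρ i x - w3 u R ρ i x + w4 u R ρ i x := by
  simp only [w1, w2, w3, w4]
  exact test_eq hu hR hρ i

/-! ### Linearity bookkeeping -/

/-- `∫ F (a - b - c + d) = ∫ Fa - ∫ Fb - ∫ Fc + ∫ Fd` for continuous `F` and continuous compactly
supported `a, b, c, d`. [folklore] -/
theorem integral_mul_combo {F a b c d : ℝ³ → ℝ} (hF : Continuous F) (ha : Continuous a)
    (hac : HasCompactSupport a) (hb : Continuous b) (hbc : HasCompactSupport b) (hc : Continuous c)
    (hcc : HasCompactSupport c) (hd : Continuous d) (hdc : HasCompactSupport d) :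
    ∫ x, F x * (a x - b x - c x + d x) =
      (∫ x, F x * a x) - (∫ x, F x * b x) - (∫ x, F x * c x) + ∫ x, F x * d x := by
  have hIa := integrable_mul_of_hasCompactSupport_right hF ha hac
  have hIb := integrable_mul_of_hasCompactSupport_right hF hb hbc
  have hIc := integrable_mul_of_hasCompactSupport_right hF hc hcc
  have hId := integrable_mul_of_hasCompactSupport_right hF hd hdc
  have hIab : Integrable fun x => F x * a x - F x * b x := hIa.sub hIb
  have hIabc : Integrable fun x => F x * a x - F x * b x - F x * c x := hIab.sub hIc
  calc ∫ x, F x * (a x - b x - c x + d x)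
      = ∫ x, (F x * a x - F x * b x - F x * c x) + F x * d x :=
        integral_congr_ae (Eventually.of_forall fun x => by ring)
    _ = (∫ x, F x * a x - F x * b x - F x * c x) + ∫ x, F x * d x := integral_add hIabc hId
    _ = ((∫ x, F x * a x - F x * b x) - ∫ x, F x * c x) + ∫ x, F x * d x := by
        rw [integral_sub hIab hIc]
    _ = _ := by rw [integral_sub hIa hIb]

/-- `∂ⱼ(a - b - c + d) = ∂ⱼa - ∂ⱼb - ∂ⱼc + ∂ⱼd`. [folklore] -/
theorem pderiv_combo {a b c d : ℝ³ → ℝ} (ha : Differentiable ℝ a) (hb : Differentiable ℝ b)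
    (hc : Differentiable ℝ c) (hd : Differentiable ℝ d) (j : Fin 3) :
    pderiv j (fun x => a x - b x - c x + d x) =
      fun x => pderiv j a x - pderiv j b x - pderiv j c x + pderiv j d x := by
  rw [pderiv_add (f := fun x => a x - b x - c x) (g := d) ((ha.sub hb).sub hc) hd,
    pderiv_sub (f := fun x => a x - b x) (g := c) (ha.sub hb) hc, pderiv_sub ha hb]

/-- `V(w) = V(w¹) - V(w²) - V(w³) + V(w⁴)`. [folklore] -/
theorem Vf_pieces (hu : ContDiff ℝ ∞ u) (hR : 0 < R) (hρ : 0 < ρ) :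
    Vf u (test u R ρ) = Vf u (w1 u R) - Vf u (w2 u R ρ) - Vf u (w3 u R ρ) + Vf u (w4 u R ρ) := by
  simp only [Vf, ← Finset.sum_sub_distrib, ← Finset.sum_add_distrib]
  refine Finset.sum_congr rfl fun i _ => Finset.sum_congr rfl fun j _ => ?_
  have h1 := contDiff_w1 hu (R := R) i
  have h2 := contDiff_w2 hu hρ (R := R) i
  have h3 := contDiff_w3 hu hρ (R := R) i
  have h4 := contDiff_w4 hu hρ (R := R) i
  have hp : pderiv j (test u R ρ i) = fun x => pderiv j (w1 u R i) x - pderiv j (w2 u R ρ i) x -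
      pderiv j (w3 u R ρ i) x + pderiv j (w4 u R ρ i) x := by
    rw [test_pieces hu hR hρ i]
    exact pderiv_combo (h1.differentiable (by simp)) (h2.differentiable (by simp))
      (h3.differentiable (by simp)) (h4.differentiable (by simp)) j
  rw [hp]
  exact integral_mul_combo (continuous_pderiv (contDiff_comp hu i) (by simp) j)
    (continuous_pderiv_one (h1.of_le (by norm_cast)) j) (hasCompactSupport_pderiv (hasCompactSupport_w1 hR i) j)
    (continuous_pderiv_one h2 j) (hasCompactSupport_pderiv (hasCompactSupport_w2 hR i) j)
    (continuous_pderiv_one (h3.of_le (by norm_cast)) j) (hasCompactSupport_pderiv (hasCompactSupport_w3 hR i) j)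
    (continuous_pderiv_one (h4.of_le (by norm_cast)) j) (hasCompactSupport_pderiv (hasCompactSupport_w4 hR i) j)

/-- `C(w) = C(w¹) - C(w²) - C(w³) + C(w⁴)`. [folklore] -/
theorem Cf_pieces (hu : ContDiff ℝ ∞ u) (hR : 0 < R) (hρ : 0 < ρ) :
    Cf u (test u R ρ) = Cf u (w1 u R) - Cf u (w2 u R ρ) - Cf u (w3 u R ρ) + Cf u (w4 u R ρ) := by
  simp only [Cf, ← Finset.sum_sub_distrib, ← Finset.sum_add_distrib]
  refine Finset.sum_congr rfl fun i _ => Finset.sum_congr rfl fun j _ => ?_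
  have h1 := contDiff_w1 hu (R := R) i
  have h2 := contDiff_w2 hu hρ (R := R) i
  have h3 := contDiff_w3 hu hρ (R := R) i
  have h4 := contDiff_w4 hu hρ (R := R) i
  rw [test_pieces hu hR hρ i]
  exact integral_mul_combo ((contDiff_comp hu j).continuous.mul
      (continuous_pderiv (contDiff_comp hu i) (by simp) j))
    h1.continuous (hasCompactSupport_w1 hR i) h2.continuous (hasCompactSupport_w2 hR i)
    h3.continuous (hasCompactSupport_w3 hR i) h4.continuous (hasCompactSupport_w4 hR i)

/-! ### The main piece `w¹ = ψu` -/

/-- `V(ψu) = ∫ ψ ∑ᵢⱼ (∂ⱼuᵢ)² + ∑ᵢⱼ ∫ ∂ⱼuᵢ ∂ⱼψ uᵢ`. [folklore] -/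
theorem Vf_w1 (hu : ContDiff ℝ ∞ u) (hR : 0 < R) :
    Vf u (w1 u R) = (∫ x, cutoff R x * ∑ i, ∑ j, pderiv j (fun z => u z i) x ^ 2) +
      ∑ i, ∑ j, ∫ x, pderiv j (fun z => u z i) x * (pderiv j (cutoff R) x * u x i) := by
  have hψ := contDiff_cutoff_infty R
  have hψd : Differentiable ℝ (cutoff (E := ℝ³) R) := hψ.differentiable (by simp)
  have hψc := hasCompactSupport_cutoff (E := ℝ³) hR
  have hui : ∀ i, ContDiff ℝ ∞ fun z : ℝ³ => u z i := fun i => contDiff_comp hu i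
  have hduc : ∀ i j, Continuous (pderiv j fun z : ℝ³ => u z i) := fun i j =>
    continuous_pderiv (hui i) (by simp) j
  have hsq : ∀ i j, Integrable fun x => cutoff R x * pderiv j (fun z => u z i) x ^ 2 := fun i j =>
    integrable_mul_of_hasCompactSupport_left hψ.continuous hψc
      ((hduc i j).pow 2)
  have hI1 : ∀ i j, Integrable fun x =>
      pderiv j (fun z => u z i) x * (pderiv j (cutoff R) x * u x i) := fun i j =>
    integrable_mul_of_hasCompactSupport_right (hduc i j)
      ((continuous_pderiv hψ (by simp) j).mul (hui i).continuous)
      ((hasCompactSupport_pderiv hψc j).mul_right)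
  have hlhs : (∫ x, cutoff R x * ∑ i, ∑ j, pderiv j (fun z => u z i) x ^ 2) =
      ∑ i, ∑ j, ∫ x, cutoff R x * pderiv j (fun z => u z i) x ^ 2 := by
    have hinner : ∀ i, Integrable fun x => ∑ j, cutoff R x * pderiv j (fun z => u z i) x ^ 2 :=
      fun i => integrable_finsetSum _ fun j _ => hsq i j
    calc (∫ x, cutoff R x * ∑ i, ∑ j, pderiv j (fun z => u z i) x ^ 2)
        = ∫ x, ∑ i, ∑ j, cutoff R x * pderiv j (fun z => u z i) x ^ 2 := by
          refine integral_congr_ae (Eventually.of_forall fun x => ?_)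
          simp only [Finset.mul_sum]
      _ = ∑ i, ∫ x, ∑ j, cutoff R x * pderiv j (fun z => u z i) x ^ 2 :=
          integral_finsetSum _ fun i _ => hinner i
      _ = ∑ i, ∑ j, ∫ x, cutoff R x * pderiv j (fun z => u z i) x ^ 2 :=
          Finset.sum_congr rfl fun i _ => integral_finsetSum _ fun j _ => hsq i j
  rw [hlhs, Vf, ← Finset.sum_add_distrib]
  refine Finset.sum_congr rfl fun i _ => ?_
  rw [← Finset.sum_add_distrib]
  refine Finset.sum_congr rfl fun j _ => ?_
  have hp : pderiv j (w1 u R i) = fun x => pderiv j (cutoff R) x * u x i +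
      cutoff R x * pderiv j (fun z => u z i) x :=
    pderiv_mul hψd ((hui i).differentiable (by simp)) j
  rw [hp, ← integral_add (hsq i j) (hI1 i j)]
  exact integral_congr_ae (Eventually.of_forall fun x => by ring)

/-- `2 C(ψu) = -∑ⱼ ∫ ∂ⱼψ uⱼ |u|²` (the convective term against `ψu`, via the trilinear
antisymmetry). [folklore] -/
theorem two_mul_Cf_w1 (hu : ContDiff ℝ ∞ u) (hdiv : ∀ x, ∑ j, pderiv j (fun z => u z j) x = 0)
    (hR : 0 < R) :
    2 * Cf u (w1 u R) = -∑ j, ∫ x, pderiv j (cutoff R) x * u x j * ∑ i, u x i ^ 2 := by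
  have hψ := contDiff_cutoff_infty R
  have hψd : Differentiable ℝ (cutoff (E := ℝ³) R) := hψ.differentiable (by simp)
  have hψc := hasCompactSupport_cutoff (E := ℝ³) hR
  have hui : ∀ i, ContDiff ℝ ∞ fun z : ℝ³ => u z i := fun i => contDiff_comp hu i
  have huc : ∀ i, Continuous fun z : ℝ³ => u z i := fun i => (hui i).continuous
  have hduc : ∀ i j, Continuous (pderiv j fun z : ℝ³ => u z i) := fun i j =>
    continuous_pderiv (hui i) (by simp) j
  have hibp := convective_ibp hu hdiv (fun i => (contDiff_w1 hu (R := R) i).of_le (by norm_cast))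
    (fun i => hasCompactSupport_w1 hR i)
  -- expand `∂ⱼ(ψuᵢ)`
  have hp : ∀ i j, pderiv j (w1 u R i) = fun x => pderiv j (cutoff R) x * u x i +
      cutoff R x * pderiv j (fun z => u z i) x := fun i j =>
    pderiv_mul hψd ((hui i).differentiable (by simp)) j
  have hIa : ∀ i j, Integrable fun x => u x i * u x j * (pderiv j (cutoff R) x * u x i) := fun i j =>
    integrable_mul_of_hasCompactSupport_right ((huc i).mul (huc j))
      ((continuous_pderiv hψ (by simp) j).mul (huc i))
      ((hasCompactSupport_pderiv hψc j).mul_right)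
  have hIb : ∀ i j, Integrable fun x => u x i * u x j * (cutoff R x * pderiv j (fun z => u z i) x) :=
    fun i j => integrable_mul_of_hasCompactSupport_right ((huc i).mul (huc j))
      (hψ.continuous.mul (hduc i j)) (hψc.mul_right)
  have hsplit : ∑ i, ∑ j, ∫ x, u x i * u x j * pderiv j (w1 u R i) x =
      (∑ i, ∑ j, ∫ x, u x i * u x j * (pderiv j (cutoff R) x * u x i)) + Cf u (w1 u R) := by
    rw [Cf, ← Finset.sum_add_distrib]
    refine Finset.sum_congr rfl fun i _ => ?_
    rw [← Finset.sum_add_distrib]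
    refine Finset.sum_congr rfl fun j _ => ?_
    rw [hp i j, ← integral_add (hIa i j)]
    · refine integral_congr_ae (Eventually.of_forall fun x => ?_)
      simp only [w1]; ring
    · have := hIb i j
      refine this.congr (Eventually.of_forall fun x => ?_)
      simp only [w1]; ring
  -- the first sum is `∑ⱼ ∫ ∂ⱼψ uⱼ |u|²`
  have hfirst : ∑ i, ∑ j, ∫ x, u x i * u x j * (pderiv j (cutoff R) x * u x i) =
      ∑ j, ∫ x, pderiv j (cutoff R) x * u x j * ∑ i, u x i ^ 2 := by
    rw [Finset.sum_comm]
    refine Finset.sum_congr rfl fun j _ => ?_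
    calc ∑ i, ∫ x, u x i * u x j * (pderiv j (cutoff R) x * u x i)
        = ∫ x, ∑ i, u x i * u x j * (pderiv j (cutoff R) x * u x i) :=
          (integral_finsetSum _ fun i _ => hIa i j).symm
      _ = ∫ x, pderiv j (cutoff R) x * u x j * ∑ i, u x i ^ 2 := by
          refine integral_congr_ae (Eventually.of_forall fun x => ?_)
          beta_reduce
          rw [Finset.mul_sum]
          exact Finset.sum_congr rfl fun i _ => by ring
  change Cf u (w1 u R) = _ at hibp
  rw [hsplit, hfirst] at hibp
  linarith

/-! ### The piece `w³ = ψ∇h`: no third derivatives of the potential in the viscous pairing -/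

/-- `V(ψ∇h) = ∑ᵢⱼ ∫ ∂ⱼuᵢ ∂ⱼψ ∂ᵢh - ∑ᵢⱼ ∫ ∂ᵢψ ∂ⱼuᵢ ∂ⱼh` (one integration by parts and
`∑ᵢ ∂ᵢ∂ⱼuᵢ = 0`). [folklore] -/
theorem Vf_w3 (hprof : IsLerayProfile 1 0 u p) (hu : ContDiff ℝ ∞ u) (hR : 0 < R) (hρ : 0 < ρ) :
    Vf u (w3 u R ρ) =
      (∑ i, ∑ j, ∫ x, pderiv j (fun z => u z i) x * (pderiv j (cutoff R) x * pderiv i (hfun u R ρ) x)) -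
        ∑ i, ∑ j, ∫ x, pderiv i (cutoff R) x * pderiv j (fun z => u z i) x * pderiv j (hfun u R ρ) x := by
  have hψ := contDiff_cutoff_infty R
  have hψd : Differentiable ℝ (cutoff (E := ℝ³) R) := hψ.differentiable (by simp)
  have hψc := hasCompactSupport_cutoff (E := ℝ³) hR
  have hui : ∀ i, ContDiff ℝ ∞ fun z : ℝ³ => u z i := fun i => contDiff_comp hu i
  have hduc : ∀ i j, Continuous (pderiv j fun z : ℝ³ => u z i) := fun i j =>
    continuous_pderiv (hui i) (by simp) j
  have hh : ContDiff ℝ ∞ (hfun u R ρ) := contDiff_hfun hu hρ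
  have hdh : ∀ i, ContDiff ℝ ∞ (pderiv i (hfun u R ρ)) := fun i => contDiff_pderiv hh i
  have hdhc : ∀ i, Continuous (pderiv i (hfun u R ρ)) := fun i => (hdh i).continuous
  -- expand `∂ⱼ(ψ ∂ᵢh)`
  have hp : ∀ i j, pderiv j (w3 u R ρ i) = fun x => pderiv j (cutoff R) x * pderiv i (hfun u R ρ) x +
      cutoff R x * pderiv j (pderiv i (hfun u R ρ)) x := fun i j =>
    pderiv_mul hψd ((hdh i).differentiable (by simp)) j
  have hIa : ∀ i j, Integrable fun x =>
      pderiv j (fun z => u z i) x * (pderiv j (cutoff R) x * pderiv i (hfun u R ρ) x) := fun i j =>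
    integrable_mul_of_hasCompactSupport_right (hduc i j)
      ((continuous_pderiv hψ (by simp) j).mul (hdhc i)) ((hasCompactSupport_pderiv hψc j).mul_right)
  have hIb : ∀ i j, Integrable fun x =>
      pderiv j (fun z => u z i) x * (cutoff R x * pderiv j (pderiv i (hfun u R ρ)) x) := fun i j =>
    integrable_mul_of_hasCompactSupport_right (hduc i j)
      (hψ.continuous.mul (continuous_pderiv (hdh i) (by simp) j)) (hψc.mul_right)
  -- the second-order term, integrated by parts in `∂ᵢ`
  have hkey : ∀ j, ∑ i, ∫ x, pderiv j (fun z => u z i) x * (cutoff R x * pderiv j (pderiv i (hfun u R ρ)) x)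
      = -∑ i, ∫ x, pderiv i (cutoff R) x * pderiv j (fun z => u z i) x * pderiv j (hfun u R ρ) x := by
    intro j
    -- `∂ⱼ∂ᵢh = ∂ᵢ∂ⱼh`, then move `∂ᵢ` onto `ψ ∂ⱼuᵢ`
    have h1 : ∀ i, ∫ x, pderiv j (fun z => u z i) x * (cutoff R x * pderiv j (pderiv i (hfun u R ρ)) x) =
        -∫ x, (pderiv i (cutoff R) x * pderiv j (fun z => u z i) x +
          cutoff R x * pderiv i (pderiv j (fun z => u z i)) x) * pderiv j (hfun u R ρ) x := by
      intro i
      have hF : ContDiff ℝ 1 fun x => cutoff R x * pderiv j (fun z => u z i) x :=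
        (hψ.mul (contDiff_pderiv (hui i) j)).of_le (by norm_cast)
      have hFc : HasCompactSupport fun x => cutoff R x * pderiv j (fun z => u z i) x := hψc.mul_right
      have hibp := integral_mul_pderiv_eq_neg hF hFc ((hdh j).of_le (by norm_cast)) i
      have hprod : pderiv i (fun x => cutoff R x * pderiv j (fun z => u z i) x) = fun x =>
          pderiv i (cutoff R) x * pderiv j (fun z => u z i) x +
            cutoff R x * pderiv i (pderiv j (fun z => u z i)) x :=
        pderiv_mul hψd ((contDiff_pderiv (hui i) j).differentiable (by simp)) i
      rw [hprod] at hibp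
      rw [pderiv_comm hh j i]
      calc ∫ x, pderiv j (fun z => u z i) x * (cutoff R x * pderiv i (pderiv j (hfun u R ρ)) x)
          = ∫ x, cutoff R x * pderiv j (fun z => u z i) x * pderiv i (pderiv j (hfun u R ρ)) x :=
            integral_congr_ae (Eventually.of_forall fun x => by ring)
        _ = _ := hibp
    simp_rw [h1]
    rw [Finset.sum_neg_distrib]
    congr 1
    have hJa : ∀ i, Integrable fun x =>
        pderiv i (cutoff R) x * pderiv j (fun z => u z i) x * pderiv j (hfun u R ρ) x := fun i =>
      ((((continuous_pderiv hψ (by simp) i).mul (hduc i j)).mul (hdhc j)).integrable_of_hasCompactSupport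
        (((hasCompactSupport_pderiv hψc i).mul_right).mul_right))
    have hJb : ∀ i, Integrable fun x =>
        cutoff R x * pderiv i (pderiv j (fun z => u z i)) x * pderiv j (hfun u R ρ) x := fun i =>
      (((hψ.continuous.mul (continuous_pderiv (contDiff_pderiv (hui i) j) (by simp) i)).mul
        (hdhc j)).integrable_of_hasCompactSupport ((hψc.mul_right).mul_right))
    have hsplit : ∀ i, ∫ x, (pderiv i (cutoff R) x * pderiv j (fun z => u z i) x +
        cutoff R x * pderiv i (pderiv j (fun z => u z i)) x) * pderiv j (hfun u R ρ) x =
        (∫ x, pderiv i (cutoff R) x * pderiv j (fun z => u z i) x * pderiv j (hfun u R ρ) x) +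
          ∫ x, cutoff R x * pderiv i (pderiv j (fun z => u z i)) x * pderiv j (hfun u R ρ) x := by
      intro i
      rw [← integral_add (hJa i) (hJb i)]
      exact integral_congr_ae (Eventually.of_forall fun x => by ring)
    simp_rw [hsplit]
    rw [Finset.sum_add_distrib]
    have hzero : ∑ i, ∫ x, cutoff R x * pderiv i (pderiv j (fun z => u z i)) x * pderiv j (hfun u R ρ) x = 0 := by
      rw [← integral_finsetSum _ fun i _ => hJb i]
      have : (fun x => ∑ i, cutoff R x * pderiv i (pderiv j (fun z => u z i)) x * pderiv j (hfun u R ρ) x) =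
          fun _ => 0 := by
        funext x
        have hs := hprof.sum_pderiv_pderiv_comp_eq_zero hu j x
        calc ∑ i, cutoff R x * pderiv i (pderiv j (fun z => u z i)) x * pderiv j (hfun u R ρ) x
            = cutoff R x * (∑ i, pderiv i (pderiv j (fun z => u z i)) x) * pderiv j (hfun u R ρ) x := by
              rw [Finset.mul_sum, Finset.sum_mul]
          _ = 0 := by rw [hs, mul_zero, zero_mul]
      rw [this, integral_zero]
    rw [hzero, add_zero]
  -- assemble
  rw [Vf]
  have hstep : ∀ i j, ∫ x, pderiv j (fun z => u z i) x * pderiv j (w3 u R ρ i) x =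
      (∫ x, pderiv j (fun z => u z i) x * (pderiv j (cutoff R) x * pderiv i (hfun u R ρ) x)) +
        ∫ x, pderiv j (fun z => u z i) x * (cutoff R x * pderiv j (pderiv i (hfun u R ρ)) x) := by
    intro i j
    rw [hp i j, ← integral_add (hIa i j) (hIb i j)]
    exact integral_congr_ae (Eventually.of_forall fun x => by ring)
  simp_rw [hstep, Finset.sum_add_distrib]
  rw [Finset.sum_comm (f := fun i j => ∫ x, pderiv j (fun z => u z i) x *
    (cutoff R x * pderiv j (pderiv i (hfun u R ρ)) x))]
  simp_rw [hkey]
  rw [Finset.sum_neg_distrib, Finset.sum_comm (f := fun j i =>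
    ∫ x, pderiv i (cutoff R) x * pderiv j (fun z => u z i) x * pderiv j (hfun u R ρ) x)]
  ring

end Energy


section EnergyIdentity

local notation "ℝ³" => EuclideanSpace ℝ (Fin 3)

variable {u : ℝ³ → ℝ³} {p : ℝ³ → ℝ} {R ρ : ℝ}

/-- **The localised energy identity.** For a smooth steady solution, `R > 0` and any scale `ρ > 0`:
`∫ ψ ∑ᵢⱼ (∂ⱼuᵢ)² = -S - C(ψu) + (V + C)(ψΛ) + (V + C)(ψ∇h) - (V + C)(∇ψ·T)` with
`S = ∑ᵢⱼ ∫ ∂ⱼuᵢ ∂ⱼψ uᵢ`. [folklore] -/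
theorem energy_identity (hprof : IsLerayProfile 1 0 u p) (hu : ContDiff ℝ ∞ u) (hR : 0 < R)
    (hρ : 0 < ρ) :
    (∫ x, cutoff R x * ∑ i, ∑ j, pderiv j (fun z => u z i) x ^ 2) =
      -(∑ i, ∑ j, ∫ x, pderiv j (fun z => u z i) x * (pderiv j (cutoff R) x * u x i)) -
        Cf u (w1 u R) + (Vf u (w2 u R ρ) + Cf u (w2 u R ρ)) + (Vf u (w3 u R ρ) + Cf u (w3 u R ρ)) -
        (Vf u (w4 u R ρ) + Cf u (w4 u R ρ)) := by
  have htest := tested_identity hprof hu (fun i => (contDiff_test hu hρ (R := R) i).of_le (by norm_cast))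
    (fun i => hasCompactSupport_test hR i) (sum_pderiv_test_eq_zero hu hρ)
  change Vf u (test u R ρ) + Cf u (test u R ρ) = 0 at htest
  rw [Vf_pieces hu hR hρ, Cf_pieces hu hR hρ, Vf_w1 hu hR] at htest
  linarith

/-- The divergence-free condition of a Leray profile in coordinates. [folklore] -/
theorem divFree_coord (hprof : IsLerayProfile 1 0 u p) (x : ℝ³) :
    ∑ j, pderiv j (fun z => u z j) x = 0 :=
  hprof.sum_pderiv_comp_eq_zero x

end EnergyIdentity

section GenericBounds

local notation "ℝ³" => EuclideanSpace ℝ (Fin 3)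

/-! ### Generic Cauchy–Schwarz bound for the pairings -/

/-- `∫ F G = ∫_S F G` when `G` vanishes off `S`, and then Cauchy–Schwarz on `S`:
`|∫ F G| ≤ √(∫_S F²) √(∫ G²)`. [folklore] -/
theorem abs_integral_mul_le_sqrt {F G : ℝ³ → ℝ} {S : Set ℝ³}
    (hF : Continuous F) (hG : Continuous G) (hGc : HasCompactSupport G)
    (hGS : ∀ x, x ∉ S → G x = 0) (hFS : IntegrableOn (fun x => F x ^ 2) S) :
    |∫ x, F x * G x| ≤ Real.sqrt (∫ x in S, F x ^ 2) * Real.sqrt (∫ x, G x ^ 2) := by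
  have hvan : ∀ x, x ∉ S → F x * G x = 0 := fun x hx => by rw [hGS x hx, mul_zero]
  rw [← setIntegral_eq_integral_of_forall_compl_eq_zero hvan]
  have hF2 : MemLp F 2 (volume.restrict S) :=
    (memLp_two_iff_integrable_sq hF.aestronglyMeasurable).2 hFS
  have hG2 : MemLp G 2 (volume.restrict S) := (hG.memLp_of_hasCompactSupport hGc).restrict S
  have hG2' : Integrable (fun x => G x ^ 2) :=
    (memLp_two_iff_integrable_sq hG.aestronglyMeasurable).1 (hG.memLp_of_hasCompactSupport hGc)
  calc |∫ x in S, F x * G x| ≤ ∫ x in S, |F x * G x| := abs_integral_le_integral_abs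
    _ = ∫ x in S, |F x| * |G x| := integral_congr_ae (Eventually.of_forall fun x => abs_mul _ _)
    _ ≤ Real.sqrt (∫ x in S, F x ^ 2) * Real.sqrt (∫ x in S, G x ^ 2) :=
        integral_abs_mul_abs_le_sqrt hF2 hG2
    _ ≤ Real.sqrt (∫ x in S, F x ^ 2) * Real.sqrt (∫ x, G x ^ 2) := by
        apply mul_le_mul_of_nonneg_left _ (Real.sqrt_nonneg _)
        exact Real.sqrt_le_sqrt
          (setIntegral_le_integral hG2' (Eventually.of_forall fun x => sq_nonneg _))

/-- **Generic bound for a pairing** `∑ᵢⱼ ∫ Fᵢⱼ Gᵢⱼ`: if every `Gᵢⱼ` vanishes off `S`,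
`∫_S Fᵢⱼ² ≤ a²` and `∫ Gᵢⱼ² ≤ b²`, then `|∑ᵢⱼ ∫ Fᵢⱼ Gᵢⱼ| ≤ 9ab`. [folklore] -/
theorem abs_sum_sum_integral_mul_le {F G : Fin 3 → Fin 3 → ℝ³ → ℝ} {S : Set ℝ³}
    (hF : ∀ i j, Continuous (F i j)) (hG : ∀ i j, Continuous (G i j))
    (hGc : ∀ i j, HasCompactSupport (G i j)) (hGS : ∀ i j x, x ∉ S → G i j x = 0)
    (hFS : ∀ i j, IntegrableOn (fun x => F i j x ^ 2) S) {a b : ℝ} (ha : 0 ≤ a) (hb : 0 ≤ b)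
    (haF : ∀ i j, ∫ x in S, F i j x ^ 2 ≤ a ^ 2) (hbG : ∀ i j, ∫ x, G i j x ^ 2 ≤ b ^ 2) :
    |∑ i, ∑ j, ∫ x, F i j x * G i j x| ≤ 9 * a * b := by
  have hterm : ∀ i j, |∫ x, F i j x * G i j x| ≤ a * b := by
    intro i j
    refine (abs_integral_mul_le_sqrt (hF i j) (hG i j) (hGc i j) (hGS i j) (hFS i j)).trans ?_
    rw [← Real.sqrt_sq ha, ← Real.sqrt_sq hb]
    gcongr
    · exact haF i j
    · exact hbG i j
  calc |∑ i, ∑ j, ∫ x, F i j x * G i j x| ≤ ∑ i, |∑ j, ∫ x, F i j x * G i j x| :=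
        Finset.abs_sum_le_sum_abs _ _
    _ ≤ ∑ i, ∑ j, |∫ x, F i j x * G i j x| :=
        Finset.sum_le_sum fun i _ => Finset.abs_sum_le_sum_abs _ _
    _ ≤ ∑ _i : Fin 3, ∑ _j : Fin 3, a * b := Finset.sum_le_sum fun i _ => Finset.sum_le_sum fun j _ => hterm i j
    _ = 9 * a * b := by simp; ring

/-- **Generic sup bound**: if `|G| ≤ M` on `S` and `G = 0` off `S`, then
`|∫ F G| ≤ M ∫_S |F|`. [folklore] -/
theorem abs_integral_mul_le_sup {F G : ℝ³ → ℝ} {S : Set ℝ³} {M : ℝ} (hS : MeasurableSet S)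
    (hGS : ∀ x, x ∉ S → G x = 0) (hGM : ∀ x ∈ S, |G x| ≤ M) (hFS : IntegrableOn F S) :
    |∫ x, F x * G x| ≤ M * ∫ x in S, |F x| := by
  have hvan : ∀ x, x ∉ S → F x * G x = 0 := fun x hx => by rw [hGS x hx, mul_zero]
  rw [← setIntegral_eq_integral_of_forall_compl_eq_zero hvan]
  calc |∫ x in S, F x * G x| ≤ ∫ x in S, |F x * G x| := abs_integral_le_integral_abs
    _ ≤ ∫ x in S, M * |F x| := by
        refine integral_mono_of_nonneg (Eventually.of_forall fun x => abs_nonneg _)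
          (hFS.abs.const_mul M) ?_
        refine (ae_restrict_iff' hS).2 (Eventually.of_forall fun x hx => ?_)
        show |F x * G x| ≤ M * |F x|
        rw [abs_mul, mul_comm]
        exact mul_le_mul_of_nonneg_right (hGM x hx) (abs_nonneg _)
    _ = M * ∫ x in S, |F x| := integral_const_mul _ _

end GenericBounds


section Pointwise

local notation "ℝ³" => EuclideanSpace ℝ (Fin 3)

variable {u : ℝ³ → ℝ³} {R : ℝ}

/-! ### Pointwise bookkeeping: coordinate gradient, components, the annulus -/

/-- The coordinate form of `|∇u|²`: `∑ᵢⱼ (∂ⱼuᵢ)²`. [folklore] -/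
def gradSq (u : ℝ³ → ℝ³) (x : ℝ³) : ℝ := ∑ i, ∑ j, pderiv j (fun z => u z i) x ^ 2

/-- `∑ᵢⱼ (∂ⱼuᵢ)² ≥ 0`. [folklore] -/
theorem gradSq_nonneg (u : ℝ³ → ℝ³) (x : ℝ³) : 0 ≤ gradSq u x :=
  Finset.sum_nonneg fun _ _ => Finset.sum_nonneg fun _ _ => sq_nonneg _

/-- A single squared partial is at most `∑ᵢⱼ (∂ⱼuᵢ)²`. [folklore] -/
theorem sq_pderiv_le_gradSq (u : ℝ³ → ℝ³) (i j : Fin 3) (x : ℝ³) :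
    pderiv j (fun z => u z i) x ^ 2 ≤ gradSq u x := by
  unfold gradSq
  calc pderiv j (fun z => u z i) x ^ 2 ≤ ∑ j', pderiv j' (fun z => u z i) x ^ 2 :=
        Finset.single_le_sum (f := fun j' => pderiv j' (fun z => u z i) x ^ 2)
          (fun _ _ => sq_nonneg _) (Finset.mem_univ j)
    _ ≤ ∑ i', ∑ j', pderiv j' (fun z => u z i') x ^ 2 :=
        Finset.single_le_sum (f := fun i' => ∑ j', pderiv j' (fun z => u z i') x ^ 2)
          (fun _ _ => Finset.sum_nonneg fun _ _ => sq_nonneg _) (Finset.mem_univ i)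

/-- `∑ᵢⱼ (∂ⱼuᵢ)²` is continuous for smooth `u`. [folklore] -/
theorem continuous_gradSq (hu : ContDiff ℝ ∞ u) : Continuous (gradSq u) :=
  continuous_finsetSum _ fun i _ => continuous_finsetSum _ fun j _ =>
    (continuous_pderiv (contDiff_comp hu i) (by simp) j).pow 2

/-- `∑ᵢ vᵢ² = ‖v‖²` on `ℝ³`. [folklore] -/
theorem sum_sq_apply_eq (v : ℝ³) : ∑ i, v i ^ 2 = ‖v‖ ^ 2 :=
  (EuclideanSpace.real_norm_sq_eq v).symm

/-- `vᵢ² ≤ ‖v‖²`. [folklore] -/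
theorem sq_apply_le_norm_sq (v : ℝ³) (i : Fin 3) : v i ^ 2 ≤ ‖v‖ ^ 2 := by
  rw [← sum_sq_apply_eq]
  exact Finset.single_le_sum (f := fun i => v i ^ 2) (fun _ _ => sq_nonneg _) (Finset.mem_univ i)

/-- `|vᵢ| ≤ ‖v‖`. [folklore] -/
theorem abs_apply_le_norm (v : ℝ³) (i : Fin 3) : |v i| ≤ ‖v‖ :=
  abs_le_of_sq_le_sq' (by simpa using sq_apply_le_norm_sq v i) (norm_nonneg _) |>.2 |> fun h =>
    abs_le.2 ⟨(abs_le_of_sq_le_sq' (by simpa using sq_apply_le_norm_sq v i) (norm_nonneg _)).1, h⟩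

/-- The closed annulus `A_R = {R ≤ ‖x‖ ≤ 2R}` carrying the gradient of `ψ_R`. [folklore] -/
def annulus (R : ℝ) : Set ℝ³ := closedBall (0 : ℝ³) (2 * R) \ ball 0 R

/-- The annulus is compact. [folklore] -/
theorem isCompact_annulus (R : ℝ) : IsCompact (annulus R) :=
  (isCompact_closedBall _ _).diff isOpen_ball

/-- The annulus is measurable. [folklore] -/
theorem measurableSet_annulus (R : ℝ) : MeasurableSet (annulus R) :=
  measurableSet_closedBall.diff measurableSet_ball

/-- A point is outside the annulus iff `‖x‖ > 2R` or `‖x‖ < R`. [folklore] -/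
theorem not_mem_annulus_iff {x : ℝ³} : x ∉ annulus R ↔ 2 * R < ‖x‖ ∨ ‖x‖ < R := by
  have e : x ∈ annulus R ↔ ‖x‖ ≤ 2 * R ∧ ¬‖x‖ < R := by
    simp only [annulus, Set.mem_sdiff, mem_closedBall_zero_iff, mem_ball_zero_iff]
  rw [e, not_and_or, not_not, not_le]

/-- The annulus lies in `B̄(0, 2R)`. [folklore] -/
theorem annulus_subset_closedBall (R : ℝ) : annulus R ⊆ closedBall (0 : ℝ³) (2 * R) :=
  sdiff_subset

/-! ### Where the cut-off and its derivatives live -/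

/-- `ψ_R` vanishes off `B̄(0, 2R)`. [folklore] -/
theorem cutoff_eq_zero_of_not_mem_closedBall (hR : 0 < R) {x : ℝ³}
    (hx : x ∉ closedBall (0 : ℝ³) (2 * R)) : cutoff R x = 0 := by
  rw [mem_closedBall_zero_iff, not_le] at hx
  exact cutoff_eq_zero_of_lt hR hx

/-- The partials of `ψ_R` vanish off the annulus. [folklore] -/
theorem pderiv_cutoff_eq_zero_of_not_mem (hR : 0 < R) {x : ℝ³} (hx : x ∉ annulus R) (l : Fin 3) :
    pderiv l (cutoff (E := ℝ³) R) x = 0 := by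
  rcases not_mem_annulus_iff.1 hx with h | h
  · exact pderiv_cutoff_eq_zero_of_lt hR h l
  · exact pderiv_cutoff_eq_zero_of_norm_lt hR h l

/-- Second partials of `ψ_R` also live on the annulus. [folklore] -/
theorem pderiv_pderiv_cutoff_eq_zero_of_not_mem (hR : 0 < R) {x : ℝ³} (hx : x ∉ annulus R)
    (j l : Fin 3) : pderiv j (pderiv l (cutoff (E := ℝ³) R)) x = 0 := by
  have hopen : IsOpen ({y : ℝ³ | 2 * R < ‖y‖} ∪ {y : ℝ³ | ‖y‖ < R}) :=
    (isOpen_lt continuous_const continuous_norm).union (isOpen_lt continuous_norm continuous_const)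
  have hmem : x ∈ {y : ℝ³ | 2 * R < ‖y‖} ∪ {y : ℝ³ | ‖y‖ < R} := by
    rcases not_mem_annulus_iff.1 hx with h | h
    · exact Or.inl h
    · exact Or.inr h
  have heq : pderiv l (cutoff (E := ℝ³) R) =ᶠ[𝓝 x] fun _ => 0 :=
    Filter.eventuallyEq_of_mem (hopen.mem_nhds hmem) fun y hy => by
      rcases hy with h | h
      · exact pderiv_cutoff_eq_zero_of_lt hR h l
      · exact pderiv_cutoff_eq_zero_of_norm_lt hR h l
  rw [pderiv_apply, heq.fderiv_eq, fderiv_const_apply]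
  rfl

/-! ### From operator-norm bounds to bounds on partials -/

/-- A bound on `‖Dχ‖` bounds every partial `∂ₗχ`. [folklore] -/
theorem abs_pderiv_le_of_norm_fderiv_le {χ : ℝ³ → ℝ} {c : ℝ} (h : ∀ x, ‖fderiv ℝ χ x‖ ≤ c)
    (l : Fin 3) (x : ℝ³) : |pderiv l χ x| ≤ c :=
  (abs_pderiv_le_norm_fderiv l χ x).trans (h x)

/-- `∂ⱼ∂ₗχ(x) = D²χ(x)(eⱼ)(eₗ)` for `χ ∈ C²`. [folklore] -/
theorem pderiv_pderiv_eq_fderiv_fderiv {χ : ℝ³ → ℝ} (hχ : ContDiff ℝ 2 χ) (j l : Fin 3) (x : ℝ³) :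
    pderiv j (pderiv l χ) x = fderiv ℝ (fderiv ℝ χ) x (stdVec j) (stdVec l) := by
  have hd : DifferentiableAt ℝ (fderiv ℝ χ) x :=
    ((hχ.fderiv_right (m := 1) le_rfl).differentiable (by simp)) x
  rw [pderiv_apply, pderiv_eq, fderiv_clm_apply hd (differentiableAt_const _)]
  simp

/-- A bound on `‖D²χ‖` bounds every second partial `∂ⱼ∂ₗχ`. [folklore] -/
theorem abs_pderiv_pderiv_le_of_norm_le {χ : ℝ³ → ℝ} (hχ : ContDiff ℝ 2 χ) {c : ℝ}
    (h : ∀ x, ‖fderiv ℝ (fderiv ℝ χ) x‖ ≤ c) (j l : Fin 3) (x : ℝ³) :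
    |pderiv j (pderiv l χ) x| ≤ c := by
  rw [pderiv_pderiv_eq_fderiv_fderiv hχ j l x, ← Real.norm_eq_abs]
  have hj : ‖(stdVec j : ℝ³)‖ = 1 := by simp [stdVec]
  have hl : ‖(stdVec l : ℝ³)‖ = 1 := by simp [stdVec]
  calc ‖fderiv ℝ (fderiv ℝ χ) x (stdVec j) (stdVec l)‖
      ≤ ‖fderiv ℝ (fderiv ℝ χ) x‖ * ‖(stdVec j : ℝ³)‖ * ‖(stdVec l : ℝ³)‖ :=
        ContinuousLinearMap.le_opNorm₂ _ _ _
    _ = ‖fderiv ℝ (fderiv ℝ χ) x‖ := by rw [hj, hl, mul_one, mul_one]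
    _ ≤ c := h x

end Pointwise


section TermBounds

local notation "ℝ³" => EuclideanSpace ℝ (Fin 3)

variable {u : ℝ³ → ℝ³} {p : ℝ³ → ℝ} {R ρ : ℝ}

/-! ### Small integration helpers -/

/-- `∫ G² ≤ ∫_S f` when `G` vanishes off the measurable set `S` and `G² ≤ f` on `S`. [folklore] -/
theorem integral_sq_le_setIntegral {G f : ℝ³ → ℝ} {S : Set ℝ³} (hS : MeasurableSet S)
    (hGS : ∀ x, x ∉ S → G x = 0) (hle : ∀ x ∈ S, G x ^ 2 ≤ f x) (hf : IntegrableOn f S) :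
    ∫ x, G x ^ 2 ≤ ∫ x in S, f x := by
  have hvan : ∀ x, x ∉ S → G x ^ 2 = 0 := fun x hx => by rw [hGS x hx]; ring
  rw [← setIntegral_eq_integral_of_forall_compl_eq_zero hvan]
  refine integral_mono_of_nonneg (Eventually.of_forall fun x => sq_nonneg _) hf ?_
  exact (ae_restrict_iff' hS).2 (Eventually.of_forall fun x hx => hle x hx)

/-- Continuous functions are integrable on compact sets (specialisation). [folklore] -/
theorem integrableOn_of_continuous {f : ℝ³ → ℝ} {S : Set ℝ³} (hS : IsCompact S) (hf : Continuous f) :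
    IntegrableOn f S := hf.continuousOn.integrableOn_compact hS

/-- Monotonicity of set integrals of continuous functions on compact sets. [folklore] -/
theorem setIntegral_mono_of_continuous {f g : ℝ³ → ℝ} {S : Set ℝ³} (hS : IsCompact S)
    (hSm : MeasurableSet S) (hf : Continuous f) (hg : Continuous g) (hle : ∀ x ∈ S, f x ≤ g x) :
    ∫ x in S, f x ≤ ∫ x in S, g x :=
  setIntegral_mono_on (integrableOn_of_continuous hS hf) (integrableOn_of_continuous hS hg) hSm hle

/-- `(uᵢuⱼ)² ≤ ‖u‖⁴`. [folklore] -/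
theorem sq_mul_apply_le (v : ℝ³) (i j : Fin 3) : (v i * v j) ^ 2 ≤ ‖v‖ ^ 4 := by
  rw [mul_pow, show ‖v‖ ^ 4 = ‖v‖ ^ 2 * ‖v‖ ^ 2 by ring]
  exact mul_le_mul (sq_apply_le_norm_sq v i) (sq_apply_le_norm_sq v j) (sq_nonneg _) (sq_nonneg _)

/-! ### The boundary term `S = ∑ᵢⱼ ∫ ∂ⱼuᵢ ∂ⱼψ uᵢ` -/

/-- **Bound for `S`**: `|S| ≤ 9 c₁ √(∫_A |∇u|²) √(∫_A ‖u‖²)`, `A` the annulus carrying `∇ψ_R`,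
`c₁ ≥ ‖∇ψ_R‖_∞`. [folklore] -/
theorem abs_S_le (hu : ContDiff ℝ ∞ u) (hR : 0 < R) {c₁ : ℝ} (hc₁ : 0 ≤ c₁)
    (hψ1 : ∀ x, ‖fderiv ℝ (cutoff (E := ℝ³) R) x‖ ≤ c₁) :
    |∑ i, ∑ j, ∫ x, pderiv j (fun z => u z i) x * (pderiv j (cutoff R) x * u x i)| ≤
      9 * Real.sqrt (∫ x in annulus R, gradSq u x) *
        (c₁ * Real.sqrt (∫ x in annulus R, ‖u x‖ ^ 2)) := by
  have hA := isCompact_annulus R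
  have hAm := measurableSet_annulus R
  have hψ := contDiff_cutoff_infty R
  have hψc := hasCompactSupport_cutoff (E := ℝ³) hR
  have hui : ∀ i, ContDiff ℝ ∞ fun z : ℝ³ => u z i := fun i => contDiff_comp hu i
  have hduc : ∀ i j, Continuous (pderiv j fun z : ℝ³ => u z i) := fun i j =>
    continuous_pderiv (hui i) (by simp) j
  have hDA : 0 ≤ ∫ x in annulus R, gradSq u x := setIntegral_nonneg hAm fun x _ => gradSq_nonneg u x
  have hIA : 0 ≤ ∫ x in annulus R, ‖u x‖ ^ 2 := setIntegral_nonneg hAm fun x _ => sq_nonneg _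
  refine abs_sum_sum_integral_mul_le (S := annulus R)
    (F := fun i j => pderiv j (fun z => u z i)) (G := fun i j x => pderiv j (cutoff R) x * u x i)
    (fun i j => hduc i j)
    (fun i j => (continuous_pderiv hψ (by simp) j).mul (hui i).continuous)
    (fun i j => (hasCompactSupport_pderiv hψc j).mul_right)
    (fun i j x hx => by rw [pderiv_cutoff_eq_zero_of_not_mem hR hx j, zero_mul])
    (fun i j => integrableOn_of_continuous hA ((hduc i j).pow 2))
    (Real.sqrt_nonneg _) (mul_nonneg hc₁ (Real.sqrt_nonneg _)) (fun i j => ?_) (fun i j => ?_)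
  · rw [Real.sq_sqrt hDA]
    exact setIntegral_mono_of_continuous hA hAm ((hduc i j).pow 2) (continuous_gradSq hu)
      fun x _ => sq_pderiv_le_gradSq u i j x
  · rw [mul_pow, Real.sq_sqrt hIA, ← integral_const_mul]
    refine integral_sq_le_setIntegral hAm
      (fun x hx => by rw [pderiv_cutoff_eq_zero_of_not_mem hR hx j, zero_mul]) (fun x _ => ?_)
      ((integrableOn_of_continuous hA (hu.continuous.norm.pow 2)).const_mul _)
    rw [mul_pow]
    have h1 : pderiv j (cutoff R) x ^ 2 ≤ c₁ ^ 2 := by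
      rw [← sq_abs]
      exact pow_le_pow_left₀ (abs_nonneg _) (abs_pderiv_le_of_norm_fderiv_le hψ1 j x) 2
    exact mul_le_mul h1 (sq_apply_le_norm_sq (u x) i) (sq_nonneg _) (sq_nonneg _)

/-! ### The transport term `K = C(ψu)` -/

/-- **Bound for `K = C(ψu)`**: `|K| ≤ (3/2) c₁ ∫_A ‖u‖³`. [folklore] -/
theorem abs_K_le (hprof : IsLerayProfile 1 0 u p) (hu : ContDiff ℝ ∞ u) (hR : 0 < R) {c₁ : ℝ}
    (hc₁ : 0 ≤ c₁) (hψ1 : ∀ x, ‖fderiv ℝ (cutoff (E := ℝ³) R) x‖ ≤ c₁) :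
    |Cf u (w1 u R)| ≤ 3 / 2 * c₁ * ∫ x in annulus R, ‖u x‖ ^ 3 := by
  have hA := isCompact_annulus R
  have hAm := measurableSet_annulus R
  have hui : ∀ i, ContDiff ℝ ∞ fun z : ℝ³ => u z i := fun i => contDiff_comp hu i
  have h2 := two_mul_Cf_w1 hu (divFree_coord hprof) hR
  have hK : Cf u (w1 u R) = -(1 / 2) * ∑ j, ∫ x, pderiv j (cutoff R) x * u x j * ∑ i, u x i ^ 2 := by
    linarith
  rw [hK, abs_mul, abs_neg, abs_of_pos (by norm_num : (0:ℝ) < 1 / 2)]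
  have hterm : ∀ j, |∫ x, pderiv j (cutoff R) x * u x j * ∑ i, u x i ^ 2| ≤
      c₁ * ∫ x in annulus R, ‖u x‖ ^ 3 := by
    intro j
    have hF : Continuous fun x : ℝ³ => u x j * ∑ i, u x i ^ 2 :=
      (hui j).continuous.mul (continuous_finsetSum _ fun i _ => (hui i).continuous.pow 2)
    calc |∫ x, pderiv j (cutoff R) x * u x j * ∑ i, u x i ^ 2|
        = |∫ x, (u x j * ∑ i, u x i ^ 2) * pderiv j (cutoff R) x| := by
          congr 1; exact integral_congr_ae (Eventually.of_forall fun x => by ring)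
      _ ≤ c₁ * ∫ x in annulus R, |u x j * ∑ i, u x i ^ 2| :=
          abs_integral_mul_le_sup hAm (fun x hx => pderiv_cutoff_eq_zero_of_not_mem hR hx j)
            (fun x _ => abs_pderiv_le_of_norm_fderiv_le hψ1 j x) (integrableOn_of_continuous hA hF)
      _ ≤ c₁ * ∫ x in annulus R, ‖u x‖ ^ 3 := by
          refine mul_le_mul_of_nonneg_left ?_ hc₁
          refine setIntegral_mono_of_continuous hA hAm hF.abs (hu.continuous.norm.pow 3) fun x _ => ?_
          rw [abs_mul, sum_sq_apply_eq, abs_of_nonneg (sq_nonneg ‖u x‖),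
            show ‖u x‖ ^ 3 = ‖u x‖ * ‖u x‖ ^ 2 by ring]
          exact mul_le_mul_of_nonneg_right (abs_apply_le_norm (u x) j) (sq_nonneg _)
  calc 1 / 2 * |∑ j, ∫ x, pderiv j (cutoff R) x * u x j * ∑ i, u x i ^ 2|
      ≤ 1 / 2 * ∑ j, |∫ x, pderiv j (cutoff R) x * u x j * ∑ i, u x i ^ 2| :=
        mul_le_mul_of_nonneg_left (Finset.abs_sum_le_sum_abs _ _) (by norm_num)
    _ ≤ 1 / 2 * ∑ _j : Fin 3, c₁ * ∫ x in annulus R, ‖u x‖ ^ 3 :=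
        mul_le_mul_of_nonneg_left (Finset.sum_le_sum fun j _ => hterm j) (by norm_num)
    _ = 3 / 2 * c₁ * ∫ x in annulus R, ‖u x‖ ^ 3 := by simp; ring

end TermBounds


section TermBounds2

local notation "ℝ³" => EuclideanSpace ℝ (Fin 3)

variable {u : ℝ³ → ℝ³} {p : ℝ³ → ℝ} {R ρ : ℝ}

/-- The tensor `Tᵢⱼ` has compact support. [folklore] -/
theorem hasCompactSupport_tens (hR : 0 < R) (hρ : 0 < ρ) (i j : Fin 3) :
    HasCompactSupport (tens u R ρ i j) :=
  (hasCompactSupport_pderiv (hasCompactSupport_pot (u := u) hR hρ i) j).sub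
    (hasCompactSupport_pderiv (hasCompactSupport_pot (u := u) hR hρ j) i)

/-- The scalar `h` has compact support. [folklore] -/
theorem hasCompactSupport_hfun (hR : 0 < R) (hρ : 0 < ρ) : HasCompactSupport (hfun u R ρ) := by
  have : hfun u R ρ = ∑ k, pderiv k (pot u R ρ k) := by
    funext x; simp only [hfun, Finset.sum_apply]
  rw [this]
  exact HasCompactSupport.finset_sum fun k _ => hasCompactSupport_pderiv (hasCompactSupport_pot hR hρ k) k

/-- The real volume of the ball `B̄(0, 2R)`. [folklore] -/
def volB (R : ℝ) : ℝ := (volume (closedBall (0 : ℝ³) (2 * R))).toReal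

/-- `|B̄_{2R}| ≥ 0`. [folklore] -/
theorem volB_nonneg (R : ℝ) : 0 ≤ volB R := ENNReal.toReal_nonneg

/-! ### The smoothing piece `w² = ψΛ` -/

/-- `∫ (∂ⱼ(ψΛᵢ))² ≤ 2 (c₁² L₀² + L₁²) |B̄_{2R}|`. [folklore] -/
theorem integral_sq_pderiv_w2_le (hu : ContDiff ℝ ∞ u) (hR : 0 < R) (hρ : 0 < ρ) {c₁ L₀ L₁ : ℝ}
    (hψ1 : ∀ x, ‖fderiv ℝ (cutoff (E := ℝ³) R) x‖ ≤ c₁)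
    (hL₀ : ∀ i x, |rem u R ρ i x| ≤ L₀) (hL₁ : ∀ i j x, |pderiv j (rem u R ρ i) x| ≤ L₁) (i j : Fin 3) :
    ∫ x, pderiv j (w2 u R ρ i) x ^ 2 ≤ 2 * (c₁ ^ 2 * L₀ ^ 2 + L₁ ^ 2) * volB R := by
  have hψ := contDiff_cutoff_infty R
  have hψd : Differentiable ℝ (cutoff (E := ℝ³) R) := hψ.differentiable (by simp)
  have hp : pderiv j (w2 u R ρ i) = fun x => pderiv j (cutoff R) x * rem u R ρ i x +
      cutoff R x * pderiv j (rem u R ρ i) x :=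
    pderiv_mul hψd ((contDiff_rem_one hu hρ i).differentiable (by simp)) j
  rw [hp]
  have hvan : ∀ x, x ∉ closedBall (0 : ℝ³) (2 * R) →
      pderiv j (cutoff R) x * rem u R ρ i x + cutoff R x * pderiv j (rem u R ρ i) x = 0 := by
    intro x hx
    have hx' : x ∉ annulus R := fun h => hx (annulus_subset_closedBall R h)
    rw [pderiv_cutoff_eq_zero_of_not_mem hR hx' j, cutoff_eq_zero_of_not_mem_closedBall hR hx]
    ring
  calc ∫ x, (pderiv j (cutoff R) x * rem u R ρ i x + cutoff R x * pderiv j (rem u R ρ i) x) ^ 2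
      ≤ ∫ x in closedBall (0 : ℝ³) (2 * R), 2 * (c₁ ^ 2 * L₀ ^ 2 + L₁ ^ 2) := by
        refine integral_sq_le_setIntegral measurableSet_closedBall hvan (fun x _ => ?_)
          (integrableOn_const (measure_closedBall_lt_top).ne)
        have h1 : (pderiv j (cutoff R) x * rem u R ρ i x) ^ 2 ≤ c₁ ^ 2 * L₀ ^ 2 := by
          rw [mul_pow, ← sq_abs (pderiv j _ x), ← sq_abs (rem u R ρ i x)]
          exact mul_le_mul (pow_le_pow_left₀ (abs_nonneg _) (abs_pderiv_le_of_norm_fderiv_le hψ1 j x) 2)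
            (pow_le_pow_left₀ (abs_nonneg _) (hL₀ i x) 2) (sq_nonneg _) (sq_nonneg _)
        have h2 : (cutoff R x * pderiv j (rem u R ρ i) x) ^ 2 ≤ L₁ ^ 2 := by
          rw [mul_pow, ← sq_abs (cutoff R x), ← sq_abs (pderiv j _ x)]
          calc |cutoff R x| ^ 2 * |pderiv j (rem u R ρ i) x| ^ 2 ≤ 1 ^ 2 * L₁ ^ 2 :=
                mul_le_mul (pow_le_pow_left₀ (abs_nonneg _) (abs_cutoff_le_one R x) 2)
                  (pow_le_pow_left₀ (abs_nonneg _) (hL₁ i j x) 2) (sq_nonneg _) (sq_nonneg _)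
            _ = L₁ ^ 2 := by ring
        nlinarith [sq_nonneg (pderiv j (cutoff R) x * rem u R ρ i x - cutoff R x * pderiv j (rem u R ρ i) x)]
    _ = 2 * (c₁ ^ 2 * L₀ ^ 2 + L₁ ^ 2) * volB R := by
        rw [setIntegral_const, volB, smul_eq_mul, mul_comm]
        rfl

/-- **Bounds for `V(ψΛ)` and `C(ψΛ)`.** With `b₂ = √(2(c₁²L₀² + L₁²)|B̄_{2R}|)`:
`|V(ψΛ)| ≤ 9 √(∫_B |∇u|²) b₂` and `|C(ψΛ)| ≤ 9 √(∫_B ‖u‖⁴) b₂`. [folklore] -/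
theorem abs_Vf_w2_add_abs_Cf_w2_le (hprof : IsLerayProfile 1 0 u p) (hu : ContDiff ℝ ∞ u)
    (hR : 0 < R) (hρ : 0 < ρ) {c₁ L₀ L₁ : ℝ} (hψ1 : ∀ x, ‖fderiv ℝ (cutoff (E := ℝ³) R) x‖ ≤ c₁)
    (hL₀ : ∀ i x, |rem u R ρ i x| ≤ L₀) (hL₁ : ∀ i j x, |pderiv j (rem u R ρ i) x| ≤ L₁) :
    |Vf u (w2 u R ρ)| + |Cf u (w2 u R ρ)| ≤
      9 * (Real.sqrt (∫ x in closedBall (0 : ℝ³) (2 * R), gradSq u x) +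
        Real.sqrt (∫ x in closedBall (0 : ℝ³) (2 * R), ‖u x‖ ^ 4)) *
        Real.sqrt (2 * (c₁ ^ 2 * L₀ ^ 2 + L₁ ^ 2) * volB R) := by
  set B := closedBall (0 : ℝ³) (2 * R) with hB
  have hBc : IsCompact B := isCompact_closedBall _ _
  have hBm : MeasurableSet B := measurableSet_closedBall
  have hui : ∀ i, ContDiff ℝ ∞ fun z : ℝ³ => u z i := fun i => contDiff_comp hu i
  have huc : ∀ i, Continuous fun z : ℝ³ => u z i := fun i => (hui i).continuous
  have hduc : ∀ i j, Continuous (pderiv j fun z : ℝ³ => u z i) := fun i j =>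
    continuous_pderiv (hui i) (by simp) j
  have hw2 : ∀ i, ContDiff ℝ 1 (w2 u R ρ i) := fun i => contDiff_w2 hu hρ i
  have hw2c : ∀ i, HasCompactSupport (w2 u R ρ i) := fun i => hasCompactSupport_w2 hR i
  have hGc : ∀ i j, Continuous (pderiv j (w2 u R ρ i)) := fun i j => continuous_pderiv_one (hw2 i) j
  have hGs : ∀ i j, HasCompactSupport (pderiv j (w2 u R ρ i)) := fun i j =>
    hasCompactSupport_pderiv (hw2c i) j
  have hψ := contDiff_cutoff_infty R
  have hψd : Differentiable ℝ (cutoff (E := ℝ³) R) := hψ.differentiable (by simp)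
  have hGS : ∀ i j x, x ∉ B → pderiv j (w2 u R ρ i) x = 0 := by
    intro i j x hx
    have hx' : x ∉ annulus R := fun h => hx (annulus_subset_closedBall R h)
    have hp : pderiv j (w2 u R ρ i) = fun x => pderiv j (cutoff R) x * rem u R ρ i x +
        cutoff R x * pderiv j (rem u R ρ i) x :=
      pderiv_mul hψd ((contDiff_rem_one hu hρ i).differentiable (by simp)) j
    rw [hp]
    show pderiv j (cutoff R) x * rem u R ρ i x + cutoff R x * pderiv j (rem u R ρ i) x = 0
    rw [pderiv_cutoff_eq_zero_of_not_mem hR hx' j, cutoff_eq_zero_of_not_mem_closedBall hR hx]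
    ring
  set bsq := 2 * (c₁ ^ 2 * L₀ ^ 2 + L₁ ^ 2) * volB R with hbsq
  have hbsq0 : 0 ≤ bsq := mul_nonneg (mul_nonneg two_pos.le (by positivity)) (volB_nonneg R)
  have hbG : ∀ i j, ∫ x, pderiv j (w2 u R ρ i) x ^ 2 ≤ Real.sqrt bsq ^ 2 := fun i j => by
    rw [Real.sq_sqrt hbsq0]; exact integral_sq_pderiv_w2_le hu hR hρ hψ1 hL₀ hL₁ i j
  have hDB : 0 ≤ ∫ x in B, gradSq u x := setIntegral_nonneg hBm fun x _ => gradSq_nonneg u x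
  have hIB : 0 ≤ ∫ x in B, ‖u x‖ ^ 4 := setIntegral_nonneg hBm fun x _ => by positivity
  -- the viscous pairing
  have hV : |Vf u (w2 u R ρ)| ≤ 9 * Real.sqrt (∫ x in B, gradSq u x) * Real.sqrt bsq := by
    refine abs_sum_sum_integral_mul_le (S := B) (F := fun i j => pderiv j (fun z => u z i))
      (G := fun i j => pderiv j (w2 u R ρ i)) (fun i j => hduc i j) hGc hGs hGS
      (fun i j => integrableOn_of_continuous hBc ((hduc i j).pow 2)) (Real.sqrt_nonneg _)
      (Real.sqrt_nonneg _) (fun i j => ?_) hbG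
    rw [Real.sq_sqrt hDB]
    exact setIntegral_mono_of_continuous hBc hBm ((hduc i j).pow 2) (continuous_gradSq hu)
      fun x _ => sq_pderiv_le_gradSq u i j x
  -- the convective pairing, after the trilinear integration by parts
  have hC : |Cf u (w2 u R ρ)| ≤ 9 * Real.sqrt (∫ x in B, ‖u x‖ ^ 4) * Real.sqrt bsq := by
    have hibp := convective_ibp hu (divFree_coord hprof) hw2 hw2c
    change Cf u (w2 u R ρ) = _ at hibp
    rw [hibp, abs_neg]
    refine abs_sum_sum_integral_mul_le (S := B) (F := fun i j x => u x i * u x j)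
      (G := fun i j => pderiv j (w2 u R ρ i)) (fun i j => (huc i).mul (huc j)) hGc hGs hGS
      (fun i j => integrableOn_of_continuous hBc (((huc i).mul (huc j)).pow 2)) (Real.sqrt_nonneg _)
      (Real.sqrt_nonneg _) (fun i j => ?_) hbG
    rw [Real.sq_sqrt hIB]
    exact setIntegral_mono_of_continuous hBc hBm (((huc i).mul (huc j)).pow 2)
      (hu.continuous.norm.pow 4) fun x _ => sq_mul_apply_le (u x) i j
  calc |Vf u (w2 u R ρ)| + |Cf u (w2 u R ρ)|
      ≤ 9 * Real.sqrt (∫ x in B, gradSq u x) * Real.sqrt bsq +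
        9 * Real.sqrt (∫ x in B, ‖u x‖ ^ 4) * Real.sqrt bsq := add_le_add hV hC
    _ = _ := by ring

end TermBounds2


section TermBounds3

local notation "ℝ³" => EuclideanSpace ℝ (Fin 3)

variable {u : ℝ³ → ℝ³} {p : ℝ³ → ℝ} {R ρ : ℝ}

/-- `∫ (φ G)² ≤ m² H²` when `|φ| ≤ m` and `∫ G² ≤ H²` (`G` continuous with compact support).
[folklore] -/
theorem integral_sq_mul_le {φ G : ℝ³ → ℝ} {m H : ℝ} (hφ : Continuous φ) (hG : Continuous G)
    (hGc : HasCompactSupport G) (hm : ∀ x, |φ x| ≤ m) (hH : ∫ x, G x ^ 2 ≤ H ^ 2) :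
    ∫ x, (φ x * G x) ^ 2 ≤ m ^ 2 * H ^ 2 := by
  have hI1 : Integrable fun x => (φ x * G x) ^ 2 :=
    ((hφ.mul hG).pow 2).integrable_of_hasCompactSupport
      (hasCompactSupport_pow (φ := fun x => φ x * G x) hGc.mul_left two_ne_zero)
  have hI2 : Integrable fun x => G x ^ 2 :=
    (hG.pow 2).integrable_of_hasCompactSupport (hasCompactSupport_pow hGc two_ne_zero)
  have hm0 : 0 ≤ m := (abs_nonneg _).trans (hm 0)
  calc ∫ x, (φ x * G x) ^ 2 ≤ ∫ x, m ^ 2 * G x ^ 2 := by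
        refine integral_mono hI1 (hI2.const_mul _) fun x => ?_
        show (φ x * G x) ^ 2 ≤ m ^ 2 * G x ^ 2
        rw [mul_pow, ← sq_abs (φ x)]
        exact mul_le_mul_of_nonneg_right (pow_le_pow_left₀ (abs_nonneg _) (hm x) 2) (sq_nonneg _)
    _ = m ^ 2 * ∫ x, G x ^ 2 := integral_const_mul _ _
    _ ≤ m ^ 2 * H ^ 2 := mul_le_mul_of_nonneg_left hH (sq_nonneg _)

/-! ### The gradient piece `w³ = ψ∇h` -/

/-- **Bounds for `V(ψ∇h)` and `C(ψ∇h)`.** With `H₁² ≥ ∫ (∂ᵢh)²`, `H₂² ≥ ∫ (∂ⱼ∂ᵢh)²`: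
`|V(ψ∇h)| + |C(ψ∇h)| ≤ 18 c₁H₁ √(∫_A |∇u|²) + 9 c₁H₁ √(∫_A ‖u‖⁴) + 9 H₂ √(∫_B ‖u‖⁴)`. [folklore] -/
theorem abs_Vf_w3_add_abs_Cf_w3_le (hprof : IsLerayProfile 1 0 u p) (hu : ContDiff ℝ ∞ u)
    (hR : 0 < R) (hρ : 0 < ρ) {c₁ H₁ H₂ : ℝ} (hc₁ : 0 ≤ c₁) (hH₁ : 0 ≤ H₁) (hH₂ : 0 ≤ H₂)
    (hψ1 : ∀ x, ‖fderiv ℝ (cutoff (E := ℝ³) R) x‖ ≤ c₁)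
    (hH1 : ∀ i, ∫ x, pderiv i (hfun u R ρ) x ^ 2 ≤ H₁ ^ 2)
    (hH2 : ∀ i j, ∫ x, pderiv j (pderiv i (hfun u R ρ)) x ^ 2 ≤ H₂ ^ 2) :
    |Vf u (w3 u R ρ)| + |Cf u (w3 u R ρ)| ≤
      18 * c₁ * H₁ * Real.sqrt (∫ x in annulus R, gradSq u x) +
        9 * c₁ * H₁ * Real.sqrt (∫ x in annulus R, ‖u x‖ ^ 4) +
        9 * H₂ * Real.sqrt (∫ x in closedBall (0 : ℝ³) (2 * R), ‖u x‖ ^ 4) := by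
  set A := annulus R with hAdef
  set B := closedBall (0 : ℝ³) (2 * R) with hBdef
  have hA : IsCompact A := isCompact_annulus R
  have hAm : MeasurableSet A := measurableSet_annulus R
  have hBc : IsCompact B := isCompact_closedBall _ _
  have hBm : MeasurableSet B := measurableSet_closedBall
  have hψ := contDiff_cutoff_infty R
  have hψd : Differentiable ℝ (cutoff (E := ℝ³) R) := hψ.differentiable (by simp)
  have hψc := hasCompactSupport_cutoff (E := ℝ³) hR
  have hdψc : ∀ j, Continuous (pderiv j (cutoff (E := ℝ³) R)) := fun j => continuous_pderiv hψ (by simp) j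
  have hui : ∀ i, ContDiff ℝ ∞ fun z : ℝ³ => u z i := fun i => contDiff_comp hu i
  have huc : ∀ i, Continuous fun z : ℝ³ => u z i := fun i => (hui i).continuous
  have hduc : ∀ i j, Continuous (pderiv j fun z : ℝ³ => u z i) := fun i j =>
    continuous_pderiv (hui i) (by simp) j
  have hh : ContDiff ℝ ∞ (hfun u R ρ) := contDiff_hfun hu hρ
  have hhc : HasCompactSupport (hfun u R ρ) := hasCompactSupport_hfun hR hρ
  have hdh : ∀ i, ContDiff ℝ ∞ (pderiv i (hfun u R ρ)) := fun i => contDiff_pderiv hh i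
  have hdhc : ∀ i, Continuous (pderiv i (hfun u R ρ)) := fun i => (hdh i).continuous
  have hdhs : ∀ i, HasCompactSupport (pderiv i (hfun u R ρ)) := fun i => hasCompactSupport_pderiv hhc i
  have hddhc : ∀ i j, Continuous (pderiv j (pderiv i (hfun u R ρ))) := fun i j =>
    continuous_pderiv (hdh i) (by simp) j
  have hddhs : ∀ i j, HasCompactSupport (pderiv j (pderiv i (hfun u R ρ))) := fun i j =>
    hasCompactSupport_pderiv (hdhs i) j
  have hDA : 0 ≤ ∫ x in A, gradSq u x := setIntegral_nonneg hAm fun x _ => gradSq_nonneg u x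
  have hIA : 0 ≤ ∫ x in A, ‖u x‖ ^ 4 := setIntegral_nonneg hAm fun x _ => by positivity
  have hIB : 0 ≤ ∫ x in B, ‖u x‖ ^ 4 := setIntegral_nonneg hBm fun x _ => by positivity
  -- F-side bounds
  have hFgrad : ∀ i j, ∫ x in A, pderiv j (fun z => u z i) x ^ 2 ≤ Real.sqrt (∫ x in A, gradSq u x) ^ 2 := by
    intro i j; rw [Real.sq_sqrt hDA]
    exact setIntegral_mono_of_continuous hA hAm ((hduc i j).pow 2) (continuous_gradSq hu)
      fun x _ => sq_pderiv_le_gradSq u i j x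
  have hFuA : ∀ i j, ∫ x in A, (u x i * u x j) ^ 2 ≤ Real.sqrt (∫ x in A, ‖u x‖ ^ 4) ^ 2 := by
    intro i j; rw [Real.sq_sqrt hIA]
    exact setIntegral_mono_of_continuous hA hAm (((huc i).mul (huc j)).pow 2)
      (hu.continuous.norm.pow 4) fun x _ => sq_mul_apply_le (u x) i j
  have hFuB : ∀ i j, ∫ x in B, (u x i * u x j) ^ 2 ≤ Real.sqrt (∫ x in B, ‖u x‖ ^ 4) ^ 2 := by
    intro i j; rw [Real.sq_sqrt hIB]
    exact setIntegral_mono_of_continuous hBc hBm (((huc i).mul (huc j)).pow 2)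
      (hu.continuous.norm.pow 4) fun x _ => sq_mul_apply_le (u x) i j
  -- G-side bounds: `ψ_j ∂_i h` type fields
  have hG1 : ∀ i j, ∫ x, (pderiv j (cutoff R) x * pderiv i (hfun u R ρ) x) ^ 2 ≤ (c₁ * H₁) ^ 2 := by
    intro i j; rw [mul_pow]
    exact integral_sq_mul_le (hdψc j) (hdhc i) (hdhs i) (fun x => abs_pderiv_le_of_norm_fderiv_le hψ1 j x) (hH1 i)
  have hG2 : ∀ i j, ∫ x, (cutoff R x * pderiv j (pderiv i (hfun u R ρ)) x) ^ 2 ≤ H₂ ^ 2 := by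
    intro i j
    have := integral_sq_mul_le hψ.continuous (hddhc i j) (hddhs i j) (abs_cutoff_le_one R) (hH2 i j)
    simpa using this
  -- the viscous pairing: two annular sums
  have hV : |Vf u (w3 u R ρ)| ≤ 18 * c₁ * H₁ * Real.sqrt (∫ x in A, gradSq u x) := by
    rw [Vf_w3 hprof hu hR hρ]
    have hS1 : |∑ i, ∑ j, ∫ x, pderiv j (fun z => u z i) x * (pderiv j (cutoff R) x * pderiv i (hfun u R ρ) x)|
        ≤ 9 * Real.sqrt (∫ x in A, gradSq u x) * (c₁ * H₁) :=
      abs_sum_sum_integral_mul_le (S := A) (F := fun i j => pderiv j (fun z => u z i))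
        (G := fun i j x => pderiv j (cutoff R) x * pderiv i (hfun u R ρ) x) (fun i j => hduc i j)
        (fun i j => (hdψc j).mul (hdhc i)) (fun i j => (hasCompactSupport_pderiv hψc j).mul_right)
        (fun i j x hx => by show pderiv j (cutoff R) x * _ = 0; rw [pderiv_cutoff_eq_zero_of_not_mem hR hx j, zero_mul])
        (fun i j => integrableOn_of_continuous hA ((hduc i j).pow 2)) (Real.sqrt_nonneg _)
        (mul_nonneg hc₁ hH₁) hFgrad hG1
    have hS2 : |∑ i, ∑ j, ∫ x, pderiv i (cutoff R) x * pderiv j (fun z => u z i) x * pderiv j (hfun u R ρ) x|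
        ≤ 9 * Real.sqrt (∫ x in A, gradSq u x) * (c₁ * H₁) := by
      have heq : ∀ i j, ∫ x, pderiv i (cutoff R) x * pderiv j (fun z => u z i) x * pderiv j (hfun u R ρ) x =
          ∫ x, pderiv j (fun z => u z i) x * (pderiv i (cutoff R) x * pderiv j (hfun u R ρ) x) := fun i j =>
        integral_congr_ae (Eventually.of_forall fun x => by ring)
      simp_rw [heq]
      exact abs_sum_sum_integral_mul_le (S := A) (F := fun i j => pderiv j (fun z => u z i))
        (G := fun i j x => pderiv i (cutoff R) x * pderiv j (hfun u R ρ) x) (fun i j => hduc i j)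
        (fun i j => (hdψc i).mul (hdhc j)) (fun i j => (hasCompactSupport_pderiv hψc i).mul_right)
        (fun i j x hx => by show pderiv i (cutoff R) x * _ = 0; rw [pderiv_cutoff_eq_zero_of_not_mem hR hx i, zero_mul])
        (fun i j => integrableOn_of_continuous hA ((hduc i j).pow 2)) (Real.sqrt_nonneg _)
        (mul_nonneg hc₁ hH₁) hFgrad (fun i j => hG1 j i)
    calc |(∑ i, ∑ j, ∫ x, pderiv j (fun z => u z i) x * (pderiv j (cutoff R) x * pderiv i (hfun u R ρ) x)) -
          ∑ i, ∑ j, ∫ x, pderiv i (cutoff R) x * pderiv j (fun z => u z i) x * pderiv j (hfun u R ρ) x|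
        ≤ |∑ i, ∑ j, ∫ x, pderiv j (fun z => u z i) x * (pderiv j (cutoff R) x * pderiv i (hfun u R ρ) x)| +
          |∑ i, ∑ j, ∫ x, pderiv i (cutoff R) x * pderiv j (fun z => u z i) x * pderiv j (hfun u R ρ) x| :=
          abs_sub _ _
      _ ≤ 9 * Real.sqrt (∫ x in A, gradSq u x) * (c₁ * H₁) + 9 * Real.sqrt (∫ x in A, gradSq u x) * (c₁ * H₁) :=
          add_le_add hS1 hS2
      _ = 18 * c₁ * H₁ * Real.sqrt (∫ x in A, gradSq u x) := by ring
  -- the convective pairing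
  have hC : |Cf u (w3 u R ρ)| ≤ 9 * c₁ * H₁ * Real.sqrt (∫ x in A, ‖u x‖ ^ 4) +
      9 * H₂ * Real.sqrt (∫ x in B, ‖u x‖ ^ 4) := by
    have hw3 : ∀ i, ContDiff ℝ 1 (w3 u R ρ i) := fun i => (contDiff_w3 hu hρ i).of_le (by norm_cast)
    have hw3c : ∀ i, HasCompactSupport (w3 u R ρ i) := fun i => hasCompactSupport_w3 hR i
    have hibp := convective_ibp hu (divFree_coord hprof) hw3 hw3c
    change Cf u (w3 u R ρ) = _ at hibp
    rw [hibp, abs_neg]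
    have hp : ∀ i j, pderiv j (w3 u R ρ i) = fun x => pderiv j (cutoff R) x * pderiv i (hfun u R ρ) x +
        cutoff R x * pderiv j (pderiv i (hfun u R ρ)) x := fun i j =>
      pderiv_mul hψd ((hdh i).differentiable (by simp)) j
    have hIa : ∀ i j, Integrable fun x => u x i * u x j * (pderiv j (cutoff R) x * pderiv i (hfun u R ρ) x) :=
      fun i j => integrable_mul_of_hasCompactSupport_right ((huc i).mul (huc j)) ((hdψc j).mul (hdhc i))
        ((hasCompactSupport_pderiv hψc j).mul_right)
    have hIb : ∀ i j, Integrable fun x => u x i * u x j * (cutoff R x * pderiv j (pderiv i (hfun u R ρ)) x) :=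
      fun i j => integrable_mul_of_hasCompactSupport_right ((huc i).mul (huc j)) (hψ.continuous.mul (hddhc i j))
        (hψc.mul_right)
    have hsplit : ∑ i, ∑ j, ∫ x, u x i * u x j * pderiv j (w3 u R ρ i) x =
        (∑ i, ∑ j, ∫ x, u x i * u x j * (pderiv j (cutoff R) x * pderiv i (hfun u R ρ) x)) +
          ∑ i, ∑ j, ∫ x, u x i * u x j * (cutoff R x * pderiv j (pderiv i (hfun u R ρ)) x) := by
      rw [← Finset.sum_add_distrib]
      refine Finset.sum_congr rfl fun i _ => ?_
      rw [← Finset.sum_add_distrib]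
      refine Finset.sum_congr rfl fun j _ => ?_
      rw [hp i j, ← integral_add (hIa i j) (hIb i j)]
      exact integral_congr_ae (Eventually.of_forall fun x => by ring)
    rw [hsplit]
    have hT1 : |∑ i, ∑ j, ∫ x, u x i * u x j * (pderiv j (cutoff R) x * pderiv i (hfun u R ρ) x)|
        ≤ 9 * Real.sqrt (∫ x in A, ‖u x‖ ^ 4) * (c₁ * H₁) :=
      abs_sum_sum_integral_mul_le (S := A) (F := fun i j x => u x i * u x j)
        (G := fun i j x => pderiv j (cutoff R) x * pderiv i (hfun u R ρ) x) (fun i j => (huc i).mul (huc j))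
        (fun i j => (hdψc j).mul (hdhc i)) (fun i j => (hasCompactSupport_pderiv hψc j).mul_right)
        (fun i j x hx => by show pderiv j (cutoff R) x * _ = 0; rw [pderiv_cutoff_eq_zero_of_not_mem hR hx j, zero_mul])
        (fun i j => integrableOn_of_continuous hA (((huc i).mul (huc j)).pow 2)) (Real.sqrt_nonneg _)
        (mul_nonneg hc₁ hH₁) hFuA hG1
    have hT2 : |∑ i, ∑ j, ∫ x, u x i * u x j * (cutoff R x * pderiv j (pderiv i (hfun u R ρ)) x)|
        ≤ 9 * Real.sqrt (∫ x in B, ‖u x‖ ^ 4) * H₂ :=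
      abs_sum_sum_integral_mul_le (S := B) (F := fun i j x => u x i * u x j)
        (G := fun i j x => cutoff R x * pderiv j (pderiv i (hfun u R ρ)) x) (fun i j => (huc i).mul (huc j))
        (fun i j => hψ.continuous.mul (hddhc i j)) (fun i j => hψc.mul_right)
        (fun i j x hx => by show cutoff R x * _ = 0; rw [cutoff_eq_zero_of_not_mem_closedBall hR hx, zero_mul])
        (fun i j => integrableOn_of_continuous hBc (((huc i).mul (huc j)).pow 2)) (Real.sqrt_nonneg _)
        hH₂ hFuB hG2
    calc _ ≤ |∑ i, ∑ j, ∫ x, u x i * u x j * (pderiv j (cutoff R) x * pderiv i (hfun u R ρ) x)| +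
          |∑ i, ∑ j, ∫ x, u x i * u x j * (cutoff R x * pderiv j (pderiv i (hfun u R ρ)) x)| := abs_add_le _ _
      _ ≤ _ := add_le_add hT1 hT2
      _ = _ := by ring
  linarith

end TermBounds3


section TermBounds4

local notation "ℝ³" => EuclideanSpace ℝ (Fin 3)

variable {u : ℝ³ → ℝ³} {p : ℝ³ → ℝ} {R ρ : ℝ}

/-! ### The corrector piece `w⁴ = ∑ⱼ ∂ⱼψ Tᵢⱼ` -/

/-- `∂ⱼw⁴ᵢ = ∑ₖ (∂ⱼ∂ₖψ Tᵢₖ + ∂ₖψ ∂ⱼTᵢₖ)`. [folklore] -/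
theorem pderiv_w4 (hu : ContDiff ℝ ∞ u) (hρ : 0 < ρ) (i j : Fin 3) :
    pderiv j (w4 u R ρ i) = fun x => ∑ k, (pderiv j (pderiv k (cutoff R)) x * tens u R ρ i k x +
      pderiv k (cutoff R) x * pderiv j (tens u R ρ i k) x) := by
  have hψ := contDiff_cutoff_infty R
  have hdψ : ∀ k, Differentiable ℝ (pderiv k (cutoff (E := ℝ³) R)) := fun k =>
    (contDiff_pderiv hψ k).differentiable (by simp)
  have hT : ∀ k, Differentiable ℝ (tens u R ρ i k) := fun k =>
    (contDiff_tens hu hρ i k).differentiable (by simp)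
  have hw : w4 u R ρ i = fun x => ∑ k, pderiv k (cutoff R) x * tens u R ρ i k x := rfl
  rw [hw, pderiv_sum (f := fun k x => pderiv k (cutoff R) x * tens u R ρ i k x) Finset.univ
    (fun k _ => (hdψ k).mul (hT k))]
  funext x
  refine Finset.sum_congr rfl fun k _ => ?_
  rw [pderiv_mul (hdψ k) (hT k) j]

/-- `∫ (∂ⱼw⁴ᵢ)² ≤ 18 (c₂² T₀² + c₁² T₁²)`. [folklore] -/
theorem integral_sq_pderiv_w4_le (hu : ContDiff ℝ ∞ u) (hR : 0 < R) (hρ : 0 < ρ) {c₁ c₂ T₀ T₁ : ℝ}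
    (hψ1 : ∀ x, ‖fderiv ℝ (cutoff (E := ℝ³) R) x‖ ≤ c₁)
    (hψ2 : ∀ x, ‖fderiv ℝ (fderiv ℝ (cutoff (E := ℝ³) R)) x‖ ≤ c₂)
    (hT0 : ∀ i k, ∫ x, tens u R ρ i k x ^ 2 ≤ T₀ ^ 2)
    (hT1 : ∀ i j k, ∫ x, pderiv j (tens u R ρ i k) x ^ 2 ≤ T₁ ^ 2) (i j : Fin 3) :
    ∫ x, pderiv j (w4 u R ρ i) x ^ 2 ≤ 18 * (c₂ ^ 2 * T₀ ^ 2 + c₁ ^ 2 * T₁ ^ 2) := by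
  have hψ := contDiff_cutoff_infty R
  have hψ2' : ContDiff ℝ 2 (cutoff (E := ℝ³) R) := hψ.of_le (by norm_cast)
  have hTc : ∀ k, Continuous (tens u R ρ i k) := fun k => (contDiff_tens hu hρ i k).continuous
  have hTs : ∀ k, HasCompactSupport (tens u R ρ i k) := fun k => hasCompactSupport_tens hR hρ i k
  have hdTc : ∀ k, Continuous (pderiv j (tens u R ρ i k)) := fun k =>
    continuous_pderiv (contDiff_tens hu hρ i k) (by simp) j
  have hdTs : ∀ k, HasCompactSupport (pderiv j (tens u R ρ i k)) := fun k =>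
    hasCompactSupport_pderiv (hTs k) j
  have hI1 : ∀ k, Integrable fun x => tens u R ρ i k x ^ 2 := fun k =>
    ((hTc k).pow 2).integrable_of_hasCompactSupport (hasCompactSupport_pow (hTs k) two_ne_zero)
  have hI2 : ∀ k, Integrable fun x => pderiv j (tens u R ρ i k) x ^ 2 := fun k =>
    ((hdTc k).pow 2).integrable_of_hasCompactSupport (hasCompactSupport_pow (hdTs k) two_ne_zero)
  -- pointwise bound
  have hpt : ∀ x, pderiv j (w4 u R ρ i) x ^ 2 ≤
      ∑ k, (6 * c₂ ^ 2 * tens u R ρ i k x ^ 2 + 6 * c₁ ^ 2 * pderiv j (tens u R ρ i k) x ^ 2) := by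
    intro x
    rw [pderiv_w4 hu hρ i j]
    set a : Fin 3 → ℝ := fun k => pderiv j (pderiv k (cutoff R)) x * tens u R ρ i k x with ha
    set b : Fin 3 → ℝ := fun k => pderiv k (cutoff R) x * pderiv j (tens u R ρ i k) x with hb
    have hak : ∀ k, a k ^ 2 ≤ c₂ ^ 2 * tens u R ρ i k x ^ 2 := by
      intro k
      simp only [ha, mul_pow]
      rw [← sq_abs (pderiv j _ x)]
      exact mul_le_mul_of_nonneg_right
        (pow_le_pow_left₀ (abs_nonneg _) (abs_pderiv_pderiv_le_of_norm_le hψ2' hψ2 j k x) 2) (sq_nonneg _)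
    have hbk : ∀ k, b k ^ 2 ≤ c₁ ^ 2 * pderiv j (tens u R ρ i k) x ^ 2 := by
      intro k
      simp only [hb, mul_pow]
      rw [← sq_abs (pderiv k _ x)]
      exact mul_le_mul_of_nonneg_right
        (pow_le_pow_left₀ (abs_nonneg _) (abs_pderiv_le_of_norm_fderiv_le hψ1 k x) 2) (sq_nonneg _)
    have hcs : (∑ k, (a k + b k)) ^ 2 ≤ 3 * ∑ k, (a k + b k) ^ 2 := by
      have := sq_sum_le_card_mul_sum_sq (s := (Finset.univ : Finset (Fin 3))) (f := fun k => a k + b k)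
      simpa using this
    calc (∑ k, (a k + b k)) ^ 2 ≤ 3 * ∑ k, (a k + b k) ^ 2 := hcs
      _ ≤ 3 * ∑ k, (2 * a k ^ 2 + 2 * b k ^ 2) := by
          refine mul_le_mul_of_nonneg_left (Finset.sum_le_sum fun k _ => ?_) (by norm_num)
          nlinarith [sq_nonneg (a k - b k)]
      _ ≤ 3 * ∑ k, (2 * (c₂ ^ 2 * tens u R ρ i k x ^ 2) + 2 * (c₁ ^ 2 * pderiv j (tens u R ρ i k) x ^ 2)) := by
          refine mul_le_mul_of_nonneg_left (Finset.sum_le_sum fun k _ => ?_) (by norm_num)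
          linarith [hak k, hbk k]
      _ = ∑ k, (6 * c₂ ^ 2 * tens u R ρ i k x ^ 2 + 6 * c₁ ^ 2 * pderiv j (tens u R ρ i k) x ^ 2) := by
          rw [Finset.mul_sum]
          exact Finset.sum_congr rfl fun k _ => by ring
  have hIk : ∀ k, Integrable fun x => 6 * c₂ ^ 2 * tens u R ρ i k x ^ 2 +
      6 * c₁ ^ 2 * pderiv j (tens u R ρ i k) x ^ 2 := fun k =>
    ((hI1 k).const_mul _).add ((hI2 k).const_mul _)
  have hIsum : Integrable fun x => ∑ k, (6 * c₂ ^ 2 * tens u R ρ i k x ^ 2 +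
      6 * c₁ ^ 2 * pderiv j (tens u R ρ i k) x ^ 2) :=
    integrable_finsetSum _ fun k _ => hIk k
  have hw4 : ContDiff ℝ 1 (w4 u R ρ i) := (contDiff_w4 hu hρ i).of_le (by norm_cast)
  have hIw : Integrable fun x => pderiv j (w4 u R ρ i) x ^ 2 :=
    ((continuous_pderiv_one hw4 j).pow 2).integrable_of_hasCompactSupport
      (hasCompactSupport_pow (hasCompactSupport_pderiv (hasCompactSupport_w4 hR i) j) two_ne_zero)
  calc ∫ x, pderiv j (w4 u R ρ i) x ^ 2
      ≤ ∫ x, ∑ k, (6 * c₂ ^ 2 * tens u R ρ i k x ^ 2 + 6 * c₁ ^ 2 * pderiv j (tens u R ρ i k) x ^ 2) :=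
        integral_mono hIw hIsum hpt
    _ = ∑ k, ∫ x, (6 * c₂ ^ 2 * tens u R ρ i k x ^ 2 + 6 * c₁ ^ 2 * pderiv j (tens u R ρ i k) x ^ 2) :=
        integral_finsetSum _ fun k _ => hIk k
    _ = ∑ k, ((6 * c₂ ^ 2 * ∫ x, tens u R ρ i k x ^ 2) + 6 * c₁ ^ 2 * ∫ x, pderiv j (tens u R ρ i k) x ^ 2) := by
        refine Finset.sum_congr rfl fun k _ => ?_
        rw [integral_add ((hI1 k).const_mul _) ((hI2 k).const_mul _), integral_const_mul, integral_const_mul]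
    _ ≤ ∑ _k : Fin 3, (6 * c₂ ^ 2 * T₀ ^ 2 + 6 * c₁ ^ 2 * T₁ ^ 2) := by
        refine Finset.sum_le_sum fun k _ => add_le_add ?_ ?_
        · exact mul_le_mul_of_nonneg_left (hT0 i k) (by positivity)
        · exact mul_le_mul_of_nonneg_left (hT1 i j k) (by positivity)
    _ = 18 * (c₂ ^ 2 * T₀ ^ 2 + c₁ ^ 2 * T₁ ^ 2) := by simp; ring

/-- **Bounds for `V(w⁴)` and `C(w⁴)`.** With `b₄ = √(18 (c₂²T₀² + c₁²T₁²))`: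
`|V(w⁴)| + |C(w⁴)| ≤ 9 (√(∫_A |∇u|²) + √(∫_A ‖u‖⁴)) b₄`. [folklore] -/
theorem abs_Vf_w4_add_abs_Cf_w4_le (hprof : IsLerayProfile 1 0 u p) (hu : ContDiff ℝ ∞ u)
    (hR : 0 < R) (hρ : 0 < ρ) {c₁ c₂ T₀ T₁ : ℝ}
    (hψ1 : ∀ x, ‖fderiv ℝ (cutoff (E := ℝ³) R) x‖ ≤ c₁)
    (hψ2 : ∀ x, ‖fderiv ℝ (fderiv ℝ (cutoff (E := ℝ³) R)) x‖ ≤ c₂)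
    (hT0 : ∀ i k, ∫ x, tens u R ρ i k x ^ 2 ≤ T₀ ^ 2)
    (hT1 : ∀ i j k, ∫ x, pderiv j (tens u R ρ i k) x ^ 2 ≤ T₁ ^ 2) :
    |Vf u (w4 u R ρ)| + |Cf u (w4 u R ρ)| ≤
      9 * (Real.sqrt (∫ x in annulus R, gradSq u x) + Real.sqrt (∫ x in annulus R, ‖u x‖ ^ 4)) *
        Real.sqrt (18 * (c₂ ^ 2 * T₀ ^ 2 + c₁ ^ 2 * T₁ ^ 2)) := by
  set A := annulus R with hAdef
  have hA : IsCompact A := isCompact_annulus R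
  have hAm : MeasurableSet A := measurableSet_annulus R
  have hui : ∀ i, ContDiff ℝ ∞ fun z : ℝ³ => u z i := fun i => contDiff_comp hu i
  have huc : ∀ i, Continuous fun z : ℝ³ => u z i := fun i => (hui i).continuous
  have hduc : ∀ i j, Continuous (pderiv j fun z : ℝ³ => u z i) := fun i j =>
    continuous_pderiv (hui i) (by simp) j
  have hw4 : ∀ i, ContDiff ℝ 1 (w4 u R ρ i) := fun i => (contDiff_w4 hu hρ i).of_le (by norm_cast)
  have hw4c : ∀ i, HasCompactSupport (w4 u R ρ i) := fun i => hasCompactSupport_w4 hR i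
  have hGc : ∀ i j, Continuous (pderiv j (w4 u R ρ i)) := fun i j => continuous_pderiv_one (hw4 i) j
  have hGs : ∀ i j, HasCompactSupport (pderiv j (w4 u R ρ i)) := fun i j =>
    hasCompactSupport_pderiv (hw4c i) j
  have hGS : ∀ i j x, x ∉ A → pderiv j (w4 u R ρ i) x = 0 := by
    intro i j x hx
    rw [pderiv_w4 hu hρ i j]
    refine Finset.sum_eq_zero fun k _ => ?_
    rw [pderiv_pderiv_cutoff_eq_zero_of_not_mem hR hx j k, pderiv_cutoff_eq_zero_of_not_mem hR hx k]
    ring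
  set bsq := 18 * (c₂ ^ 2 * T₀ ^ 2 + c₁ ^ 2 * T₁ ^ 2) with hbsq
  have hbsq0 : 0 ≤ bsq := by positivity
  have hbG : ∀ i j, ∫ x, pderiv j (w4 u R ρ i) x ^ 2 ≤ Real.sqrt bsq ^ 2 := fun i j => by
    rw [Real.sq_sqrt hbsq0]; exact integral_sq_pderiv_w4_le hu hR hρ hψ1 hψ2 hT0 hT1 i j
  have hDA : 0 ≤ ∫ x in A, gradSq u x := setIntegral_nonneg hAm fun x _ => gradSq_nonneg u x
  have hIA : 0 ≤ ∫ x in A, ‖u x‖ ^ 4 := setIntegral_nonneg hAm fun x _ => by positivity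
  have hV : |Vf u (w4 u R ρ)| ≤ 9 * Real.sqrt (∫ x in A, gradSq u x) * Real.sqrt bsq := by
    refine abs_sum_sum_integral_mul_le (S := A) (F := fun i j => pderiv j (fun z => u z i))
      (G := fun i j => pderiv j (w4 u R ρ i)) (fun i j => hduc i j) hGc hGs hGS
      (fun i j => integrableOn_of_continuous hA ((hduc i j).pow 2)) (Real.sqrt_nonneg _)
      (Real.sqrt_nonneg _) (fun i j => ?_) hbG
    rw [Real.sq_sqrt hDA]
    exact setIntegral_mono_of_continuous hA hAm ((hduc i j).pow 2) (continuous_gradSq hu)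
      fun x _ => sq_pderiv_le_gradSq u i j x
  have hC : |Cf u (w4 u R ρ)| ≤ 9 * Real.sqrt (∫ x in A, ‖u x‖ ^ 4) * Real.sqrt bsq := by
    have hibp := convective_ibp hu (divFree_coord hprof) hw4 hw4c
    change Cf u (w4 u R ρ) = _ at hibp
    rw [hibp, abs_neg]
    refine abs_sum_sum_integral_mul_le (S := A) (F := fun i j x => u x i * u x j)
      (G := fun i j => pderiv j (w4 u R ρ i)) (fun i j => (huc i).mul (huc j)) hGc hGs hGS
      (fun i j => integrableOn_of_continuous hA (((huc i).mul (huc j)).pow 2)) (Real.sqrt_nonneg _)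
      (Real.sqrt_nonneg _) (fun i j => ?_) hbG
    rw [Real.sq_sqrt hIA]
    exact setIntegral_mono_of_continuous hA hAm (((huc i).mul (huc j)).pow 2)
      (hu.continuous.norm.pow 4) fun x _ => sq_mul_apply_le (u x) i j
  calc |Vf u (w4 u R ρ)| + |Cf u (w4 u R ρ)|
      ≤ 9 * Real.sqrt (∫ x in A, gradSq u x) * Real.sqrt bsq +
        9 * Real.sqrt (∫ x in A, ‖u x‖ ^ 4) * Real.sqrt bsq := add_le_add hV hC
    _ = _ := by ring

end TermBounds4


section EnergyBound

local notation "ℝ³" => EuclideanSpace ℝ (Fin 3)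

variable {u : ℝ³ → ℝ³} {p : ℝ³ → ℝ} {R ρ : ℝ}

/-- **The localised energy bound (abstract form).** For a smooth steady solution, `R > 0`,
`ρ > 0`, bounds `c₁, c₂` on `∇ψ_R, ∇²ψ_R`, sup bounds `L₀, L₁` on `Λᵢ, ∂ⱼΛᵢ`, and `L²` bounds
`H₁, H₂, T₀, T₁` on `∂ᵢh, ∂ⱼ∂ᵢh, Tᵢₖ, ∂ⱼTᵢₖ`:
`∫ ψ_R |∇u|² ≤` (boundary terms on the annulus) `+` (smoothing terms) `+` (potential terms).
[folklore] -/
theorem energy_bound (hprof : IsLerayProfile 1 0 u p) (hu : ContDiff ℝ ∞ u) (hR : 0 < R)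
    (hρ : 0 < ρ) {c₁ c₂ L₀ L₁ H₁ H₂ T₀ T₁ : ℝ} (hc₁ : 0 ≤ c₁) (hH₁ : 0 ≤ H₁) (hH₂ : 0 ≤ H₂)
    (hψ1 : ∀ x, ‖fderiv ℝ (cutoff (E := ℝ³) R) x‖ ≤ c₁)
    (hψ2 : ∀ x, ‖fderiv ℝ (fderiv ℝ (cutoff (E := ℝ³) R)) x‖ ≤ c₂)
    (hL₀ : ∀ i x, |rem u R ρ i x| ≤ L₀) (hL₁ : ∀ i j x, |pderiv j (rem u R ρ i) x| ≤ L₁)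
    (hH1 : ∀ i, ∫ x, pderiv i (hfun u R ρ) x ^ 2 ≤ H₁ ^ 2)
    (hH2 : ∀ i j, ∫ x, pderiv j (pderiv i (hfun u R ρ)) x ^ 2 ≤ H₂ ^ 2)
    (hT0 : ∀ i k, ∫ x, tens u R ρ i k x ^ 2 ≤ T₀ ^ 2)
    (hT1 : ∀ i j k, ∫ x, pderiv j (tens u R ρ i k) x ^ 2 ≤ T₁ ^ 2) :
    ∫ x, cutoff R x * gradSq u x ≤
      9 * Real.sqrt (∫ x in annulus R, gradSq u x) * (c₁ * Real.sqrt (∫ x in annulus R, ‖u x‖ ^ 2)) +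
      3 / 2 * c₁ * (∫ x in annulus R, ‖u x‖ ^ 3) +
      9 * (Real.sqrt (∫ x in closedBall (0 : ℝ³) (2 * R), gradSq u x) +
          Real.sqrt (∫ x in closedBall (0 : ℝ³) (2 * R), ‖u x‖ ^ 4)) *
        Real.sqrt (2 * (c₁ ^ 2 * L₀ ^ 2 + L₁ ^ 2) * volB R) +
      (18 * c₁ * H₁ * Real.sqrt (∫ x in annulus R, gradSq u x) +
        9 * c₁ * H₁ * Real.sqrt (∫ x in annulus R, ‖u x‖ ^ 4) +
        9 * H₂ * Real.sqrt (∫ x in closedBall (0 : ℝ³) (2 * R), ‖u x‖ ^ 4)) +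
      9 * (Real.sqrt (∫ x in annulus R, gradSq u x) + Real.sqrt (∫ x in annulus R, ‖u x‖ ^ 4)) *
        Real.sqrt (18 * (c₂ ^ 2 * T₀ ^ 2 + c₁ ^ 2 * T₁ ^ 2)) := by
  have hid := energy_identity hprof hu hR hρ
  change ∫ x, cutoff R x * gradSq u x = _ at hid
  have h1 := abs_S_le hu hR hc₁ hψ1
  have h2 := abs_K_le hprof hu hR hc₁ hψ1
  have h3 := abs_Vf_w2_add_abs_Cf_w2_le hprof hu hR hρ hψ1 hL₀ hL₁
  have h4 := abs_Vf_w3_add_abs_Cf_w3_le hprof hu hR hρ hc₁ hH₁ hH₂ hψ1 hH1 hH2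
  have h5 := abs_Vf_w4_add_abs_Cf_w4_le hprof hu hR hρ hψ1 hψ2 hT0 hT1
  rw [hid]
  have key : ∀ (S K V2 C2 V3 C3 V4 C4 : ℝ),
      -S - K + (V2 + C2) + (V3 + C3) - (V4 + C4) ≤
        |S| + |K| + (|V2| + |C2|) + (|V3| + |C3|) + (|V4| + |C4|) := by
    intro S K V2 C2 V3 C3 V4 C4
    have := neg_abs_le S; have := neg_abs_le K; have := le_abs_self V2; have := le_abs_self C2
    have := le_abs_self V3; have := le_abs_self C3; have := neg_abs_le V4; have := neg_abs_le C4
    linarith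
  refine (key _ _ _ _ _ _ _ _).trans ?_
  linarith

end EnergyBound


section PotentialBounds

local notation "ℝ³" => EuclideanSpace ℝ (Fin 3)

variable {u : ℝ³ → ℝ³} {p : ℝ³ → ℝ} {R ρ : ℝ}

/-! ### Universal constants of the truncated Newton kernel at radii `(1, 2)` -/

/-- The `L¹` mass of `λ_{1,2} = Δ((1-θ)Γ)`. [folklore] -/
def massΛ : ℝ := ∫ z : ℝ³, |newtonFarLaplacian 1 2 z|

/-- The Hessian constant `C_H = 2 (1 + ‖λ_{1,2}‖₁²)`. [folklore] -/
def hessC : ℝ := 2 * (1 + massΛ ^ 2)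

/-- The `L¹` mass of the truncated kernel `Γ₀^{1,2} = θΓ`. [folklore] -/
def massΓ : ℝ := ∫ z : ℝ³, |newtonNear 1 2 z|

/-- `‖λ_{1,2}‖₁ ≥ 0`. [folklore] -/
theorem massΛ_nonneg : 0 ≤ massΛ := integral_nonneg fun _ => abs_nonneg _
/-- `‖Γ₀^{1,2}‖₁ ≥ 0`. [folklore] -/
theorem massΓ_nonneg : 0 ≤ massΓ := integral_nonneg fun _ => abs_nonneg _
/-- `C_H > 0`. [folklore] -/
theorem hessC_pos : 0 < hessC := by unfold hessC; positivity

/-- `∫|λ_{ρ,2ρ}| = ‖λ_{1,2}‖₁` (scale invariance). [folklore] -/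
theorem integral_abs_newtonFarLaplacian_rho (hρ : 0 < ρ) :
    ∫ z : ℝ³, |newtonFarLaplacian ρ (2 * ρ) z| = massΛ := by
  have h := integral_abs_newtonFarLaplacian_scale hρ 1 2
  rw [mul_one, mul_comm ρ 2] at h
  exact h

/-- `∫|Γ₀^{ρ,2ρ}| = ρ² ‖Γ₀^{1,2}‖₁`. [folklore] -/
theorem integral_abs_newtonNear_rho (hρ : 0 < ρ) :
    ∫ z : ℝ³, |newtonNear ρ (2 * ρ) z| = ρ ^ 2 * massΓ := by
  have h := integral_abs_newtonNear_scale hρ 1 2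
  rw [mul_one, mul_comm ρ 2] at h
  exact h

/-- A uniform bound for `λ_{1,2}` and its first partials. [folklore] -/
theorem exists_bound_lambda :
    ∃ Λ₀ : ℝ, 0 ≤ Λ₀ ∧ (∀ z : ℝ³, |newtonFarLaplacian 1 2 z| ≤ Λ₀) ∧
      ∀ (k : Fin 3) (z : ℝ³), |pderiv k (newtonFarLaplacian 1 2) z| ≤ Λ₀ := by
  have hc : ContDiff ℝ 1 (newtonFarLaplacian (1 : ℝ) 2 : ℝ³ → ℝ) :=
    contDiff_newtonFarLaplacian one_pos one_lt_two
  have hs : HasCompactSupport (newtonFarLaplacian (1 : ℝ) 2 : ℝ³ → ℝ) :=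
    hasCompactSupport_newtonFarLaplacian zero_le_one one_lt_two
  obtain ⟨A, hA⟩ := hc.continuous.bounded_above_of_compact_support hs
  obtain ⟨B, hB⟩ := (hc.continuous_fderiv one_ne_zero).bounded_above_of_compact_support (hs.fderiv (𝕜 := ℝ))
  refine ⟨max (max A B) 0, le_max_right _ _, fun z => ?_, fun k z => ?_⟩
  · rw [← Real.norm_eq_abs]
    exact (hA z).trans ((le_max_left _ _).trans (le_max_left _ _))
  · exact (abs_pderiv_le_norm_fderiv k _ z).trans ((hB z).trans ((le_max_right _ _).trans (le_max_left _ _)))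

/-- **Scaling of `∂ₖλ`**: `∂ₖλ_{ρ,2ρ}(z) = ρ⁻⁴ ∂ₖλ_{1,2}(z/ρ)` (the computation of
`pderiv_newtonFarLaplacian_scale` in `LocalVelocityGradient`). [folklore] -/
theorem pderiv_newtonFarLaplacian_rho (hρ : 0 < ρ) (k : Fin 3) (z : ℝ³) :
    pderiv k (newtonFarLaplacian ρ (2 * ρ)) z =
      ρ⁻¹ ^ 4 * pderiv k (newtonFarLaplacian 1 2) (ρ⁻¹ • z) := by
  have hfun : newtonFarLaplacian ρ (2 * ρ) =
      fun z : ℝ³ => ρ⁻¹ ^ 3 * newtonFarLaplacian 1 2 (ρ⁻¹ • z) := by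
    funext w
    have h := newtonFarLaplacian_scale hρ 1 2 w
    rw [mul_one, mul_comm ρ 2] at h
    exact h
  rw [pderiv_apply, hfun]
  have hd : DifferentiableAt ℝ (newtonFarLaplacian (1 : ℝ) 2) (ρ⁻¹ • z) :=
    ((contDiff_newtonFarLaplacian one_pos one_lt_two (n := 1)).differentiable (by norm_num)) _
  have hA : HasFDerivAt (fun w : ℝ³ => ρ⁻¹ • w)
      (ρ⁻¹ • ContinuousLinearMap.id ℝ ℝ³) z := (hasFDerivAt_id z).const_smul ρ⁻¹
  have hB : HasFDerivAt (fun w : ℝ³ => newtonFarLaplacian 1 2 (ρ⁻¹ • w))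
      ((fderiv ℝ (newtonFarLaplacian 1 2) (ρ⁻¹ • z)).comp
        (ρ⁻¹ • ContinuousLinearMap.id ℝ ℝ³)) z := hd.hasFDerivAt.comp z hA
  have hC : HasFDerivAt (fun w : ℝ³ => ρ⁻¹ ^ 3 * newtonFarLaplacian 1 2 (ρ⁻¹ • w))
      (ρ⁻¹ ^ 3 • (fderiv ℝ (newtonFarLaplacian 1 2) (ρ⁻¹ • z)).comp
        (ρ⁻¹ • ContinuousLinearMap.id ℝ ℝ³)) z := hB.const_mul (ρ⁻¹ ^ 3)
  rw [hC.fderiv, pderiv_apply]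
  simp only [FunLike.coe_smul, Pi.smul_apply, ContinuousLinearMap.coe_comp, comp_apply,
    ContinuousLinearMap.coe_id', id_eq, map_smul, smul_eq_mul]
  ring

/-- Uniform bounds for `λ_{ρ,2ρ}` and `∂ₖλ_{ρ,2ρ}` from the unit-scale bound `Λ₀`. [folklore] -/
theorem abs_newtonFarLaplacian_rho_le (hρ : 0 < ρ) {Λ₀ : ℝ} (hΛ : ∀ z : ℝ³, |newtonFarLaplacian 1 2 z| ≤ Λ₀)
    (z : ℝ³) : |newtonFarLaplacian ρ (2 * ρ) z| ≤ ρ⁻¹ ^ 3 * Λ₀ := by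
  have h := newtonFarLaplacian_scale hρ 1 2 z
  rw [mul_one, mul_comm ρ 2] at h
  rw [h, abs_mul, abs_of_pos (by positivity : (0:ℝ) < ρ⁻¹ ^ 3)]
  exact mul_le_mul_of_nonneg_left (hΛ _) (by positivity)

/-- Uniform bound for `∂ₖλ_{ρ,2ρ}` from the unit-scale bound. [folklore] -/
theorem abs_pderiv_newtonFarLaplacian_rho_le (hρ : 0 < ρ) {Λ₀ : ℝ}
    (hΛ : ∀ (k : Fin 3) (z : ℝ³), |pderiv k (newtonFarLaplacian 1 2) z| ≤ Λ₀) (k : Fin 3) (z : ℝ³) :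
    |pderiv k (newtonFarLaplacian ρ (2 * ρ)) z| ≤ ρ⁻¹ ^ 4 * Λ₀ := by
  rw [pderiv_newtonFarLaplacian_rho hρ, abs_mul, abs_of_pos (by positivity : (0:ℝ) < ρ⁻¹ ^ 4)]
  exact mul_le_mul_of_nonneg_left (hΛ _ _) (by positivity)

/-! ### The localised data `gᵢ` -/

/-- `|gᵢ| ≤ ‖u‖`. [folklore] -/
theorem abs_gloc_le (u : ℝ³ → ℝ³) (R : ℝ) (i : Fin 3) (x : ℝ³) : |gloc u R i x| ≤ ‖u x‖ := by
  unfold gloc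
  rw [abs_mul]
  calc |cutoff (2 * R) x| * |u x i| ≤ 1 * ‖u x‖ :=
        mul_le_mul (abs_cutoff_le_one _ x) (abs_apply_le_norm (u x) i) (abs_nonneg _) zero_le_one
    _ = ‖u x‖ := one_mul _

/-- `gᵢ` vanishes off `B̄(0, 4R)`. [folklore] -/
theorem gloc_eq_zero_of_not_mem (hR : 0 < R) (i : Fin 3) {x : ℝ³}
    (hx : x ∉ closedBall (0 : ℝ³) (4 * R)) : gloc u R i x = 0 := by
  rw [mem_closedBall_zero_iff, not_le] at hx
  unfold gloc
  rw [cutoff_eq_zero (by positivity : 0 < 2 * R) (by linarith), zero_mul]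

/-- `∫ gᵢ² ≤ ∫_{B̄_{4R}} ‖u‖²`. [folklore] -/
theorem integral_sq_gloc_le (hu : ContDiff ℝ ∞ u) (hR : 0 < R) (i : Fin 3) :
    ∫ x, gloc u R i x ^ 2 ≤ ∫ x in closedBall (0 : ℝ³) (4 * R), ‖u x‖ ^ 2 := by
  refine integral_sq_le_setIntegral measurableSet_closedBall (fun x hx => gloc_eq_zero_of_not_mem hR i hx)
    (fun x _ => ?_) (integrableOn_of_continuous (isCompact_closedBall _ _) (hu.continuous.norm.pow 2))
  rw [← sq_abs]
  exact pow_le_pow_left₀ (abs_nonneg _) (abs_gloc_le u R i x) 2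

/-- `∫ |gᵢ| ≤ ∫_{B̄_{4R}} ‖u‖`. [folklore] -/
theorem integral_abs_gloc_le (hu : ContDiff ℝ ∞ u) (hR : 0 < R) (i : Fin 3) :
    ∫ x, |gloc u R i x| ≤ ∫ x in closedBall (0 : ℝ³) (4 * R), ‖u x‖ := by
  have hvan : ∀ x, x ∉ closedBall (0 : ℝ³) (4 * R) → |gloc u R i x| = 0 := fun x hx => by
    rw [gloc_eq_zero_of_not_mem hR i hx, abs_zero]
  rw [← setIntegral_eq_integral_of_forall_compl_eq_zero hvan]
  exact setIntegral_mono_of_continuous (isCompact_closedBall _ _) measurableSet_closedBall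
    (contDiff_gloc hu i).continuous.abs hu.continuous.norm fun x _ => abs_gloc_le u R i x

/-! ### Hessian and Young bounds for the potentials -/

/-- **Hessian bound** for `N_{ρ,2ρ}[g]`: `∫ (∂ⱼ∂ₖN[g])² ≤ C_H ∫ g²` for `g ∈ C_c^∞`. [folklore] -/
theorem integral_sq_pderiv_pderiv_newtonNearPotential_le (hρ : 0 < ρ) {g : ℝ³ → ℝ}
    (hg : ContDiff ℝ ∞ g) (hgc : HasCompactSupport g) (j k : Fin 3) :
    ∫ x, pderiv j (pderiv k (newtonNearPotential ρ (2 * ρ) g)) x ^ 2 ≤ hessC * ∫ x, g x ^ 2 := by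
  have h := integral_sq_fderiv_fderiv_newtonNearPotential_le (EuclideanSpace.basisFun (Fin 3) ℝ) hρ
    (by linarith : ρ < 2 * ρ) (hg.of_le (by norm_cast)) hgc k j
  rw [integral_abs_newtonFarLaplacian_rho hρ] at h
  simp only [← stdVec_eq_basisFun] at h
  exact h

/-- `N[g]` is the convolution `Γ₀ ⋆ g`. [folklore] -/
theorem newtonNearPotential_eq_convolution' (r₀ r₁ : ℝ) (g : ℝ³ → ℝ) :
    newtonNearPotential r₀ r₁ g = newtonNear r₀ r₁ ⋆[ContinuousLinearMap.lsmul ℝ ℝ, volume] g := by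
  funext x; rw [convolution_lsmul_apply]; rfl

/-- **Young bound** for `N_{ρ,2ρ}[g]`: `∫ N[g]² ≤ (ρ² ‖Γ₀^{1,2}‖₁)² ∫ g²`. [folklore] -/
theorem integral_sq_newtonNearPotential_le (hρ : 0 < ρ) {g : ℝ³ → ℝ} (hg : Continuous g)
    (hgc : HasCompactSupport g) :
    ∫ x, newtonNearPotential ρ (2 * ρ) g x ^ 2 ≤ (ρ ^ 2 * massΓ) ^ 2 * ∫ x, g x ^ 2 := by
  have h2ρ : ρ < 2 * ρ := by linarith
  have hki : Integrable (newtonNear ρ (2 * ρ)) := integrable_newtonNear hρ.le h2ρ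
  have hY := Literature.Analysis.UnboundedOperators.eLpNorm_convolution_le_lintegral_enorm_mul
    (μ := volume) (K := newtonNear ρ (2 * ρ)) hki.aestronglyMeasurable (f := g) hg.aestronglyMeasurable
    (p := 2) (by norm_num)
  rw [← newtonNearPotential_eq_convolution'] at hY
  have hNc : ContDiff ℝ (0 : ℕ) (newtonNearPotential ρ (2 * ρ) g) :=
    contDiff_newtonNearPotential hρ.le h2ρ 0 (contDiff_zero.2 hg)
  have hNs : HasCompactSupport (newtonNearPotential ρ (2 * ρ) g) :=
    hasCompactSupport_newtonNearPotential hρ.le h2ρ hgc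
  have hN2 : MemLp (newtonNearPotential ρ (2 * ρ) g) 2 volume :=
    hNc.continuous.memLp_of_hasCompactSupport hNs
  have hg2 : MemLp g 2 volume := hg.memLp_of_hasCompactSupport hgc
  have hM0 : 0 ≤ ∫ z, ‖newtonNear ρ (2 * ρ) z‖ := integral_nonneg fun _ => norm_nonneg _
  rw [eLpNorm_two_eq_ofReal_sqrt hN2, eLpNorm_two_eq_ofReal_sqrt hg2,
    ← ofReal_integral_norm_eq_lintegral_enorm hki, ← ENNReal.ofReal_mul hM0,
    ENNReal.ofReal_le_ofReal_iff (mul_nonneg hM0 (Real.sqrt_nonneg _))] at hY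
  have hA0 : 0 ≤ ∫ x, newtonNearPotential ρ (2 * ρ) g x ^ 2 := integral_nonneg fun _ => sq_nonneg _
  have hB0 : 0 ≤ ∫ x, g x ^ 2 := integral_nonneg fun _ => sq_nonneg _
  have hnorm : (∫ z, ‖newtonNear ρ (2 * ρ) z‖) = ρ ^ 2 * massΓ := by
    rw [← integral_abs_newtonNear_rho hρ]; rfl
  calc ∫ x, newtonNearPotential ρ (2 * ρ) g x ^ 2
      = (Real.sqrt (∫ x, newtonNearPotential ρ (2 * ρ) g x ^ 2)) ^ 2 := (Real.sq_sqrt hA0).symm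
    _ ≤ ((∫ z, ‖newtonNear ρ (2 * ρ) z‖) * Real.sqrt (∫ x, g x ^ 2)) ^ 2 :=
        pow_le_pow_left₀ (Real.sqrt_nonneg _) hY 2
    _ = (ρ ^ 2 * massΓ) ^ 2 * ∫ x, g x ^ 2 := by rw [mul_pow, Real.sq_sqrt hB0, hnorm]

/-- **First derivatives of the potential**: `∫ (∂ₖN[g])² ≤ ρ² ‖Γ₀^{1,2}‖₁ √C_H ∫ g²` (one integration
by parts, Cauchy–Schwarz, Young and the Hessian bound). [folklore] -/
theorem integral_sq_pderiv_newtonNearPotential_le (hρ : 0 < ρ) {g : ℝ³ → ℝ} (hg : ContDiff ℝ ∞ g)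
    (hgc : HasCompactSupport g) (k : Fin 3) :
    ∫ x, pderiv k (newtonNearPotential ρ (2 * ρ) g) x ^ 2 ≤
      ρ ^ 2 * massΓ * Real.sqrt hessC * ∫ x, g x ^ 2 := by
  have h2ρ : ρ < 2 * ρ := by linarith
  set N := newtonNearPotential ρ (2 * ρ) g with hN
  have hNs : ContDiff ℝ ∞ N := contDiff_newtonNearPotential_top hρ.le h2ρ hg
  have hNc : HasCompactSupport N := hasCompactSupport_newtonNearPotential hρ.le h2ρ hgc
  have hdN : ContDiff ℝ ∞ (pderiv k N) := contDiff_pderiv hNs k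
  have hdNc : HasCompactSupport (pderiv k N) := hasCompactSupport_pderiv hNc k
  -- `∫ (∂ₖN)² = -∫ ∂ₖ∂ₖN · N`
  have hibp : ∫ x, pderiv k N x * pderiv k N x = -∫ x, pderiv k (pderiv k N) x * N x :=
    integral_mul_pderiv_eq_neg (hdN.of_le (by norm_cast)) hdNc (hNs.of_le (by norm_cast)) k
  have hsq : ∫ x, pderiv k N x ^ 2 = -∫ x, pderiv k (pderiv k N) x * N x := by
    rw [← hibp]; exact integral_congr_ae (Eventually.of_forall fun x => by ring)
  have hN2 : MemLp N 2 volume := hNs.continuous.memLp_of_hasCompactSupport hNc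
  have hddN2 : MemLp (pderiv k (pderiv k N)) 2 volume :=
    (contDiff_pderiv hdN k).continuous.memLp_of_hasCompactSupport (hasCompactSupport_pderiv hdNc k)
  have hCS := integral_abs_mul_abs_le_sqrt hddN2 hN2
  have hH := integral_sq_pderiv_pderiv_newtonNearPotential_le hρ hg hgc k k
  have hY := integral_sq_newtonNearPotential_le hρ hg.continuous hgc
  have hG0 : 0 ≤ ∫ x, g x ^ 2 := integral_nonneg fun _ => sq_nonneg _
  calc ∫ x, pderiv k N x ^ 2 = -∫ x, pderiv k (pderiv k N) x * N x := hsq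
    _ ≤ |∫ x, pderiv k (pderiv k N) x * N x| := neg_le_abs _
    _ ≤ ∫ x, |pderiv k (pderiv k N) x * N x| := abs_integral_le_integral_abs
    _ = ∫ x, |pderiv k (pderiv k N) x| * |N x| := integral_congr_ae (Eventually.of_forall fun x => abs_mul _ _)
    _ ≤ Real.sqrt (∫ x, pderiv k (pderiv k N) x ^ 2) * Real.sqrt (∫ x, N x ^ 2) := hCS
    _ ≤ Real.sqrt (hessC * ∫ x, g x ^ 2) * Real.sqrt ((ρ ^ 2 * massΓ) ^ 2 * ∫ x, g x ^ 2) :=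
        mul_le_mul (Real.sqrt_le_sqrt hH) (Real.sqrt_le_sqrt hY) (Real.sqrt_nonneg _) (Real.sqrt_nonneg _)
    _ = ρ ^ 2 * massΓ * Real.sqrt hessC * ∫ x, g x ^ 2 := by
        rw [Real.sqrt_mul hessC_pos.le, Real.sqrt_mul (sq_nonneg _),
          Real.sqrt_sq (mul_nonneg (sq_nonneg _) massΓ_nonneg)]
        calc Real.sqrt hessC * Real.sqrt (∫ x, g x ^ 2) * (ρ ^ 2 * massΓ * Real.sqrt (∫ x, g x ^ 2))
            = ρ ^ 2 * massΓ * Real.sqrt hessC * (Real.sqrt (∫ x, g x ^ 2) * Real.sqrt (∫ x, g x ^ 2)) := by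
              ring
          _ = _ := by rw [Real.mul_self_sqrt hG0]

end PotentialBounds


section PotentialBounds2

local notation "ℝ³" => EuclideanSpace ℝ (Fin 3)

variable {u : ℝ³ → ℝ³} {p : ℝ³ → ℝ} {R ρ : ℝ}

/-! ### The concrete `L²` bounds `T₀, T₁, H₁` -/

/-- Hessian entries of the potentials: `∫ (∂ⱼ∂ₖΦᵢ)² ≤ C_H ∫_{B̄_{4R}} ‖u‖²`. [folklore] -/
theorem integral_sq_pderiv_pderiv_pot_le (hu : ContDiff ℝ ∞ u) (hR : 0 < R) (hρ : 0 < ρ) (i j k : Fin 3) :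
    ∫ x, pderiv j (pderiv k (pot u R ρ i)) x ^ 2 ≤
      hessC * ∫ x in closedBall (0 : ℝ³) (4 * R), ‖u x‖ ^ 2 :=
  (integral_sq_pderiv_pderiv_newtonNearPotential_le hρ (contDiff_gloc hu i) (hasCompactSupport_gloc hR i) j k).trans
    (mul_le_mul_of_nonneg_left (integral_sq_gloc_le hu hR i) hessC_pos.le)

/-- First derivatives of the potentials: `∫ (∂ₖΦᵢ)² ≤ ρ² ‖Γ₀‖₁ √C_H ∫_{B̄_{4R}} ‖u‖²`. [folklore] -/
theorem integral_sq_pderiv_pot_le (hu : ContDiff ℝ ∞ u) (hR : 0 < R) (hρ : 0 < ρ) (i k : Fin 3) :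
    ∫ x, pderiv k (pot u R ρ i) x ^ 2 ≤
      ρ ^ 2 * massΓ * Real.sqrt hessC * ∫ x in closedBall (0 : ℝ³) (4 * R), ‖u x‖ ^ 2 :=
  (integral_sq_pderiv_newtonNearPotential_le hρ (contDiff_gloc hu i) (hasCompactSupport_gloc hR i) k).trans
    (mul_le_mul_of_nonneg_left (integral_sq_gloc_le hu hR i)
      (mul_nonneg (mul_nonneg (sq_nonneg _) massΓ_nonneg) (Real.sqrt_nonneg _)))

/-- `∫ (a - b)² ≤ 2 ∫ a² + 2 ∫ b²` for continuous compactly supported `a, b`. [folklore] -/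
theorem integral_sq_sub_le {a b : ℝ³ → ℝ} (ha : Continuous a) (hac : HasCompactSupport a)
    (hb : Continuous b) (hbc : HasCompactSupport b) :
    ∫ x, (a x - b x) ^ 2 ≤ 2 * (∫ x, a x ^ 2) + 2 * (∫ x, b x ^ 2) := by
  have hIa : Integrable fun x => a x ^ 2 :=
    (ha.pow 2).integrable_of_hasCompactSupport (hasCompactSupport_pow hac two_ne_zero)
  have hIb : Integrable fun x => b x ^ 2 :=
    (hb.pow 2).integrable_of_hasCompactSupport (hasCompactSupport_pow hbc two_ne_zero)
  have hI : Integrable fun x => (a x - b x) ^ 2 :=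
    ((ha.sub hb).pow 2).integrable_of_hasCompactSupport (hasCompactSupport_pow (hac.sub hbc) two_ne_zero)
  have h2a : Integrable fun x => 2 * a x ^ 2 := hIa.const_mul 2
  have h2b : Integrable fun x => 2 * b x ^ 2 := hIb.const_mul 2
  calc ∫ x, (a x - b x) ^ 2 ≤ ∫ x, (2 * a x ^ 2 + 2 * b x ^ 2) := by
        refine integral_mono hI (h2a.add h2b) fun x => ?_
        show (a x - b x) ^ 2 ≤ 2 * a x ^ 2 + 2 * b x ^ 2
        nlinarith [sq_nonneg (a x + b x)]
    _ = 2 * (∫ x, a x ^ 2) + 2 * (∫ x, b x ^ 2) := by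
        rw [integral_add h2a h2b, integral_const_mul, integral_const_mul]

/-- **`T₁`**: `∫ (∂ⱼTᵢₖ)² ≤ 4 C_H ∫_{B̄_{4R}} ‖u‖²`. [folklore] -/
theorem integral_sq_pderiv_tens_le (hu : ContDiff ℝ ∞ u) (hR : 0 < R) (hρ : 0 < ρ) (i j k : Fin 3) :
    ∫ x, pderiv j (tens u R ρ i k) x ^ 2 ≤ 4 * hessC * ∫ x in closedBall (0 : ℝ³) (4 * R), ‖u x‖ ^ 2 := by
  have hΦ : ∀ i, ContDiff ℝ ∞ (pot u R ρ i) := fun i => contDiff_pot hu hρ i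
  have hΦc : ∀ i, HasCompactSupport (pot u R ρ i) := fun i => hasCompactSupport_pot hR hρ i
  have hd : ∀ i l, Differentiable ℝ (pderiv l (pot u R ρ i)) := fun i l =>
    (contDiff_pderiv (hΦ i) l).differentiable (by simp)
  have hp : pderiv j (tens u R ρ i k) = fun x => pderiv j (pderiv k (pot u R ρ i)) x -
      pderiv j (pderiv i (pot u R ρ k)) x := by
    have : tens u R ρ i k = fun x => pderiv k (pot u R ρ i) x - pderiv i (pot u R ρ k) x := rfl
    rw [this, pderiv_sub (hd i k) (hd k i)]
  rw [hp]
  have hc : ∀ i l m, Continuous (pderiv m (pderiv l (pot u R ρ i))) := fun i l m =>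
    continuous_pderiv (contDiff_pderiv (hΦ i) l) (by simp) m
  have hs : ∀ i l m, HasCompactSupport (pderiv m (pderiv l (pot u R ρ i))) := fun i l m =>
    hasCompactSupport_pderiv (hasCompactSupport_pderiv (hΦc i) l) m
  refine (integral_sq_sub_le (hc i k j) (hs i k j) (hc k i j) (hs k i j)).trans ?_
  have h1 := integral_sq_pderiv_pderiv_pot_le hu hR hρ i j k
  have h2 := integral_sq_pderiv_pderiv_pot_le hu hR hρ k j i
  linarith

/-- **`T₀`**: `∫ Tᵢₖ² ≤ 4 ρ² ‖Γ₀‖₁ √C_H ∫_{B̄_{4R}} ‖u‖²`. [folklore] -/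
theorem integral_sq_tens_le (hu : ContDiff ℝ ∞ u) (hR : 0 < R) (hρ : 0 < ρ) (i k : Fin 3) :
    ∫ x, tens u R ρ i k x ^ 2 ≤
      4 * (ρ ^ 2 * massΓ * Real.sqrt hessC) * ∫ x in closedBall (0 : ℝ³) (4 * R), ‖u x‖ ^ 2 := by
  have hΦ : ∀ i, ContDiff ℝ ∞ (pot u R ρ i) := fun i => contDiff_pot hu hρ i
  have hΦc : ∀ i, HasCompactSupport (pot u R ρ i) := fun i => hasCompactSupport_pot hR hρ i
  have hc : ∀ i l, Continuous (pderiv l (pot u R ρ i)) := fun i l =>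
    continuous_pderiv (hΦ i) (by simp) l
  have hs : ∀ i l, HasCompactSupport (pderiv l (pot u R ρ i)) := fun i l =>
    hasCompactSupport_pderiv (hΦc i) l
  have : tens u R ρ i k = fun x => pderiv k (pot u R ρ i) x - pderiv i (pot u R ρ k) x := rfl
  rw [this]
  refine (integral_sq_sub_le (hc i k) (hs i k) (hc k i) (hs k i)).trans ?_
  have h1 := integral_sq_pderiv_pot_le hu hR hρ i k
  have h2 := integral_sq_pderiv_pot_le hu hR hρ k i
  linarith

/-- **`H₁`**: `∫ (∂ᵢh)² ≤ 9 C_H ∫_{B̄_{4R}} ‖u‖²`. [folklore] -/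
theorem integral_sq_pderiv_hfun_le (hu : ContDiff ℝ ∞ u) (hR : 0 < R) (hρ : 0 < ρ) (i : Fin 3) :
    ∫ x, pderiv i (hfun u R ρ) x ^ 2 ≤ 9 * hessC * ∫ x in closedBall (0 : ℝ³) (4 * R), ‖u x‖ ^ 2 := by
  have hΦ : ∀ i, ContDiff ℝ ∞ (pot u R ρ i) := fun i => contDiff_pot hu hρ i
  have hΦc : ∀ i, HasCompactSupport (pot u R ρ i) := fun i => hasCompactSupport_pot hR hρ i
  have hd : ∀ k, Differentiable ℝ (pderiv k (pot u R ρ k)) := fun k =>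
    (contDiff_pderiv (hΦ k) k).differentiable (by simp)
  have hc : ∀ k, Continuous (pderiv i (pderiv k (pot u R ρ k))) := fun k =>
    continuous_pderiv (contDiff_pderiv (hΦ k) k) (by simp) i
  have hs : ∀ k, HasCompactSupport (pderiv i (pderiv k (pot u R ρ k))) := fun k =>
    hasCompactSupport_pderiv (hasCompactSupport_pderiv (hΦc k) k) i
  have hp : pderiv i (hfun u R ρ) = fun x => ∑ k, pderiv i (pderiv k (pot u R ρ k)) x := by
    have : hfun u R ρ = fun x => ∑ k, pderiv k (pot u R ρ k) x := rfl
    rw [this, pderiv_sum (f := fun k x => pderiv k (pot u R ρ k) x) Finset.univ (fun k _ => hd k)]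
  rw [hp]
  have hI : ∀ k, Integrable fun x => pderiv i (pderiv k (pot u R ρ k)) x ^ 2 := fun k =>
    ((hc k).pow 2).integrable_of_hasCompactSupport (hasCompactSupport_pow (hs k) two_ne_zero)
  have hIs : Integrable fun x => (∑ k, pderiv i (pderiv k (pot u R ρ k)) x) ^ 2 := by
    have hcs : Continuous fun x => ∑ k, pderiv i (pderiv k (pot u R ρ k)) x := continuous_finsetSum _ fun k _ => hc k
    have hss : HasCompactSupport fun x => ∑ k, pderiv i (pderiv k (pot u R ρ k)) x := by
      have : (fun x => ∑ k, pderiv i (pderiv k (pot u R ρ k)) x) = ∑ k, pderiv i (pderiv k (pot u R ρ k)) := by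
        funext x; simp only [Finset.sum_apply]
      rw [this]; exact HasCompactSupport.finset_sum fun k _ => hs k
    exact (hcs.pow 2).integrable_of_hasCompactSupport (hasCompactSupport_pow hss two_ne_zero)
  calc ∫ x, (∑ k, pderiv i (pderiv k (pot u R ρ k)) x) ^ 2
      ≤ ∫ x, 3 * ∑ k, pderiv i (pderiv k (pot u R ρ k)) x ^ 2 := by
        refine integral_mono hIs ((integrable_finsetSum _ fun k _ => hI k).const_mul 3) fun x => ?_
        have := sq_sum_le_card_mul_sum_sq (s := (Finset.univ : Finset (Fin 3)))
          (f := fun k => pderiv i (pderiv k (pot u R ρ k)) x)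
        simpa using this
    _ = 3 * ∑ k, ∫ x, pderiv i (pderiv k (pot u R ρ k)) x ^ 2 := by
        rw [integral_const_mul, integral_finsetSum _ fun k _ => hI k]
    _ ≤ 3 * ∑ _k : Fin 3, hessC * ∫ x in closedBall (0 : ℝ³) (4 * R), ‖u x‖ ^ 2 := by
        refine mul_le_mul_of_nonneg_left (Finset.sum_le_sum fun k _ => ?_) (by norm_num)
        exact integral_sq_pderiv_pderiv_pot_le hu hR hρ k i k
    _ = 9 * hessC * ∫ x in closedBall (0 : ℝ³) (4 * R), ‖u x‖ ^ 2 := by simp; ring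

/-! ### `h = N[d]` with `d = ∑ₖ ∂ₖχ_{2R} uₖ`, and the bound `H₂` -/

/-- The divergence of the localised data: `d = ∑ₖ ∂ₖχ_{2R} uₖ` (`= div (χ_{2R} u)` as `div u = 0`).
[folklore] -/
def dloc (u : ℝ³ → ℝ³) (R : ℝ) : ℝ³ → ℝ := fun x => ∑ k, pderiv k (cutoff (2 * R)) x * u x k

/-- `d` is smooth. [folklore] -/
theorem contDiff_dloc (hu : ContDiff ℝ ∞ u) : ContDiff ℝ ∞ (dloc u R) :=
  ContDiff.sum fun k _ => (contDiff_pderiv (contDiff_cutoff_infty (2 * R)) k).mul (contDiff_comp hu k)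

/-- `d` vanishes off the annulus `A_{2R}`. [folklore] -/
theorem dloc_eq_zero_of_not_mem (hR : 0 < R) {x : ℝ³} (hx : x ∉ annulus (2 * R)) : dloc u R x = 0 :=
  Finset.sum_eq_zero fun k _ => by
    rw [pderiv_cutoff_eq_zero_of_not_mem (by positivity : 0 < 2 * R) hx k, zero_mul]

/-- `d` has compact support. [folklore] -/
theorem hasCompactSupport_dloc (hR : 0 < R) : HasCompactSupport (dloc u R) :=
  HasCompactSupport.intro (isCompact_annulus (2 * R)) fun _ hx => dloc_eq_zero_of_not_mem hR hx

/-- `∑ₖ ∂ₖgₖ = d` when `∑ₖ ∂ₖuₖ = 0`. [folklore] -/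
theorem sum_pderiv_gloc (hu : ContDiff ℝ ∞ u) (hdiv : ∀ x, ∑ j, pderiv j (fun z => u z j) x = 0) (y : ℝ³) :
    ∑ k, pderiv k (gloc u R k) y = dloc u R y := by
  have hχd : Differentiable ℝ (cutoff (E := ℝ³) (2 * R)) := (contDiff_cutoff_infty (2 * R)).differentiable (by simp)
  have hud : ∀ k, Differentiable ℝ (fun z : ℝ³ => u z k) := fun k => (contDiff_comp hu k).differentiable (by simp)
  have h1 : ∀ k, pderiv k (gloc u R k) y = pderiv k (cutoff (2 * R)) y * u y k +
      cutoff (2 * R) y * pderiv k (fun z => u z k) y := by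
    intro k
    have : gloc u R k = fun x => cutoff (2 * R) x * u x k := rfl
    rw [this, pderiv_mul hχd (hud k) k]
  simp_rw [h1]
  rw [Finset.sum_add_distrib, ← Finset.mul_sum, hdiv y, mul_zero, add_zero]
  rfl

/-- Integrability of `z ↦ Γ₀(z) f(x - z)` for continuous compactly supported `f`. [folklore] -/
theorem integrable_newtonNear_mul_comp_sub (hρ : 0 < ρ) {f : ℝ³ → ℝ} (hf : Continuous f)
    (hfc : HasCompactSupport f) (x : ℝ³) : Integrable fun z => newtonNear ρ (2 * ρ) z * f (x - z) := by
  obtain ⟨C, hC⟩ := hf.bounded_above_of_compact_support hfc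
  have h := (integrable_newtonNear hρ.le (by linarith : ρ < 2 * ρ)).bdd_mul (c := C)
    ((hf.comp (continuous_const.sub continuous_id)).aestronglyMeasurable) (ae_of_all _ fun z => hC (x - z))
  exact h.congr (Eventually.of_forall fun z => mul_comm _ _)

/-- **`h = N[d]`**: the divergence of the potential is the potential of `d` (derivatives commute
with `N`, linearity, `div u = 0`). [folklore] -/
theorem hfun_eq_newtonNearPotential_dloc (hu : ContDiff ℝ ∞ u) (hR : 0 < R) (hρ : 0 < ρ)
    (hdiv : ∀ x, ∑ j, pderiv j (fun z => u z j) x = 0) :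
    hfun u R ρ = newtonNearPotential ρ (2 * ρ) (dloc u R) := by
  have h2ρ : ρ < 2 * ρ := by linarith
  funext x
  have h1 : ∀ k, pderiv k (pot u R ρ k) x = newtonNearPotential ρ (2 * ρ) (pderiv k (gloc u R k)) x := by
    intro k
    rw [pderiv_apply]
    exact fderiv_newtonNearPotential_apply hρ.le h2ρ ((contDiff_gloc hu k).of_le (by norm_cast)) x (stdVec k)
  have hI : ∀ k, Integrable fun z => newtonNear ρ (2 * ρ) z * pderiv k (gloc u R k) (x - z) := fun k =>
    integrable_newtonNear_mul_comp_sub hρ (continuous_pderiv (contDiff_gloc hu k) (by simp) k)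
      (hasCompactSupport_pderiv (hasCompactSupport_gloc hR k) k) x
  calc hfun u R ρ x = ∑ k, pderiv k (pot u R ρ k) x := rfl
    _ = ∑ k, newtonNearPotential ρ (2 * ρ) (pderiv k (gloc u R k)) x := Finset.sum_congr rfl fun k _ => h1 k
    _ = ∑ k, ∫ z, newtonNear ρ (2 * ρ) z * pderiv k (gloc u R k) (x - z) := rfl
    _ = ∫ z, ∑ k, newtonNear ρ (2 * ρ) z * pderiv k (gloc u R k) (x - z) := (integral_finsetSum _ fun k _ => hI k).symm
    _ = ∫ z, newtonNear ρ (2 * ρ) z * dloc u R (x - z) := by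
        refine integral_congr_ae (Eventually.of_forall fun z => ?_)
        show ∑ k, newtonNear ρ (2 * ρ) z * pderiv k (gloc u R k) (x - z) = newtonNear ρ (2 * ρ) z * dloc u R (x - z)
        rw [← Finset.mul_sum, sum_pderiv_gloc hu hdiv]
    _ = newtonNearPotential ρ (2 * ρ) (dloc u R) x := rfl

/-- `∫ d² ≤ 3 c'² ∫_{A_{2R}} ‖u‖²` with `c' ≥ ‖∇χ_{2R}‖_∞`. [folklore] -/
theorem integral_sq_dloc_le (hu : ContDiff ℝ ∞ u) (hR : 0 < R) {c' : ℝ}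
    (hχ1 : ∀ x, ‖fderiv ℝ (cutoff (E := ℝ³) (2 * R)) x‖ ≤ c') :
    ∫ x, dloc u R x ^ 2 ≤ 3 * c' ^ 2 * ∫ x in annulus (2 * R), ‖u x‖ ^ 2 := by
  rw [← integral_const_mul]
  refine integral_sq_le_setIntegral (measurableSet_annulus _) (fun x hx => dloc_eq_zero_of_not_mem hR hx)
    (fun x _ => ?_) ((integrableOn_of_continuous (isCompact_annulus _) (hu.continuous.norm.pow 2)).const_mul _)
  unfold dloc
  have hcs := sq_sum_le_card_mul_sum_sq (s := (Finset.univ : Finset (Fin 3)))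
    (f := fun k => pderiv k (cutoff (2 * R)) x * u x k)
  simp only [Finset.card_univ, Fintype.card_fin, Nat.cast_ofNat] at hcs
  refine hcs.trans ?_
  have hk : ∀ k, (pderiv k (cutoff (2 * R)) x * u x k) ^ 2 ≤ c' ^ 2 * u x k ^ 2 := by
    intro k
    rw [mul_pow, ← sq_abs (pderiv k _ x)]
    exact mul_le_mul_of_nonneg_right
      (pow_le_pow_left₀ (abs_nonneg _) (abs_pderiv_le_of_norm_fderiv_le hχ1 k x) 2) (sq_nonneg _)
  calc (3 : ℝ) * ∑ k, (pderiv k (cutoff (2 * R)) x * u x k) ^ 2 ≤ 3 * ∑ k, c' ^ 2 * u x k ^ 2 :=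
        mul_le_mul_of_nonneg_left (Finset.sum_le_sum fun k _ => hk k) (by norm_num)
    _ = 3 * c' ^ 2 * ‖u x‖ ^ 2 := by rw [← Finset.mul_sum, sum_sq_apply_eq]; ring

/-- **`H₂`**: `∫ (∂ⱼ∂ᵢh)² ≤ 3 C_H c'² ∫_{A_{2R}} ‖u‖²`. [folklore] -/
theorem integral_sq_pderiv_pderiv_hfun_le (hprof : IsLerayProfile 1 0 u p) (hu : ContDiff ℝ ∞ u)
    (hR : 0 < R) (hρ : 0 < ρ) {c' : ℝ} (hχ1 : ∀ x, ‖fderiv ℝ (cutoff (E := ℝ³) (2 * R)) x‖ ≤ c')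
    (i j : Fin 3) :
    ∫ x, pderiv j (pderiv i (hfun u R ρ)) x ^ 2 ≤
      3 * hessC * c' ^ 2 * ∫ x in annulus (2 * R), ‖u x‖ ^ 2 := by
  rw [hfun_eq_newtonNearPotential_dloc hu hR hρ (divFree_coord hprof)]
  refine (integral_sq_pderiv_pderiv_newtonNearPotential_le hρ (contDiff_dloc hu) (hasCompactSupport_dloc hR) j i).trans ?_
  have := integral_sq_dloc_le hu hR hχ1
  calc hessC * ∫ x, dloc u R x ^ 2 ≤ hessC * (3 * c' ^ 2 * ∫ x in annulus (2 * R), ‖u x‖ ^ 2) :=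
        mul_le_mul_of_nonneg_left this hessC_pos.le
    _ = _ := by ring

/-! ### The sup bounds `L₀, L₁` for the smoothing remainders -/

/-- **`L₀`**: `|Λᵢ(x)| ≤ ρ⁻³ Λ₀ ∫_{B̄_{4R}} ‖u‖`. [folklore] -/
theorem abs_rem_le (hu : ContDiff ℝ ∞ u) (hR : 0 < R) (hρ : 0 < ρ) {Λ₀ : ℝ} (hΛ0 : 0 ≤ Λ₀)
    (hΛ : ∀ z : ℝ³, |newtonFarLaplacian 1 2 z| ≤ Λ₀) (i : Fin 3) (x : ℝ³) :
    |rem u R ρ i x| ≤ ρ⁻¹ ^ 3 * Λ₀ * ∫ y in closedBall (0 : ℝ³) (4 * R), ‖u y‖ := by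
  have hg := (contDiff_gloc hu (R := R) i).continuous
  have hgc := hasCompactSupport_gloc (u := u) hR i
  have hrem : rem u R ρ i x = ∫ y, gloc u R i y * newtonFarLaplacian ρ (2 * ρ) (x - y) :=
    newtonFarSmoothing_eq_integral_kernel ρ (2 * ρ) (gloc u R i) x
  rw [hrem]
  have hI : Integrable fun y => ρ⁻¹ ^ 3 * Λ₀ * |gloc u R i y| :=
    (hg.abs.integrable_of_hasCompactSupport hgc.abs).const_mul _
  calc |∫ y, gloc u R i y * newtonFarLaplacian ρ (2 * ρ) (x - y)|
      ≤ ∫ y, |gloc u R i y * newtonFarLaplacian ρ (2 * ρ) (x - y)| := abs_integral_le_integral_abs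
    _ ≤ ∫ y, ρ⁻¹ ^ 3 * Λ₀ * |gloc u R i y| := by
        refine integral_mono_of_nonneg (Eventually.of_forall fun y => abs_nonneg _) hI
          (Eventually.of_forall fun y => ?_)
        show |gloc u R i y * newtonFarLaplacian ρ (2 * ρ) (x - y)| ≤ ρ⁻¹ ^ 3 * Λ₀ * |gloc u R i y|
        rw [abs_mul, mul_comm]
        exact mul_le_mul_of_nonneg_right (abs_newtonFarLaplacian_rho_le hρ hΛ _) (abs_nonneg _)
    _ = ρ⁻¹ ^ 3 * Λ₀ * ∫ y, |gloc u R i y| := integral_const_mul _ _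
    _ ≤ ρ⁻¹ ^ 3 * Λ₀ * ∫ y in closedBall (0 : ℝ³) (4 * R), ‖u y‖ :=
        mul_le_mul_of_nonneg_left (integral_abs_gloc_le hu hR i) (by positivity)

/-- **`L₁`**: `|∂ⱼΛᵢ(x)| ≤ ρ⁻⁴ Λ₀ ∫_{B̄_{4R}} ‖u‖`. [folklore] -/
theorem abs_pderiv_rem_le (hu : ContDiff ℝ ∞ u) (hR : 0 < R) (hρ : 0 < ρ) {Λ₀ : ℝ} (hΛ0 : 0 ≤ Λ₀)
    (hΛ : ∀ (k : Fin 3) (z : ℝ³), |pderiv k (newtonFarLaplacian 1 2) z| ≤ Λ₀) (i j : Fin 3) (x : ℝ³) :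
    |pderiv j (rem u R ρ i) x| ≤ ρ⁻¹ ^ 4 * Λ₀ * ∫ y in closedBall (0 : ℝ³) (4 * R), ‖u y‖ := by
  have hg := (contDiff_gloc hu (R := R) i).continuous
  have hgc := hasCompactSupport_gloc (u := u) hR i
  have hrem : pderiv j (rem u R ρ i) x =
      ∫ y, gloc u R i y * pderiv j (newtonFarLaplacian ρ (2 * ρ)) (x - y) := by
    rw [pderiv_apply]
    exact fderiv_newtonFarSmoothing_eq_integral_kernel hρ (by linarith) hg hgc x (stdVec j)
  rw [hrem]
  have hI : Integrable fun y => ρ⁻¹ ^ 4 * Λ₀ * |gloc u R i y| :=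
    (hg.abs.integrable_of_hasCompactSupport hgc.abs).const_mul _
  calc |∫ y, gloc u R i y * pderiv j (newtonFarLaplacian ρ (2 * ρ)) (x - y)|
      ≤ ∫ y, |gloc u R i y * pderiv j (newtonFarLaplacian ρ (2 * ρ)) (x - y)| := abs_integral_le_integral_abs
    _ ≤ ∫ y, ρ⁻¹ ^ 4 * Λ₀ * |gloc u R i y| := by
        refine integral_mono_of_nonneg (Eventually.of_forall fun y => abs_nonneg _) hI
          (Eventually.of_forall fun y => ?_)
        show |gloc u R i y * pderiv j (newtonFarLaplacian ρ (2 * ρ)) (x - y)| ≤ ρ⁻¹ ^ 4 * Λ₀ * |gloc u R i y|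
        rw [abs_mul, mul_comm]
        exact mul_le_mul_of_nonneg_right (abs_pderiv_newtonFarLaplacian_rho_le hρ hΛ j _) (abs_nonneg _)
    _ = ρ⁻¹ ^ 4 * Λ₀ * ∫ y, |gloc u R i y| := integral_const_mul _ _
    _ ≤ ρ⁻¹ ^ 4 * Λ₀ * ∫ y in closedBall (0 : ℝ³) (4 * R), ‖u y‖ :=
        mul_le_mul_of_nonneg_left (integral_abs_gloc_le hu hR i) (by positivity)

end PotentialBounds2

section HolderTails

local notation "ℝ³" => EuclideanSpace ℝ (Fin 3)

/-- The `L^{9/2}` norm of `u` on a set, as a real number. [folklore] -/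
def n92 (u : ℝ³ → ℝ³) (S : Set ℝ³) : ℝ := (eLpNorm u (9 / 2 : ℝ≥0∞) (volume.restrict S)).toReal

/-- The local `L^{9/2}` norm is nonnegative. [folklore] -/
theorem n92_nonneg (u : ℝ³ → ℝ³) (S : Set ℝ³) : 0 ≤ n92 u S := ENNReal.toReal_nonneg

/-- Monotonicity of the local `L^{9/2}` norm in the set. [folklore] -/
theorem n92_mono {u : ℝ³ → ℝ³} (hu : MemLp u (9 / 2 : ℝ≥0∞) volume) {S T : Set ℝ³} (h : S ⊆ T) :
    n92 u S ≤ n92 u T := by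
  unfold n92
  refine (ENNReal.toReal_le_toReal ?_ ?_).2 (eLpNorm_mono_measure u (Measure.restrict_mono h le_rfl))
  · exact ((hu.restrict S).eLpNorm_lt_top).ne
  · exact ((hu.restrict T).eLpNorm_lt_top).ne

/-- **Hölder from `L^{9/2}` on a set of finite measure**: for `q ∈ {1, …, 4}`,
`∫_S ‖u‖^q ≤ ‖u‖_{L^{9/2}(S)}^q |S|^{1 - 2q/9}`. [folklore] -/
theorem setIntegral_norm_pow_le {u : ℝ³ → ℝ³} (hu : MemLp u (9 / 2 : ℝ≥0∞) volume) {S : Set ℝ³}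
    (hS : volume S ≠ ⊤) (q : ℕ) (hq1 : 1 ≤ q) (hq4 : q ≤ 4) :
    ∫ x in S, ‖u x‖ ^ q ≤ n92 u S ^ q * (volume S).toReal ^ (1 - 2 * (q : ℝ) / 9) := by
  haveI : IsFiniteMeasure (volume.restrict S) := isFiniteMeasure_restrict.2 hS
  set μ : Measure ℝ³ := volume.restrict S with hμ
  have hq0 : (q : ℝ≥0∞) ≠ 0 := by exact_mod_cast (by omega : q ≠ 0)
  have hqtop : (q : ℝ≥0∞) ≠ ⊤ := ENNReal.natCast_ne_top q
  have hqr : ((q : ℝ≥0∞)).toReal = q := by simp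
  have hle : (q : ℝ≥0∞) ≤ (9 / 2 : ℝ≥0∞) := by
    have : (q : ℝ≥0∞) ≤ (4 : ℝ≥0∞) := by exact_mod_cast hq4
    refine this.trans ?_
    rw [ENNReal.le_div_iff_mul_le (Or.inl (by norm_num)) (Or.inl (by norm_num))]
    norm_num
  have hμS : MemLp u (9 / 2 : ℝ≥0∞) μ := hu.restrict S
  have hμq : MemLp u (q : ℝ≥0∞) μ := hμS.mono_exponent hle
  -- Hölder in `ℝ≥0∞`
  have hH := eLpNorm_le_eLpNorm_mul_rpow_measure_univ hle hμS.aestronglyMeasurable (μ := μ)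
  rw [hμq.eLpNorm_eq_integral_rpow_norm hq0 hqtop, hqr] at hH
  have hexp : 1 / (q : ℝ) - 1 / (9 / 2 : ℝ≥0∞).toReal = 1 / (q : ℝ) - 2 / 9 := by
    rw [ENNReal.toReal_div]; norm_num
  rw [hexp, Measure.restrict_apply_univ] at hH
  -- pass to real numbers
  have hI0 : 0 ≤ ∫ x, ‖u x‖ ^ (q : ℝ) ∂μ := integral_nonneg fun _ => by positivity
  have hfin1 : eLpNorm u (9 / 2 : ℝ≥0∞) μ ≠ ⊤ := hμS.eLpNorm_lt_top.ne
  have hfin2 : volume S ^ (1 / (q : ℝ) - 2 / 9) ≠ ⊤ := by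
    refine ENNReal.rpow_ne_top_of_nonneg ?_ hS
    have : (q : ℝ) ≤ 4 := by exact_mod_cast hq4
    have hq1' : (1 : ℝ) ≤ q := by exact_mod_cast hq1
    rw [sub_nonneg, div_le_div_iff₀ (by norm_num) (by linarith)]
    linarith
  have hH' : (∫ x, ‖u x‖ ^ (q : ℝ) ∂μ) ^ ((q : ℝ))⁻¹ ≤
      n92 u S * (volume S).toReal ^ (1 / (q : ℝ) - 2 / 9) := by
    have := (ENNReal.ofReal_le_iff_le_toReal (ENNReal.mul_ne_top hfin1 hfin2)).1 hH
    rwa [ENNReal.toReal_mul, ← ENNReal.toReal_rpow] at this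
  -- raise to the power `q`
  have hq_pos : (0 : ℝ) < q := by exact_mod_cast (by omega : 0 < q)
  have hbase : 0 ≤ (∫ x, ‖u x‖ ^ (q : ℝ) ∂μ) ^ ((q : ℝ))⁻¹ := Real.rpow_nonneg hI0 _
  have hpow := pow_le_pow_left₀ hbase hH' q
  rw [← Real.rpow_natCast, ← Real.rpow_mul hI0, inv_mul_cancel₀ hq_pos.ne', Real.rpow_one,
    mul_pow, ← Real.rpow_natCast ((volume S).toReal ^ _), ← Real.rpow_mul ENNReal.toReal_nonneg] at hpow
  have hexp2 : (1 / (q : ℝ) - 2 / 9) * (q : ℝ) = 1 - 2 * (q : ℝ) / 9 := by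
    field_simp
  rw [hexp2] at hpow
  have hint : ∫ x in S, ‖u x‖ ^ q = ∫ x, ‖u x‖ ^ (q : ℝ) ∂μ := by
    refine integral_congr_ae (Eventually.of_forall fun x => ?_)
    simp [Real.rpow_natCast]
  rw [hint]
  exact hpow


/-! ### Volumes of balls in `ℝ³` -/

/-- The volume of the unit ball of `ℝ³`, as a real number. [folklore] -/
def v₁ : ℝ := (volume (ball (0 : ℝ³) 1)).toReal

/-- The unit ball has positive volume. [folklore] -/
theorem v₁_pos : 0 < v₁ :=
  ENNReal.toReal_pos (measure_ball_pos volume (0 : ℝ³) one_pos).ne' measure_ball_lt_top.ne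

/-- `|B̄(0, r)| = v₁ r³` in `ℝ³`. [folklore] -/
theorem toReal_volume_closedBall {r : ℝ} (hr : 0 ≤ r) :
    (volume (closedBall (0 : ℝ³) r)).toReal = v₁ * r ^ 3 := by
  rw [Measure.addHaar_closedBall volume (0 : ℝ³) hr, ENNReal.toReal_mul, finrank_euclideanSpace_fin,
    ENNReal.toReal_ofReal (by positivity), v₁, mul_comm]

/-- `|B̄(0, c s⁶)|^θ = (v₁ c³)^θ s^m` when `18 θ = m`. [folklore] -/
theorem rpow_volume_closedBall {c s θ : ℝ} (hc : 0 < c) (hs : 0 < s) {m : ℕ}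
    (hm : 18 * θ = m) :
    (volume (closedBall (0 : ℝ³) (c * s ^ 6))).toReal ^ θ = (v₁ * c ^ 3) ^ θ * s ^ m := by
  rw [toReal_volume_closedBall (by positivity)]
  have h1 : v₁ * (c * s ^ 6) ^ 3 = (v₁ * c ^ 3) * s ^ 18 := by ring
  rw [h1, Real.mul_rpow (mul_nonneg v₁_pos.le (by positivity)) (by positivity)]
  congr 1
  rw [← Real.rpow_natCast s 18, ← Real.rpow_mul hs.le, show ((18 : ℕ) : ℝ) * θ = m by exact_mod_cast hm,
    Real.rpow_natCast]

/-- **Hölder on a subset of a ball of radius `c s⁶`**: `∫_S ‖u‖^q ≤ E^q (v₁c³)^θ s^m` with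
`θ = 1 - 2q/9`, `18θ = m`, `E ≥ ‖u‖_{L^{9/2}(S)}`. [folklore] -/
theorem setIntegral_norm_pow_le_monomial {u : ℝ³ → ℝ³} (hu : MemLp u (9 / 2 : ℝ≥0∞) volume)
    {S : Set ℝ³} {c s : ℝ} (hc : 0 < c) (hs : 0 < s) (hsub : S ⊆ closedBall (0 : ℝ³) (c * s ^ 6))
    (q : ℕ) (hq1 : 1 ≤ q) (hq4 : q ≤ 4) {m : ℕ} (hm : 18 * (1 - 2 * (q : ℝ) / 9) = m) {E : ℝ}
    (hE : n92 u S ≤ E) :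
    ∫ x in S, ‖u x‖ ^ q ≤ E ^ q * ((v₁ * c ^ 3) ^ (1 - 2 * (q : ℝ) / 9) * s ^ m) := by
  have hθ : 0 ≤ 1 - 2 * (q : ℝ) / 9 := by
    have : (q : ℝ) ≤ 4 := by exact_mod_cast hq4
    linarith
  have hvol : volume S ≤ volume (closedBall (0 : ℝ³) (c * s ^ 6)) := measure_mono hsub
  have hfin : volume (closedBall (0 : ℝ³) (c * s ^ 6)) ≠ ⊤ := measure_closedBall_lt_top.ne
  have hS : volume S ≠ ⊤ := (lt_of_le_of_lt hvol measure_closedBall_lt_top).ne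
  refine (setIntegral_norm_pow_le hu hS q hq1 hq4).trans ?_
  rw [← rpow_volume_closedBall hc hs hm]
  refine mul_le_mul (pow_le_pow_left₀ (n92_nonneg u S) hE q)
    (Real.rpow_le_rpow ENNReal.toReal_nonneg ((ENNReal.toReal_le_toReal hS hfin).2 hvol) hθ)
    (Real.rpow_nonneg ENNReal.toReal_nonneg _) (pow_nonneg ((n92_nonneg u S).trans hE) q)

/-! ### Tails -/

/-- The exterior region `{s⁶ ≤ ‖x‖}`. [folklore] -/
def ext (s : ℝ) : Set ℝ³ := {x | s ^ 6 ≤ ‖x‖}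

/-- The exterior region is measurable. [folklore] -/
theorem measurableSet_ext (s : ℝ) : MeasurableSet (ext s) :=
  measurableSet_le measurable_const measurable_norm

/-- The exterior regions decrease in `s`. [folklore] -/
theorem ext_antitone {s t : ℝ} (hs : 0 ≤ s) (hst : s ≤ t) : ext t ⊆ ext s := fun x hx => by
  simp only [ext, mem_setOf_eq] at hx ⊢
  exact le_trans (pow_le_pow_left₀ hs hst 6) hx

/-- The exterior regions along `s = n + 1` have empty intersection. [folklore] -/
theorem iInter_ext_nat : ⋂ n : ℕ, ext ((n : ℝ) + 1) = ∅ := by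
  ext x
  simp only [mem_iInter, ext, mem_setOf_eq, mem_empty_iff_false, iff_false, not_forall, not_le]
  obtain ⟨n, hn⟩ := exists_nat_gt ‖x‖
  refine ⟨n, hn.trans_le ?_⟩
  have h1 : (1 : ℝ) ≤ (n : ℝ) + 1 := by linarith [n.cast_nonneg (α := ℝ)]
  calc (n : ℝ) ≤ (n : ℝ) + 1 := by linarith
    _ = ((n : ℝ) + 1) ^ 1 := (pow_one _).symm
    _ ≤ ((n : ℝ) + 1) ^ 6 := pow_le_pow_right₀ h1 (by norm_num)

/-- **The `L^{9/2}` tail vanishes**: `‖u‖_{L^{9/2}({(n+1)⁶ ≤ ‖x‖})} → 0`. [folklore] -/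
theorem tendsto_n92_ext {u : ℝ³ → ℝ³} (hu : MemLp u (9 / 2 : ℝ≥0∞) volume) :
    Tendsto (fun n : ℕ => n92 u (ext ((n : ℝ) + 1))) atTop (𝓝 0) := by
  have hp0 : (9 / 2 : ℝ≥0∞) ≠ 0 := by norm_num
  have hptop : (9 / 2 : ℝ≥0∞) ≠ ⊤ := by
    rw [Ne, ENNReal.div_eq_top]; norm_num
  have hpr : (9 / 2 : ℝ≥0∞).toReal = 9 / 2 := by rw [ENNReal.toReal_div]; norm_num
  set F : ℝ³ → ℝ≥0∞ := fun x => ‖u x‖ₑ ^ (9 / 2 : ℝ) with hF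
  have hFint : ∫⁻ x, F x ≠ ⊤ := by
    have h := hu.eLpNorm_lt_top
    rw [eLpNorm_eq_lintegral_rpow_enorm_toReal hp0 hptop, hpr] at h
    exact ((ENNReal.rpow_lt_top_iff_of_pos (by norm_num)).1 h).ne
  have hFm : AEMeasurable F volume := (hu.aestronglyMeasurable.aemeasurable.enorm.pow_const _)
  -- the exterior `L^{9/2}`-mass as a finite measure evaluated on decreasing sets
  set ν : Measure ℝ³ := volume.withDensity F with hν
  haveI : IsFiniteMeasure ν := isFiniteMeasure_withDensity hFint
  have hνS : ∀ n : ℕ, ν (ext ((n : ℝ) + 1)) = ∫⁻ x in ext ((n : ℝ) + 1), F x := fun n =>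
    withDensity_apply F (measurableSet_ext _)
  have hanti : Antitone fun n : ℕ => ext ((n : ℝ) + 1) := fun m n hmn =>
    ext_antitone (by positivity) (by have : (m : ℝ) ≤ n := Nat.cast_le.2 hmn; linarith)
  have hlim : Tendsto (fun n : ℕ => ν (ext ((n : ℝ) + 1))) atTop (𝓝 0) := by
    have h := tendsto_measure_iInter_atTop (μ := ν) (s := fun n : ℕ => ext ((n : ℝ) + 1))
      (fun n => (measurableSet_ext ((n : ℝ) + 1)).nullMeasurableSet) hanti ⟨0, measure_ne_top ν _⟩
    rw [iInter_ext_nat, measure_empty] at h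
    exact h
  -- `n92 = (ν S)^{2/9}` in real terms
  have heq : ∀ n : ℕ, n92 u (ext ((n : ℝ) + 1)) = ((ν (ext ((n : ℝ) + 1))) ^ (1 / (9 / 2 : ℝ))).toReal := by
    intro n
    rw [n92, eLpNorm_eq_lintegral_rpow_enorm_toReal hp0 hptop, hpr, hνS]
  simp_rw [heq]
  have h2 : Tendsto (fun n : ℕ => (ν (ext ((n : ℝ) + 1))) ^ (1 / (9 / 2 : ℝ))) atTop (𝓝 0) := by
    have := (ENNReal.continuous_rpow_const (y := 1 / (9 / 2 : ℝ))).tendsto 0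
    rw [ENNReal.zero_rpow_of_pos (by norm_num)] at this
    exact this.comp hlim
  rw [← ENNReal.toReal_zero]
  exact (ENNReal.tendsto_toReal ENNReal.zero_ne_top).comp h2

/-- Tails of an integrable function over the exterior regions vanish. [folklore] -/
theorem tendsto_setIntegral_ext {f : ℝ³ → ℝ} (hf : Integrable f) :
    Tendsto (fun n : ℕ => ∫ x in ext ((n : ℝ) + 1), f x) atTop (𝓝 0) := by
  have hanti : Antitone fun n : ℕ => ext ((n : ℝ) + 1) := fun m n hmn =>
    ext_antitone (by positivity) (by have : (m : ℝ) ≤ n := Nat.cast_le.2 hmn; linarith)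
  have h := tendsto_setIntegral_of_antitone (μ := volume) (f := f) (s := fun n : ℕ => ext ((n : ℝ) + 1))
    (fun n => measurableSet_ext ((n : ℝ) + 1)) hanti ⟨0, hf.integrableOn⟩
  rw [iInter_ext_nat] at h
  simpa using h

/-- The integrals over the balls `B̄(0, (n+1)⁶)` exhaust the integral. [folklore] -/
theorem tendsto_setIntegral_closedBall {f : ℝ³ → ℝ} (hf : Integrable f) :
    Tendsto (fun n : ℕ => ∫ x in closedBall (0 : ℝ³) (((n : ℝ) + 1) ^ 6), f x) atTop (𝓝 (∫ x, f x)) := by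
  have hmono : Monotone fun n : ℕ => closedBall (0 : ℝ³) (((n : ℝ) + 1) ^ 6) := fun m n hmn =>
    closedBall_subset_closedBall (pow_le_pow_left₀ (by positivity)
      (by have : (m : ℝ) ≤ n := Nat.cast_le.2 hmn; linarith) 6)
  have hunion : (⋃ n : ℕ, closedBall (0 : ℝ³) (((n : ℝ) + 1) ^ 6)) = univ := by
    refine eq_univ_of_forall fun x => ?_
    obtain ⟨n, hn⟩ := exists_nat_gt ‖x‖
    refine mem_iUnion.2 ⟨n, mem_closedBall_zero_iff.2 (hn.le.trans ?_)⟩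
    have h1 : (1 : ℝ) ≤ (n : ℝ) + 1 := by linarith [n.cast_nonneg (α := ℝ)]
    calc (n : ℝ) ≤ (n : ℝ) + 1 := by linarith
      _ = ((n : ℝ) + 1) ^ 1 := (pow_one _).symm
      _ ≤ ((n : ℝ) + 1) ^ 6 := pow_le_pow_right₀ h1 (by norm_num)
  have h := tendsto_setIntegral_of_monotone (μ := volume) (f := f)
    (s := fun n : ℕ => closedBall (0 : ℝ³) (((n : ℝ) + 1) ^ 6)) (fun n => measurableSet_closedBall) hmono
    (by rw [hunion]; exact hf.integrableOn)
  rwa [hunion, setIntegral_univ] at h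


end HolderTails

/-- `√X ≤ Y` from `X ≤ Y²`, `Y ≥ 0`. [folklore] -/
theorem sqrt_le_of_le_sq {X Y : ℝ} (hY : 0 ≤ Y) (h : X ≤ Y ^ 2) : Real.sqrt X ≤ Y :=
  Real.sqrt_le_iff.2 ⟨hY, h⟩

section Algebra

variable {C₁ C₂ Λ₀ hC mΓ v a₁ a₂ a₃ a₄ a₅ n D : ℝ}
variable {s κ e d IA2 IA3 IA4 IB4 IB2 IB1 IA2p DA DB c₁ c₂ L₀ L₁ H₁ H₂ T₀ T₁ vB : ℝ}

/-- Basic consequences of `1 ≤ s`, `1 ≤ κ`. [folklore] -/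
theorem inv_le_one_of_one_le' {s : ℝ} (hs : 1 ≤ s) : s⁻¹ ≤ 1 := inv_le_one_of_one_le₀ hs

/-- Term 1: `9 √DA (c₁ √IA2) ≤ (9 C₁ √a₁ n) d`. [folklore] -/
theorem T1_le (hC₁ : 0 ≤ C₁) (ha₁ : 0 ≤ a₁) (hs : 1 ≤ s) (he : 0 ≤ e) (hen : e ≤ n)
    (hd : 0 ≤ d) (hDA : DA ≤ d ^ 2) (hIA2 : IA2 ≤ e ^ 2 * a₁ * s ^ 10) (hc₁ : 0 ≤ c₁)
    (hc₁' : c₁ ≤ C₁ / s ^ 6) :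
    9 * Real.sqrt DA * (c₁ * Real.sqrt IA2) ≤ (9 * C₁ * Real.sqrt a₁ * n) * d := by
  have hs0 : 0 < s := by linarith
  have hn : 0 ≤ n := he.trans hen
  have h1 : Real.sqrt DA ≤ d := sqrt_le_of_le_sq hd hDA
  have h2 : Real.sqrt IA2 ≤ Real.sqrt a₁ * e * s ^ 5 := by
    refine sqrt_le_of_le_sq (by positivity) (hIA2.trans_eq ?_)
    rw [mul_pow, mul_pow, Real.sq_sqrt ha₁]; ring
  have h3 : c₁ * Real.sqrt IA2 ≤ C₁ / s ^ 6 * (Real.sqrt a₁ * e * s ^ 5) :=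
    mul_le_mul hc₁' h2 (Real.sqrt_nonneg _) (by positivity)
  have h4 : C₁ / s ^ 6 * (Real.sqrt a₁ * e * s ^ 5) = C₁ * Real.sqrt a₁ * e * s⁻¹ := by
    field_simp
  have h5 : C₁ * Real.sqrt a₁ * e * s⁻¹ ≤ C₁ * Real.sqrt a₁ * n * 1 :=
    mul_le_mul (mul_le_mul_of_nonneg_left hen (by positivity)) (inv_le_one_of_one_le' hs)
      (by positivity) (by positivity)
  calc 9 * Real.sqrt DA * (c₁ * Real.sqrt IA2) ≤ 9 * d * (C₁ * Real.sqrt a₁ * n * 1) := by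
        refine mul_le_mul (mul_le_mul_of_nonneg_left h1 (by norm_num)) (h3.trans (h4.le.trans h5))
          (by positivity) (by positivity)
    _ = (9 * C₁ * Real.sqrt a₁ * n) * d := by ring

/-- Term 2: `(3/2) c₁ IA3 ≤ ((3/2) C₁ a₂ n²) e`. [folklore] -/
theorem T2_le (hC₁ : 0 ≤ C₁) (ha₂ : 0 ≤ a₂) (hs : 1 ≤ s) (he : 0 ≤ e) (hen : e ≤ n)
    (hIA3 : IA3 ≤ e ^ 3 * a₂ * s ^ 6) (hIA3' : 0 ≤ IA3) (hc₁' : c₁ ≤ C₁ / s ^ 6) :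
    3 / 2 * c₁ * IA3 ≤ (3 / 2 * C₁ * a₂ * n ^ 2) * e := by
  have hs0 : 0 < s := by linarith
  have h1 : c₁ * IA3 ≤ C₁ / s ^ 6 * (e ^ 3 * a₂ * s ^ 6) := mul_le_mul hc₁' hIA3 hIA3' (by positivity)
  have h2 : C₁ / s ^ 6 * (e ^ 3 * a₂ * s ^ 6) = C₁ * a₂ * e ^ 2 * e := by field_simp
  have h3 : C₁ * a₂ * e ^ 2 * e ≤ C₁ * a₂ * n ^ 2 * e := by
    have : e ^ 2 ≤ n ^ 2 := pow_le_pow_left₀ he hen 2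
    exact mul_le_mul_of_nonneg_right (mul_le_mul_of_nonneg_left this (by positivity)) he
  calc 3 / 2 * c₁ * IA3 = 3 / 2 * (c₁ * IA3) := by ring
    _ ≤ 3 / 2 * (C₁ * a₂ * n ^ 2 * e) := by
        refine mul_le_mul_of_nonneg_left (h1.trans (h2.le.trans h3)) (by norm_num)
    _ = (3 / 2 * C₁ * a₂ * n ^ 2) * e := by ring


/-- `κ⁻¹ ^ m ≤ κ⁻¹ ^ k` for `k ≤ m` when `κ ≥ 1`. [folklore] -/
theorem inv_pow_le_inv_pow {κ : ℝ} (hκ : 1 ≤ κ) {k m : ℕ} (hkm : k ≤ m) : κ⁻¹ ^ m ≤ κ⁻¹ ^ k :=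
  pow_le_pow_of_le_one (inv_nonneg.2 (by linarith)) (inv_le_one_of_one_le' hκ) hkm

/-- Term 3 (the smoothing remainder): with `y₃ = Λ₀ n a₅`,
`9 (√DB + √IB4) √(2(c₁²L₀² + L₁²) vB) ≤ K₃ s⁻¹ + K₃' κ⁻³`. [folklore] -/
theorem T3_le (hC₁ : 0 ≤ C₁) (hΛ₀ : 0 ≤ Λ₀) (hv : 0 ≤ v) (ha₃ : 0 ≤ a₃) (ha₅ : 0 ≤ a₅) (hn : 0 ≤ n)
    (hs : 1 ≤ s) (hκ : 1 ≤ κ) (hDB : DB ≤ D) (hIB4 : IB4 ≤ n ^ 4 * a₃ * s ^ 2)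
    (hIB1' : IB1 ≤ n * a₅ * s ^ 14) (hc₁ : 0 ≤ c₁) (hc₁' : c₁ ≤ C₁ / s ^ 6)
    (hL₀ : 0 ≤ L₀) (hL₀' : L₀ ≤ Λ₀ * IB1 * (κ⁻¹ ^ 3 * (s ^ 6)⁻¹ ^ 3))
    (hL₁ : 0 ≤ L₁) (hL₁' : L₁ ≤ Λ₀ * IB1 * (κ⁻¹ ^ 4 * (s ^ 6)⁻¹ ^ 4))
    (hvB : 0 ≤ vB) (hvB' : vB ≤ 8 * v * s ^ 18) :
    9 * (Real.sqrt DB + Real.sqrt IB4) * Real.sqrt (2 * (c₁ ^ 2 * L₀ ^ 2 + L₁ ^ 2) * vB) ≤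
      (36 * Real.sqrt (v * (C₁ ^ 2 + 1)) * (Λ₀ * n * a₅) * Real.sqrt D) * s⁻¹ +
        (36 * Real.sqrt (v * (C₁ ^ 2 + 1)) * (Λ₀ * n * a₅) * (Real.sqrt a₃ * n ^ 2)) * κ⁻¹ ^ 3 := by
  have hs0 : 0 < s := by linarith
  have hκ0 : 0 < κ := by linarith
  set y₃ := Λ₀ * n * a₅ with hy₃
  have hy₃0 : 0 ≤ y₃ := by positivity
  -- the two sup bounds in monomial form
  have hL0m : L₀ ≤ y₃ * κ⁻¹ ^ 3 * s⁻¹ ^ 4 := by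
    refine hL₀'.trans ?_
    calc Λ₀ * IB1 * (κ⁻¹ ^ 3 * (s ^ 6)⁻¹ ^ 3) ≤ Λ₀ * (n * a₅ * s ^ 14) * (κ⁻¹ ^ 3 * (s ^ 6)⁻¹ ^ 3) :=
          mul_le_mul_of_nonneg_right (mul_le_mul_of_nonneg_left hIB1' hΛ₀) (by positivity)
      _ = y₃ * κ⁻¹ ^ 3 * s⁻¹ ^ 4 := by rw [hy₃]; field_simp
  have hL1m : L₁ ≤ y₃ * κ⁻¹ ^ 4 * s⁻¹ ^ 10 := by
    refine hL₁'.trans ?_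
    calc Λ₀ * IB1 * (κ⁻¹ ^ 4 * (s ^ 6)⁻¹ ^ 4) ≤ Λ₀ * (n * a₅ * s ^ 14) * (κ⁻¹ ^ 4 * (s ^ 6)⁻¹ ^ 4) :=
          mul_le_mul_of_nonneg_right (mul_le_mul_of_nonneg_left hIB1' hΛ₀) (by positivity)
      _ = y₃ * κ⁻¹ ^ 4 * s⁻¹ ^ 10 := by rw [hy₃]; field_simp
  have hcL : c₁ * L₀ ≤ C₁ / s ^ 6 * (y₃ * κ⁻¹ ^ 3 * s⁻¹ ^ 4) := mul_le_mul hc₁' hL0m hL₀ (by positivity)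
  -- the square of the target
  set Y := 4 * Real.sqrt (v * (C₁ ^ 2 + 1)) * y₃ * κ⁻¹ ^ 3 * s⁻¹ with hY
  have hY0 : 0 ≤ Y := by positivity
  have hsq : 2 * (c₁ ^ 2 * L₀ ^ 2 + L₁ ^ 2) * vB ≤ Y ^ 2 := by
    have e1 : c₁ ^ 2 * L₀ ^ 2 ≤ (C₁ / s ^ 6 * (y₃ * κ⁻¹ ^ 3 * s⁻¹ ^ 4)) ^ 2 := by
      rw [← mul_pow]; exact pow_le_pow_left₀ (by positivity) hcL 2
    have e2 : L₁ ^ 2 ≤ (y₃ * κ⁻¹ ^ 4 * s⁻¹ ^ 10) ^ 2 := pow_le_pow_left₀ hL₁ hL1m 2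
    have e3 : κ⁻¹ ^ 8 ≤ κ⁻¹ ^ 6 := inv_pow_le_inv_pow hκ (by norm_num)
    calc 2 * (c₁ ^ 2 * L₀ ^ 2 + L₁ ^ 2) * vB
        ≤ 2 * ((C₁ / s ^ 6 * (y₃ * κ⁻¹ ^ 3 * s⁻¹ ^ 4)) ^ 2 + (y₃ * κ⁻¹ ^ 4 * s⁻¹ ^ 10) ^ 2) * (8 * v * s ^ 18) :=
          mul_le_mul (mul_le_mul_of_nonneg_left (add_le_add e1 e2) (by norm_num)) hvB' hvB (by positivity)
      _ = 16 * v * y₃ ^ 2 * s⁻¹ ^ 2 * (C₁ ^ 2 * κ⁻¹ ^ 6 + κ⁻¹ ^ 8) := by simp only [hy₃]; field_simp; ring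
      _ ≤ 16 * v * y₃ ^ 2 * s⁻¹ ^ 2 * (C₁ ^ 2 * κ⁻¹ ^ 6 + κ⁻¹ ^ 6) :=
          mul_le_mul_of_nonneg_left (add_le_add le_rfl e3) (by positivity)
      _ = Y ^ 2 := by
          have hw2 : Real.sqrt (v * (C₁ ^ 2 + 1)) ^ 2 = v * (C₁ ^ 2 + 1) := Real.sq_sqrt (by positivity)
          simp only [hY, hy₃]
          linear_combination (-(16 * (Λ₀ * n * a₅) ^ 2 * s⁻¹ ^ 2 * κ⁻¹ ^ 6)) * hw2
  have hS3 : Real.sqrt (2 * (c₁ ^ 2 * L₀ ^ 2 + L₁ ^ 2) * vB) ≤ Y := sqrt_le_of_le_sq hY0 hsq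
  have hDBs : Real.sqrt DB ≤ Real.sqrt D := Real.sqrt_le_sqrt hDB
  have hIB4s : Real.sqrt IB4 ≤ Real.sqrt a₃ * n ^ 2 * s := by
    refine sqrt_le_of_le_sq (by positivity) (hIB4.trans_eq ?_)
    rw [mul_pow, mul_pow, Real.sq_sqrt ha₃]; ring
  have hsum : Real.sqrt DB + Real.sqrt IB4 ≤ Real.sqrt D + Real.sqrt a₃ * n ^ 2 * s := add_le_add hDBs hIB4s
  calc 9 * (Real.sqrt DB + Real.sqrt IB4) * Real.sqrt (2 * (c₁ ^ 2 * L₀ ^ 2 + L₁ ^ 2) * vB)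
      ≤ 9 * (Real.sqrt D + Real.sqrt a₃ * n ^ 2 * s) * Y :=
        mul_le_mul (mul_le_mul_of_nonneg_left hsum (by norm_num)) hS3 (Real.sqrt_nonneg _) (by positivity)
    _ = (36 * Real.sqrt (v * (C₁ ^ 2 + 1)) * y₃ * Real.sqrt D) * (κ⁻¹ ^ 3 * s⁻¹) +
          (36 * Real.sqrt (v * (C₁ ^ 2 + 1)) * y₃ * (Real.sqrt a₃ * n ^ 2)) * (κ⁻¹ ^ 3 * (s * s⁻¹)) := by
        rw [hY]; ring
    _ ≤ (36 * Real.sqrt (v * (C₁ ^ 2 + 1)) * y₃ * Real.sqrt D) * s⁻¹ +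
          (36 * Real.sqrt (v * (C₁ ^ 2 + 1)) * y₃ * (Real.sqrt a₃ * n ^ 2)) * κ⁻¹ ^ 3 := by
        refine add_le_add (mul_le_mul_of_nonneg_left ?_ (by positivity))
          (mul_le_mul_of_nonneg_left ?_ (by positivity))
        · calc κ⁻¹ ^ 3 * s⁻¹ ≤ 1 * s⁻¹ :=
              mul_le_mul_of_nonneg_right (pow_le_one₀ (by positivity) (inv_le_one_of_one_le' hκ)) (by positivity)
            _ = s⁻¹ := one_mul _
        · rw [mul_inv_cancel₀ hs0.ne', mul_one]

/-- Term 4: `18 c₁ H₁ √DA ≤ (54 C₁ √(hC a₄) n) d`. [folklore] -/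
theorem T4_le (hC₁ : 0 ≤ C₁) (hhC : 0 ≤ hC) (ha₄ : 0 ≤ a₄) (hn : 0 ≤ n) (hs : 1 ≤ s) (hd : 0 ≤ d)
    (hDA : DA ≤ d ^ 2) (hIB2 : IB2 ≤ n ^ 2 * a₄ * s ^ 10) (hc₁' : c₁ ≤ C₁ / s ^ 6)
    (hH₁ : 0 ≤ H₁) (hH₁' : H₁ ^ 2 ≤ 9 * hC * IB2) :
    18 * c₁ * H₁ * Real.sqrt DA ≤ (54 * C₁ * Real.sqrt (hC * a₄) * n) * d := by
  have hs0 : 0 < s := by linarith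
  have h1 : Real.sqrt DA ≤ d := sqrt_le_of_le_sq hd hDA
  have hH : H₁ ≤ 3 * Real.sqrt (hC * a₄) * n * s ^ 5 := by
    refine (Real.sqrt_sq hH₁).symm.le.trans (sqrt_le_of_le_sq (by positivity) ?_)
    calc H₁ ^ 2 ≤ 9 * hC * IB2 := hH₁'
      _ ≤ 9 * hC * (n ^ 2 * a₄ * s ^ 10) := mul_le_mul_of_nonneg_left hIB2 (by positivity)
      _ = (3 * Real.sqrt (hC * a₄) * n * s ^ 5) ^ 2 := by
          rw [mul_pow, mul_pow, mul_pow, Real.sq_sqrt (by positivity)]; ring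
  have h2 : c₁ * H₁ ≤ C₁ / s ^ 6 * (3 * Real.sqrt (hC * a₄) * n * s ^ 5) := mul_le_mul hc₁' hH hH₁ (by positivity)
  have h3 : C₁ / s ^ 6 * (3 * Real.sqrt (hC * a₄) * n * s ^ 5) = 3 * C₁ * Real.sqrt (hC * a₄) * n * s⁻¹ := by
    field_simp
  have h4 : 3 * C₁ * Real.sqrt (hC * a₄) * n * s⁻¹ ≤ 3 * C₁ * Real.sqrt (hC * a₄) * n * 1 :=
    mul_le_mul_of_nonneg_left (inv_le_one_of_one_le' hs) (by positivity)
  calc 18 * c₁ * H₁ * Real.sqrt DA = 18 * (c₁ * H₁) * Real.sqrt DA := by ring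
    _ ≤ 18 * (3 * C₁ * Real.sqrt (hC * a₄) * n * 1) * d :=
        mul_le_mul (mul_le_mul_of_nonneg_left (h2.trans (h3.le.trans h4)) (by norm_num)) h1
          (Real.sqrt_nonneg _) (by positivity)
    _ = (54 * C₁ * Real.sqrt (hC * a₄) * n) * d := by ring

/-- Term 5: `9 c₁ H₁ √IA4 ≤ (27 C₁ √(hC a₄) √a₃ n²) e`. [folklore] -/
theorem T5_le (hC₁ : 0 ≤ C₁) (hhC : 0 ≤ hC) (ha₃ : 0 ≤ a₃) (ha₄ : 0 ≤ a₄) (hn : 0 ≤ n) (hs : 1 ≤ s)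
    (he : 0 ≤ e) (hen : e ≤ n) (hIA4 : IA4 ≤ e ^ 4 * a₃ * s ^ 2) (hIB2 : IB2 ≤ n ^ 2 * a₄ * s ^ 10)
    (hc₁' : c₁ ≤ C₁ / s ^ 6) (hH₁ : 0 ≤ H₁) (hH₁' : H₁ ^ 2 ≤ 9 * hC * IB2) :
    9 * c₁ * H₁ * Real.sqrt IA4 ≤ (27 * C₁ * Real.sqrt (hC * a₄) * Real.sqrt a₃ * n ^ 2) * e := by
  have hs0 : 0 < s := by linarith
  have hH : H₁ ≤ 3 * Real.sqrt (hC * a₄) * n * s ^ 5 := by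
    refine (Real.sqrt_sq hH₁).symm.le.trans (sqrt_le_of_le_sq (by positivity) ?_)
    calc H₁ ^ 2 ≤ 9 * hC * IB2 := hH₁'
      _ ≤ 9 * hC * (n ^ 2 * a₄ * s ^ 10) := mul_le_mul_of_nonneg_left hIB2 (by positivity)
      _ = (3 * Real.sqrt (hC * a₄) * n * s ^ 5) ^ 2 := by
          rw [mul_pow, mul_pow, mul_pow, Real.sq_sqrt (by positivity)]; ring
  have h2 : c₁ * H₁ ≤ C₁ / s ^ 6 * (3 * Real.sqrt (hC * a₄) * n * s ^ 5) := mul_le_mul hc₁' hH hH₁ (by positivity)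
  have h4 : Real.sqrt IA4 ≤ Real.sqrt a₃ * e ^ 2 * s := by
    refine sqrt_le_of_le_sq (by positivity) (hIA4.trans_eq ?_)
    rw [mul_pow, mul_pow, Real.sq_sqrt ha₃]; ring
  have h5 : e ^ 2 ≤ n * e := by rw [sq]; exact mul_le_mul_of_nonneg_right hen he
  calc 9 * c₁ * H₁ * Real.sqrt IA4 = 9 * (c₁ * H₁) * Real.sqrt IA4 := by ring
    _ ≤ 9 * (C₁ / s ^ 6 * (3 * Real.sqrt (hC * a₄) * n * s ^ 5)) * (Real.sqrt a₃ * e ^ 2 * s) :=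
        mul_le_mul (mul_le_mul_of_nonneg_left h2 (by norm_num)) h4 (Real.sqrt_nonneg _) (by positivity)
    _ = 27 * C₁ * Real.sqrt (hC * a₄) * Real.sqrt a₃ * n * e ^ 2 := by field_simp; ring
    _ ≤ 27 * C₁ * Real.sqrt (hC * a₄) * Real.sqrt a₃ * n * (n * e) :=
        mul_le_mul_of_nonneg_left h5 (by positivity)
    _ = (27 * C₁ * Real.sqrt (hC * a₄) * Real.sqrt a₃ * n ^ 2) * e := by ring

/-- Term 6: `9 H₂ √IB4 ≤ ((9/2) C₁ √(3 hC a₄) √a₃ n²) e`. [folklore] -/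
theorem T6_le (hC₁ : 0 ≤ C₁) (hhC : 0 ≤ hC) (ha₃ : 0 ≤ a₃) (ha₄ : 0 ≤ a₄) (hs : 1 ≤ s)
    (he : 0 ≤ e) (hIB4 : IB4 ≤ n ^ 4 * a₃ * s ^ 2) (hIA2p0 : 0 ≤ IA2p) (hIA2p : IA2p ≤ e ^ 2 * a₄ * s ^ 10)
    {c' : ℝ} (hc' : 0 ≤ c') (hc'' : c' ≤ C₁ / (2 * s ^ 6)) (hH₂ : 0 ≤ H₂)
    (hH₂' : H₂ ^ 2 ≤ 3 * hC * c' ^ 2 * IA2p) :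
    9 * H₂ * Real.sqrt IB4 ≤ (9 / 2 * C₁ * Real.sqrt (3 * hC * a₄) * Real.sqrt a₃ * n ^ 2) * e := by
  have hs0 : 0 < s := by linarith
  have hH : H₂ ≤ Real.sqrt (3 * hC * a₄) * (C₁ / (2 * s ^ 6)) * e * s ^ 5 := by
    refine (Real.sqrt_sq hH₂).symm.le.trans (sqrt_le_of_le_sq (by positivity) ?_)
    have hc2 : c' ^ 2 ≤ (C₁ / (2 * s ^ 6)) ^ 2 := pow_le_pow_left₀ hc' hc'' 2
    calc H₂ ^ 2 ≤ 3 * hC * c' ^ 2 * IA2p := hH₂'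
      _ ≤ 3 * hC * (C₁ / (2 * s ^ 6)) ^ 2 * (e ^ 2 * a₄ * s ^ 10) :=
          mul_le_mul (mul_le_mul_of_nonneg_left hc2 (by positivity)) hIA2p hIA2p0 (by positivity)
      _ = (Real.sqrt (3 * hC * a₄) * (C₁ / (2 * s ^ 6)) * e * s ^ 5) ^ 2 := by
          rw [mul_pow, mul_pow, mul_pow, Real.sq_sqrt (by positivity)]; ring
  have h4 : Real.sqrt IB4 ≤ Real.sqrt a₃ * n ^ 2 * s := by
    refine sqrt_le_of_le_sq (by positivity) (hIB4.trans_eq ?_)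
    rw [mul_pow, mul_pow, Real.sq_sqrt ha₃]; ring
  calc 9 * H₂ * Real.sqrt IB4
      ≤ 9 * (Real.sqrt (3 * hC * a₄) * (C₁ / (2 * s ^ 6)) * e * s ^ 5) * (Real.sqrt a₃ * n ^ 2 * s) :=
        mul_le_mul (mul_le_mul_of_nonneg_left hH (by norm_num)) h4 (Real.sqrt_nonneg _) (by positivity)
    _ = (9 / 2 * C₁ * Real.sqrt (3 * hC * a₄) * Real.sqrt a₃ * n ^ 2) * e := by field_simp


/-- Term 7 (the corrector): with `z = √(72 a₄ (C₂² mΓ √hC + C₁² hC))`,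
`9 (√DA + √IA4) √(18 (c₂²T₀² + c₁²T₁²)) ≤ (9 z n) κ d + (9 z n² √a₃) κ e`. [folklore] -/
theorem T7_le (hhC : 0 ≤ hC) (hmΓ : 0 ≤ mΓ) (ha₃ : 0 ≤ a₃) (ha₄ : 0 ≤ a₄)
    (hn : 0 ≤ n) (hs : 1 ≤ s) (hκ : 1 ≤ κ) (hd : 0 ≤ d) (he : 0 ≤ e) (hen : e ≤ n)
    (hDA : DA ≤ d ^ 2) (hIA4 : IA4 ≤ e ^ 4 * a₃ * s ^ 2) (hIB2' : IB2 ≤ n ^ 2 * a₄ * s ^ 10)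
    (hc₁ : 0 ≤ c₁) (hc₁' : c₁ ≤ C₁ / s ^ 6) (hc₂ : 0 ≤ c₂) (hc₂' : c₂ ≤ C₂ / (s ^ 6) ^ 2)
    (hT₀' : T₀ ^ 2 ≤ 4 * ((κ * s ^ 6) ^ 2 * mΓ * Real.sqrt hC) * IB2)
    (hT₁' : T₁ ^ 2 ≤ 4 * hC * IB2) :
    9 * (Real.sqrt DA + Real.sqrt IA4) * Real.sqrt (18 * (c₂ ^ 2 * T₀ ^ 2 + c₁ ^ 2 * T₁ ^ 2)) ≤
      (9 * Real.sqrt (72 * a₄ * (C₂ ^ 2 * mΓ * Real.sqrt hC + C₁ ^ 2 * hC)) * n) * κ * d +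
        (9 * Real.sqrt (72 * a₄ * (C₂ ^ 2 * mΓ * Real.sqrt hC + C₁ ^ 2 * hC)) * n ^ 2 * Real.sqrt a₃) * κ * e := by
  have hs0 : 0 < s := by linarith
  have hκ0 : 0 < κ := by linarith
  set z := Real.sqrt (72 * a₄ * (C₂ ^ 2 * mΓ * Real.sqrt hC + C₁ ^ 2 * hC)) with hz
  have hz0 : 0 ≤ z := Real.sqrt_nonneg _
  have hz2 : z ^ 2 = 72 * a₄ * (C₂ ^ 2 * mΓ * Real.sqrt hC + C₁ ^ 2 * hC) := Real.sq_sqrt (by positivity)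
  -- the square of the corrector norm
  have e1 : c₂ ^ 2 * T₀ ^ 2 ≤ (C₂ / (s ^ 6) ^ 2) ^ 2 * (4 * ((κ * s ^ 6) ^ 2 * mΓ * Real.sqrt hC) * (n ^ 2 * a₄ * s ^ 10)) :=
    mul_le_mul (pow_le_pow_left₀ hc₂ hc₂' 2) (hT₀'.trans (mul_le_mul_of_nonneg_left hIB2' (by positivity)))
      (sq_nonneg _) (by positivity)
  have e2 : c₁ ^ 2 * T₁ ^ 2 ≤ (C₁ / s ^ 6) ^ 2 * (4 * hC * (n ^ 2 * a₄ * s ^ 10)) :=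
    mul_le_mul (pow_le_pow_left₀ hc₁ hc₁' 2) (hT₁'.trans (mul_le_mul_of_nonneg_left hIB2' (by positivity)))
      (sq_nonneg _) (by positivity)
  have e3 : (1 : ℝ) ≤ κ ^ 2 := one_le_pow₀ hκ
  have hsq : 18 * (c₂ ^ 2 * T₀ ^ 2 + c₁ ^ 2 * T₁ ^ 2) ≤ (z * n * κ * s⁻¹) ^ 2 := by
    calc 18 * (c₂ ^ 2 * T₀ ^ 2 + c₁ ^ 2 * T₁ ^ 2)
        ≤ 18 * ((C₂ / (s ^ 6) ^ 2) ^ 2 * (4 * ((κ * s ^ 6) ^ 2 * mΓ * Real.sqrt hC) * (n ^ 2 * a₄ * s ^ 10)) +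
            (C₁ / s ^ 6) ^ 2 * (4 * hC * (n ^ 2 * a₄ * s ^ 10))) :=
          mul_le_mul_of_nonneg_left (add_le_add e1 e2) (by norm_num)
      _ = 72 * a₄ * n ^ 2 * s⁻¹ ^ 2 * (C₂ ^ 2 * mΓ * Real.sqrt hC * κ ^ 2 + C₁ ^ 2 * hC * 1) := by
          field_simp; ring
      _ ≤ 72 * a₄ * n ^ 2 * s⁻¹ ^ 2 * (C₂ ^ 2 * mΓ * Real.sqrt hC * κ ^ 2 + C₁ ^ 2 * hC * κ ^ 2) := by
          refine mul_le_mul_of_nonneg_left (add_le_add le_rfl ?_) (by positivity)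
          exact mul_le_mul_of_nonneg_left e3 (by positivity)
      _ = (z * n * κ * s⁻¹) ^ 2 := by
          rw [mul_pow, mul_pow, mul_pow, hz2]; ring
  have hS7 : Real.sqrt (18 * (c₂ ^ 2 * T₀ ^ 2 + c₁ ^ 2 * T₁ ^ 2)) ≤ z * n * κ * s⁻¹ :=
    sqrt_le_of_le_sq (by positivity) hsq
  have h1 : Real.sqrt DA ≤ d := sqrt_le_of_le_sq hd hDA
  have h2 : Real.sqrt IA4 ≤ Real.sqrt a₃ * e ^ 2 * s := by
    refine sqrt_le_of_le_sq (by positivity) (hIA4.trans_eq ?_)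
    rw [mul_pow, mul_pow, Real.sq_sqrt ha₃]; ring
  have h5 : e ^ 2 ≤ n * e := by rw [sq]; exact mul_le_mul_of_nonneg_right hen he
  calc 9 * (Real.sqrt DA + Real.sqrt IA4) * Real.sqrt (18 * (c₂ ^ 2 * T₀ ^ 2 + c₁ ^ 2 * T₁ ^ 2))
      ≤ 9 * (d + Real.sqrt a₃ * e ^ 2 * s) * (z * n * κ * s⁻¹) :=
        mul_le_mul (mul_le_mul_of_nonneg_left (add_le_add h1 h2) (by norm_num)) hS7 (Real.sqrt_nonneg _)
          (by positivity)
    _ = (9 * z * n) * κ * d * s⁻¹ + (9 * z * n * Real.sqrt a₃) * κ * e ^ 2 * (s * s⁻¹) := by ring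
    _ ≤ (9 * z * n) * κ * d * 1 + (9 * z * n * Real.sqrt a₃) * κ * (n * e) * 1 := by
        refine add_le_add ?_ ?_
        · exact mul_le_mul_of_nonneg_left (inv_le_one_of_one_le' hs) (by positivity)
        · rw [mul_inv_cancel₀ hs0.ne']
          exact mul_le_mul_of_nonneg_right (mul_le_mul_of_nonneg_left h5 (by positivity)) zero_le_one
    _ = (9 * z * n) * κ * d + (9 * z * n ^ 2 * Real.sqrt a₃) * κ * e := by ring

/-- **Combining the seven term bounds.** [folklore] -/
theorem combine {T1 T2 T3 T4 T5 T6 T7 K₁ K₂ K₃ K₃' K₄ K₅ K₆ K₇ K₇' κ d e t : ℝ} (hκ : 1 ≤ κ)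
    (hd : 0 ≤ d) (he : 0 ≤ e) (ht : 0 ≤ t) (hK₁ : 0 ≤ K₁) (hK₂ : 0 ≤ K₂) (hK₃ : 0 ≤ K₃)
    (hK₄ : 0 ≤ K₄) (hK₅ : 0 ≤ K₅) (hK₆ : 0 ≤ K₆) (hK₇ : 0 ≤ K₇) (hK₇' : 0 ≤ K₇')
    (h1 : T1 ≤ K₁ * d) (h2 : T2 ≤ K₂ * e) (h3 : T3 ≤ K₃ * t + K₃' * κ⁻¹ ^ 3) (h4 : T4 ≤ K₄ * d)
    (h5 : T5 ≤ K₅ * e) (h6 : T6 ≤ K₆ * e) (h7 : T7 ≤ K₇ * κ * d + K₇' * κ * e) :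
    T1 + T2 + T3 + (T4 + T5 + T6) + T7 ≤
      (K₁ + K₂ + K₃ + K₄ + K₅ + K₆ + K₇ + K₇') * κ * (e + d + t) + K₃' * κ⁻¹ ^ 3 := by
  set X := κ * (e + d + t) with hX
  have hsum : 0 ≤ e + d + t := by positivity
  have hbase : e + d + t ≤ X := by
    rw [hX]; nlinarith
  have hdX : d ≤ X := by linarith
  have heX : e ≤ X := by linarith
  have htX : t ≤ X := by linarith
  have hκd : κ * d ≤ X := by rw [hX]; nlinarith
  have hκe : κ * e ≤ X := by rw [hX]; nlinarith
  have i1 := h1.trans (mul_le_mul_of_nonneg_left hdX hK₁)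
  have i2 := h2.trans (mul_le_mul_of_nonneg_left heX hK₂)
  have i3 : K₃ * t ≤ K₃ * X := mul_le_mul_of_nonneg_left htX hK₃
  have i4 := h4.trans (mul_le_mul_of_nonneg_left hdX hK₄)
  have i5 := h5.trans (mul_le_mul_of_nonneg_left heX hK₅)
  have i6 := h6.trans (mul_le_mul_of_nonneg_left heX hK₆)
  have i7 : K₇ * κ * d ≤ K₇ * X := by rw [mul_assoc]; exact mul_le_mul_of_nonneg_left hκd hK₇
  have i7' : K₇' * κ * e ≤ K₇' * X := by rw [mul_assoc]; exact mul_le_mul_of_nonneg_left hκe hK₇'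
  have hfin : (K₁ + K₂ + K₃ + K₄ + K₅ + K₆ + K₇ + K₇') * κ * (e + d + t) =
      K₁ * X + K₂ * X + K₃ * X + K₄ * X + K₅ * X + K₆ * X + K₇ * X + K₇' * X := by rw [hX]; ring
  rw [hfin]
  linarith

end Algebra



section FinalPrep

local notation "ℝ³" => EuclideanSpace ℝ (Fin 3)

variable {u : ℝ³ → ℝ³} {R : ℝ}

/-! ### `gradSq` is the Frobenius norm of the derivative -/

/-- `∑ᵢⱼ (∂ⱼuᵢ)² = |Du|²_{Frobenius}`. [folklore] -/
theorem gradSq_eq_frobeniusNormSq (hu : ContDiff ℝ ∞ u) (x : ℝ³) :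
    gradSq u x = frobeniusNormSq (fderiv ℝ u x) := by
  have hd : DifferentiableAt ℝ u x := (hu.differentiable (by simp)) x
  rw [frobeniusNormSq_eq_sum (EuclideanSpace.basisFun (Fin 3) ℝ), gradSq, Finset.sum_comm]
  refine Finset.sum_congr rfl fun j _ => ?_
  rw [← sum_sq_apply_eq]
  refine Finset.sum_congr rfl fun i _ => ?_
  rw [pderiv_apply, stdVec_eq_basisFun, euclidean_fderiv_apply_comp hd]

/-- Finite Dirichlet integral: `gradSq u` is integrable. [folklore] -/
theorem integrable_gradSq (hu : ContDiff ℝ ∞ u)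
    (hD : (∫⁻ x, ENNReal.ofReal (frobeniusNormSq (fderiv ℝ u x))) < ⊤) : Integrable (gradSq u) := by
  refine ⟨(continuous_gradSq hu).aestronglyMeasurable, ?_⟩
  rw [hasFiniteIntegral_iff_enorm]
  have heq : ∀ x, ‖gradSq u x‖ₑ = ENNReal.ofReal (frobeniusNormSq (fderiv ℝ u x)) := fun x => by
    rw [Real.enorm_eq_ofReal (gradSq_nonneg u x), gradSq_eq_frobeniusNormSq hu x]
  simp_rw [heq]
  exact hD

/-- If `gradSq u ≡ 0` then `Du ≡ 0`. [folklore] -/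
theorem fderiv_eq_zero_of_gradSq_eq_zero (hu : ContDiff ℝ ∞ u) {x : ℝ³} (h : gradSq u x = 0) :
    fderiv ℝ u x = 0 := by
  have hd : DifferentiableAt ℝ u x := (hu.differentiable (by simp)) x
  have hij : ∀ i j, pderiv j (fun z => u z i) x = 0 := by
    intro i j
    have h0 : pderiv j (fun z => u z i) x ^ 2 = 0 :=
      le_antisymm (h ▸ sq_pderiv_le_gradSq u i j x) (sq_nonneg _)
    exact pow_eq_zero_iff (n := 2) two_ne_zero |>.1 h0
  ext v i
  rw [euclidean_fderiv_apply_comp hd, fderiv_apply_eq_sum_mul_pderiv]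
  simp [hij]

/-! ### Set inclusions at scale `R` -/

/-- The annulus `A_R` lies in the exterior region `{R ≤ ‖x‖}`. [folklore] -/
theorem annulus_subset_ext' (R : ℝ) : annulus R ⊆ {x : ℝ³ | R ≤ ‖x‖} := fun x hx => by
  simp only [annulus, Set.mem_sdiff, mem_closedBall_zero_iff, mem_ball_zero_iff, not_lt] at hx
  exact hx.2

/-- The annulus `A_{2R}` lies in `{R ≤ ‖x‖}`. [folklore] -/
theorem annulus_two_subset (hR : 0 ≤ R) : annulus (2 * R) ⊆ {x : ℝ³ | R ≤ ‖x‖} := fun x hx => by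
  have := annulus_subset_ext' (2 * R) hx
  simp only [mem_setOf_eq] at this ⊢
  linarith

/-- The annulus `A_{2R}` lies in `B̄(0, 4R)`. [folklore] -/
theorem annulus_two_subset_closedBall (R : ℝ) : annulus (2 * R) ⊆ closedBall (0 : ℝ³) (4 * R) := by
  have := annulus_subset_closedBall (2 * R)
  rwa [show 2 * (2 * R) = 4 * R by ring] at this

/-- `∫_{B̄_R} |∇u|² ≤ ∫ ψ_R |∇u|²`. [folklore] -/
theorem setIntegral_gradSq_le_integral_cutoff (hu : ContDiff ℝ ∞ u) (hR : 0 < R) :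
    ∫ x in closedBall (0 : ℝ³) R, gradSq u x ≤ ∫ x, cutoff R x * gradSq u x := by
  have heq : ∫ x in closedBall (0 : ℝ³) R, gradSq u x = ∫ x in closedBall (0 : ℝ³) R, cutoff R x * gradSq u x := by
    refine setIntegral_congr_fun measurableSet_closedBall fun x hx => ?_
    rw [cutoff_eq_one hR (mem_closedBall_zero_iff.1 hx), one_mul]
  rw [heq]
  refine setIntegral_le_integral ?_ (Eventually.of_forall fun x => mul_nonneg (cutoff_nonneg R x) (gradSq_nonneg u x))
  exact integrable_mul_of_hasCompactSupport_left (contDiff_cutoff_infty R).continuous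
    (hasCompactSupport_cutoff (E := ℝ³) hR) (continuous_gradSq hu)

end FinalPrep


section ScaleBound

local notation "ℝ³" => EuclideanSpace ℝ (Fin 3)

variable {u : ℝ³ → ℝ³} {p : ℝ³ → ℝ}

/-- **The energy bound at scale `R = s⁶` with potential scale `ρ = κ s⁶`.** There are constants
`K, K₀ ≥ 0` (depending on `u` only through `‖u‖_{L^{9/2}}` and `∫|∇u|²`) such that for all `s, κ ≥ 1`,
`∫_{B̄(0,s⁶)} |∇u|² ≤ K κ (‖u‖_{L^{9/2}(|x| ≥ s⁶)} + ‖∇u‖_{L²(|x| ≥ s⁶)} + s⁻¹) + K₀ κ⁻³`. [folklore] -/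
theorem scale_bound (hprof : IsLerayProfile 1 0 u p) (hu : ContDiff ℝ ∞ u)
    (hLp : MemLp u (9 / 2 : ℝ≥0∞) volume) (hDint : Integrable (gradSq u)) :
    ∃ K K₀ : ℝ, 0 ≤ K ∧ 0 ≤ K₀ ∧ ∀ s κ : ℝ, 1 ≤ s → 1 ≤ κ →
      ∫ x in closedBall (0 : ℝ³) (s ^ 6), gradSq u x ≤
        K * κ * (n92 u (ext s) + Real.sqrt (∫ x in ext s, gradSq u x) + s⁻¹) + K₀ * κ⁻¹ ^ 3 := by
  obtain ⟨C₁, hC₁, hC1⟩ := exists_norm_fderiv_cutoff_le (E := ℝ³)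
  obtain ⟨C₂, hC₂, hC2⟩ := exists_norm_fderiv_fderiv_cutoff_le (E := ℝ³)
  obtain ⟨Λ₀, hΛ₀, hΛa, hΛb⟩ := exists_bound_lambda
  have hn0 : 0 ≤ n92 u univ := n92_nonneg u _
  have hD0 : 0 ≤ ∫ x, gradSq u x := integral_nonneg fun x => gradSq_nonneg u x
  have hhC : 0 ≤ hessC := hessC_pos.le
  have hmΓ : 0 ≤ massΓ := massΓ_nonneg
  have hv : 0 ≤ v₁ := v₁_pos.le
  -- volume constants
  have ha₁ : 0 ≤ (v₁ * 2 ^ 3) ^ (1 - 2 * ((2 : ℕ) : ℝ) / 9) := Real.rpow_nonneg (by positivity) _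
  have ha₂ : 0 ≤ (v₁ * 2 ^ 3) ^ (1 - 2 * ((3 : ℕ) : ℝ) / 9) := Real.rpow_nonneg (by positivity) _
  have ha₃ : 0 ≤ (v₁ * 2 ^ 3) ^ (1 - 2 * ((4 : ℕ) : ℝ) / 9) := Real.rpow_nonneg (by positivity) _
  have ha₄ : 0 ≤ (v₁ * 4 ^ 3) ^ (1 - 2 * ((2 : ℕ) : ℝ) / 9) := Real.rpow_nonneg (by positivity) _
  have ha₅ : 0 ≤ (v₁ * 4 ^ 3) ^ (1 - 2 * ((1 : ℕ) : ℝ) / 9) := Real.rpow_nonneg (by positivity) _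
  set a₁ := (v₁ * 2 ^ 3) ^ (1 - 2 * ((2 : ℕ) : ℝ) / 9) with ha1
  set a₂ := (v₁ * 2 ^ 3) ^ (1 - 2 * ((3 : ℕ) : ℝ) / 9) with ha2
  set a₃ := (v₁ * 2 ^ 3) ^ (1 - 2 * ((4 : ℕ) : ℝ) / 9) with ha3
  set a₄ := (v₁ * 4 ^ 3) ^ (1 - 2 * ((2 : ℕ) : ℝ) / 9) with ha4
  set a₅ := (v₁ * 4 ^ 3) ^ (1 - 2 * ((1 : ℕ) : ℝ) / 9) with ha5
  set n := n92 u univ with hndef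
  set D := ∫ x, gradSq u x with hDdef
  refine ⟨9 * C₁ * Real.sqrt a₁ * n + 3 / 2 * C₁ * a₂ * n ^ 2 +
      36 * Real.sqrt (v₁ * (C₁ ^ 2 + 1)) * (Λ₀ * n * a₅) * Real.sqrt D +
      54 * C₁ * Real.sqrt (hessC * a₄) * n + 27 * C₁ * Real.sqrt (hessC * a₄) * Real.sqrt a₃ * n ^ 2 +
      9 / 2 * C₁ * Real.sqrt (3 * hessC * a₄) * Real.sqrt a₃ * n ^ 2 +
      9 * Real.sqrt (72 * a₄ * (C₂ ^ 2 * massΓ * Real.sqrt hessC + C₁ ^ 2 * hessC)) * n +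
      9 * Real.sqrt (72 * a₄ * (C₂ ^ 2 * massΓ * Real.sqrt hessC + C₁ ^ 2 * hessC)) * n ^ 2 * Real.sqrt a₃,
    36 * Real.sqrt (v₁ * (C₁ ^ 2 + 1)) * (Λ₀ * n * a₅) * (Real.sqrt a₃ * n ^ 2),
    by positivity, by positivity, fun s κ hs hκ => ?_⟩
  have hs0 : 0 < s := by linarith
  have hκ0 : 0 < κ := by linarith
  have hR0 : 0 < s ^ 6 := by positivity
  have hρ0 : 0 < κ * s ^ 6 := by positivity
  -- abbreviations for the `u`-integrals at this scale
  set R := s ^ 6 with hRdef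
  set e := n92 u (ext s) with hedef
  set d := Real.sqrt (∫ x in ext s, gradSq u x) with hddef
  have he0 : 0 ≤ e := n92_nonneg u _
  have hen : e ≤ n := n92_mono hLp (subset_univ _)
  have hd0 : 0 ≤ d := Real.sqrt_nonneg _
  have hext0 : 0 ≤ ∫ x in ext s, gradSq u x := setIntegral_nonneg (measurableSet_ext s) fun x _ => gradSq_nonneg u x
  -- set inclusions
  have hA_ext : annulus R ⊆ ext s := annulus_subset_ext' R
  have hA_B : annulus R ⊆ closedBall (0 : ℝ³) (2 * s ^ 6) := annulus_subset_closedBall R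
  have hA2_ext : annulus (2 * R) ⊆ ext s := annulus_two_subset hR0.le
  have hA2_B : annulus (2 * R) ⊆ closedBall (0 : ℝ³) (4 * s ^ 6) := annulus_two_subset_closedBall R
  -- the monomial bounds
  have hIA2 : ∫ x in annulus R, ‖u x‖ ^ 2 ≤ e ^ 2 * a₁ * s ^ 10 :=
    (setIntegral_norm_pow_le_monomial hLp two_pos hs0 hA_B 2 (by norm_num) (by norm_num) (m := 10)
      (by norm_num) (n92_mono hLp hA_ext)).trans (le_of_eq (by ring))
  have hIA3 : ∫ x in annulus R, ‖u x‖ ^ 3 ≤ e ^ 3 * a₂ * s ^ 6 :=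
    (setIntegral_norm_pow_le_monomial hLp two_pos hs0 hA_B 3 (by norm_num) (by norm_num) (m := 6)
      (by norm_num) (n92_mono hLp hA_ext)).trans (le_of_eq (by ring))
  have hIA4 : ∫ x in annulus R, ‖u x‖ ^ 4 ≤ e ^ 4 * a₃ * s ^ 2 :=
    (setIntegral_norm_pow_le_monomial hLp two_pos hs0 hA_B 4 (by norm_num) (by norm_num) (m := 2)
      (by norm_num) (n92_mono hLp hA_ext)).trans (le_of_eq (by ring))
  have hIB4 : ∫ x in closedBall (0 : ℝ³) (2 * R), ‖u x‖ ^ 4 ≤ n ^ 4 * a₃ * s ^ 2 :=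
    (setIntegral_norm_pow_le_monomial hLp two_pos hs0 subset_rfl 4 (by norm_num) (by norm_num) (m := 2)
      (by norm_num) (n92_mono hLp (subset_univ _))).trans (le_of_eq (by ring))
  have hIB2 : ∫ x in closedBall (0 : ℝ³) (4 * R), ‖u x‖ ^ 2 ≤ n ^ 2 * a₄ * s ^ 10 :=
    (setIntegral_norm_pow_le_monomial hLp (by norm_num : (0:ℝ) < 4) hs0 subset_rfl 2 (by norm_num)
      (by norm_num) (m := 10) (by norm_num) (n92_mono hLp (subset_univ _))).trans (le_of_eq (by ring))
  have hIB1 : ∫ x in closedBall (0 : ℝ³) (4 * R), ‖u x‖ ≤ n * a₅ * s ^ 14 := by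
    have h := setIntegral_norm_pow_le_monomial hLp (by norm_num : (0:ℝ) < 4) hs0 subset_rfl 1 le_rfl
      (by norm_num) (m := 14) (by norm_num) (n92_mono hLp (subset_univ _))
    simp only [pow_one] at h
    exact h.trans (le_of_eq (by ring))
  have hIA2p : ∫ x in annulus (2 * R), ‖u x‖ ^ 2 ≤ e ^ 2 * a₄ * s ^ 10 :=
    (setIntegral_norm_pow_le_monomial hLp (by norm_num : (0:ℝ) < 4) hs0 hA2_B 2 (by norm_num) (by norm_num)
      (m := 10) (by norm_num) (n92_mono hLp hA2_ext)).trans (le_of_eq (by ring))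
  have hDA : ∫ x in annulus R, gradSq u x ≤ d ^ 2 := by
    rw [hddef, Real.sq_sqrt hext0]
    exact setIntegral_mono_set hDint.integrableOn (Eventually.of_forall fun x => gradSq_nonneg u x)
      (Eventually.of_forall hA_ext)
  have hDB : ∫ x in closedBall (0 : ℝ³) (2 * R), gradSq u x ≤ D :=
    setIntegral_le_integral hDint (Eventually.of_forall fun x => gradSq_nonneg u x)
  -- nonnegativity of the integrals
  have hIA30 : 0 ≤ ∫ x in annulus R, ‖u x‖ ^ 3 := setIntegral_nonneg (measurableSet_annulus R) fun x _ => by positivity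
  have hIB10 : 0 ≤ ∫ x in closedBall (0 : ℝ³) (4 * R), ‖u x‖ := setIntegral_nonneg measurableSet_closedBall fun x _ => norm_nonneg _
  have hIB20 : 0 ≤ ∫ x in closedBall (0 : ℝ³) (4 * R), ‖u x‖ ^ 2 := setIntegral_nonneg measurableSet_closedBall fun x _ => by positivity
  have hIA2p0 : 0 ≤ ∫ x in annulus (2 * R), ‖u x‖ ^ 2 := setIntegral_nonneg (measurableSet_annulus _) fun x _ => by positivity
  -- the cut-off bounds at this scale
  have hψ1 := hC1 R hR0
  have hψ2 := hC2 R hR0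
  have hχ1 : ∀ x, ‖fderiv ℝ (cutoff (E := ℝ³) (2 * R)) x‖ ≤ C₁ / (2 * R) := hC1 (2 * R) (by positivity)
  -- the abstract energy bound with the concrete potential-theoretic constants
  have hEB := energy_bound hprof hu hR0 hρ0 (c₁ := C₁ / R) (c₂ := C₂ / R ^ 2)
    (L₀ := (κ * s ^ 6)⁻¹ ^ 3 * Λ₀ * ∫ y in closedBall (0 : ℝ³) (4 * R), ‖u y‖)
    (L₁ := (κ * s ^ 6)⁻¹ ^ 4 * Λ₀ * ∫ y in closedBall (0 : ℝ³) (4 * R), ‖u y‖)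
    (H₁ := Real.sqrt (9 * hessC * ∫ x in closedBall (0 : ℝ³) (4 * R), ‖u x‖ ^ 2))
    (H₂ := Real.sqrt (3 * hessC * (C₁ / (2 * R)) ^ 2 * ∫ x in annulus (2 * R), ‖u x‖ ^ 2))
    (T₀ := Real.sqrt (4 * ((κ * s ^ 6) ^ 2 * massΓ * Real.sqrt hessC) * ∫ x in closedBall (0 : ℝ³) (4 * R), ‖u x‖ ^ 2))
    (T₁ := Real.sqrt (4 * hessC * ∫ x in closedBall (0 : ℝ³) (4 * R), ‖u x‖ ^ 2))
    (by positivity) (Real.sqrt_nonneg _) (Real.sqrt_nonneg _) hψ1 hψ2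
    (fun i x => abs_rem_le hu hR0 hρ0 hΛ₀ hΛa i x)
    (fun i j x => abs_pderiv_rem_le hu hR0 hρ0 hΛ₀ hΛb i j x)
    (fun i => (integral_sq_pderiv_hfun_le hu hR0 hρ0 i).trans (le_of_eq (Real.sq_sqrt (by positivity)).symm))
    (fun i j => (integral_sq_pderiv_pderiv_hfun_le hprof hu hR0 hρ0 hχ1 i j).trans
      (le_of_eq (Real.sq_sqrt (by positivity)).symm))
    (fun i k => (integral_sq_tens_le hu hR0 hρ0 i k).trans (le_of_eq (Real.sq_sqrt (by positivity)).symm))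
    (fun i j k => (integral_sq_pderiv_tens_le hu hR0 hρ0 i j k).trans (le_of_eq (Real.sq_sqrt (by positivity)).symm))
  refine (setIntegral_gradSq_le_integral_cutoff hu hR0).trans (hEB.trans ?_)
  -- the seven terms
  refine combine hκ hd0 he0 (inv_nonneg.2 hs0.le) (by positivity) (by positivity) (by positivity)
    (by positivity) (by positivity) (by positivity) (by positivity) (by positivity)
    (T1_le hC₁ ha₁ hs he0 hen hd0 hDA hIA2 (by positivity) le_rfl)
    (T2_le hC₁ ha₂ hs he0 hen hIA3 hIA30 le_rfl)
    (T3_le hC₁ hΛ₀ hv ha₃ ha₅ hn0 hs hκ hDB hIB4 hIB1 (by positivity) le_rfl (by positivity)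
      (le_of_eq (by rw [mul_inv]; ring)) (by positivity) (le_of_eq (by rw [mul_inv]; ring))
      (volB_nonneg R) (le_of_eq ?_))
    (T4_le hC₁ hhC ha₄ hn0 hs hd0 hDA hIB2 le_rfl (Real.sqrt_nonneg _) (le_of_eq (Real.sq_sqrt (by positivity))))
    (T5_le hC₁ hhC ha₃ ha₄ hn0 hs he0 hen hIA4 hIB2 le_rfl (Real.sqrt_nonneg _) (le_of_eq (Real.sq_sqrt (by positivity))))
    (T6_le hC₁ hhC ha₃ ha₄ hs he0 hIB4 hIA2p0 hIA2p (by positivity) le_rfl (Real.sqrt_nonneg _)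
      (le_of_eq (Real.sq_sqrt (by positivity))))
    (T7_le hhC hmΓ ha₃ ha₄ hn0 hs hκ hd0 he0 hen hDA hIA4 hIB2 (by positivity) le_rfl (by positivity)
      le_rfl (le_of_eq (Real.sq_sqrt (by positivity))) (le_of_eq (Real.sq_sqrt (by positivity))))
  -- the volume of `B̄(0, 2R)`
  rw [volB, toReal_volume_closedBall (by positivity)]
  ring

end ScaleBound


section Final

local notation "ℝ³" => EuclideanSpace ℝ (Fin 3)

variable {u : ℝ³ → ℝ³} {p : ℝ³ → ℝ}

/-- **The Dirichlet integral vanishes.** [folklore] -/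
theorem integral_gradSq_eq_zero (hprof : IsLerayProfile 1 0 u p) (hu : ContDiff ℝ ∞ u)
    (hLp : MemLp u (9 / 2 : ℝ≥0∞) volume) (hDint : Integrable (gradSq u)) :
    ∫ x, gradSq u x = 0 := by
  obtain ⟨K, K₀, hK, hK₀, hbound⟩ := scale_bound hprof hu hLp hDint
  set D := ∫ x, gradSq u x with hDdef
  have hD0 : 0 ≤ D := integral_nonneg fun x => gradSq_nonneg u x
  -- Step 1: `D ≤ K₀ κ⁻³` for every `κ ≥ 1`, letting `s = n + 1 → ∞`.
  have hstep : ∀ κ : ℝ, 1 ≤ κ → D ≤ K₀ * κ⁻¹ ^ 3 := by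
    intro κ hκ
    have hL : Tendsto (fun n : ℕ => ∫ x in closedBall (0 : ℝ³) (((n : ℝ) + 1) ^ 6), gradSq u x) atTop (𝓝 D) :=
      tendsto_setIntegral_closedBall hDint
    have he : Tendsto (fun n : ℕ => n92 u (ext ((n : ℝ) + 1))) atTop (𝓝 0) := tendsto_n92_ext hLp
    have hd : Tendsto (fun n : ℕ => Real.sqrt (∫ x in ext ((n : ℝ) + 1), gradSq u x)) atTop (𝓝 0) := by
      have h := (Real.continuous_sqrt.tendsto 0).comp (tendsto_setIntegral_ext hDint)
      rwa [Function.comp_def, Real.sqrt_zero] at h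
    have hs : Tendsto (fun n : ℕ => ((n : ℝ) + 1)⁻¹) atTop (𝓝 0) :=
      tendsto_inv_atTop_zero.comp (tendsto_natCast_atTop_atTop.atTop_add tendsto_const_nhds)
    have hR : Tendsto (fun n : ℕ => K * κ * (n92 u (ext ((n : ℝ) + 1)) +
        Real.sqrt (∫ x in ext ((n : ℝ) + 1), gradSq u x) + ((n : ℝ) + 1)⁻¹) + K₀ * κ⁻¹ ^ 3) atTop
        (𝓝 (K * κ * (0 + 0 + 0) + K₀ * κ⁻¹ ^ 3)) :=
      ((((he.add hd).add hs).const_mul (K * κ)).add tendsto_const_nhds)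
    rw [add_zero, add_zero, mul_zero, zero_add] at hR
    refine le_of_tendsto_of_tendsto' hL hR fun n => ?_
    exact hbound ((n : ℝ) + 1) κ (by linarith [n.cast_nonneg (α := ℝ)]) hκ
  -- Step 2: `κ → ∞`.
  refine le_antisymm ?_ hD0
  by_contra hneg
  rw [not_le] at hneg
  by_cases hK0 : K₀ = 0
  · have := hstep 1 le_rfl
    rw [hK0, zero_mul] at this
    exact absurd this (not_le.2 hneg)
  · have hK₀pos : 0 < K₀ := lt_of_le_of_ne hK₀ (Ne.symm hK0)
    set κ := max 1 (2 * K₀ / D) with hκdef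
    have hκ1 : 1 ≤ κ := le_max_left _ _
    have hκ0 : 0 < κ := by linarith
    have hκ2 : 2 * K₀ / D ≤ κ := le_max_right _ _
    have h1 := hstep κ hκ1
    have h2 : κ⁻¹ ^ 3 ≤ κ⁻¹ := by
      have : κ⁻¹ ≤ 1 := inv_le_one_of_one_le₀ hκ1
      calc κ⁻¹ ^ 3 ≤ κ⁻¹ ^ 1 := pow_le_pow_of_le_one (inv_nonneg.2 hκ0.le) this (by norm_num)
        _ = κ⁻¹ := pow_one _
    have h3 : K₀ * κ⁻¹ ≤ D / 2 := by
      rw [← div_eq_mul_inv, div_le_iff₀ hκ0]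
      have : 2 * K₀ ≤ κ * D := by rwa [div_le_iff₀ hneg] at hκ2
      linarith
    have : D ≤ D / 2 := h1.trans ((mul_le_mul_of_nonneg_left h2 hK₀).trans h3)
    linarith

/-- **Galdi's Liouville theorem, all hypotheses explicit**: a smooth steady solution on `ℝ³` with
finite Dirichlet integral, decaying at infinity and in `L^{9/2}` vanishes identically.
[cite: Galdi2011, Thm X.9.5] -/
theorem eq_zero_of_memLp_nineHalves (hprof : IsLerayProfile 1 0 u p) (hu : ContDiff ℝ ∞ u)
    (hD : (∫⁻ x, ENNReal.ofReal (frobeniusNormSq (fderiv ℝ u x))) < ⊤)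
    (hlim : Tendsto u (cocompact ℝ³) (𝓝 0)) (hLp : MemLp u (9 / 2 : ℝ≥0∞) volume) : u = 0 := by
  have hDint : Integrable (gradSq u) := integrable_gradSq hu hD
  have hzero := integral_gradSq_eq_zero hprof hu hLp hDint
  -- `gradSq u ≡ 0`
  have hae : gradSq u =ᵐ[volume] 0 :=
    (integral_eq_zero_iff_of_nonneg (fun x => gradSq_nonneg u x) hDint).1 hzero
  have hfun : gradSq u = 0 := ((continuous_gradSq hu).ae_eq_iff_eq volume continuous_const).1 hae
  -- `Du ≡ 0`, so `u` is constant
  have hfd : ∀ x, fderiv ℝ u x = 0 := fun x =>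
    fderiv_eq_zero_of_gradSq_eq_zero hu (congrFun hfun x)
  have hconst : ∀ x, u x = u 0 := fun x =>
    is_const_of_fderiv_eq_zero (hu.differentiable (by simp)) hfd x 0
  -- the constant is `0` by the decay at infinity
  have hc : Tendsto (fun _ : ℝ³ => u 0) (cocompact ℝ³) (𝓝 0) :=
    hlim.congr fun x => hconst x
  have h0 : u 0 = 0 := tendsto_const_nhds_iff.1 hc
  funext x
  rw [hconst x, h0]
  rfl

end Final

end SteadyLiouvilleL9half


/-- **Galdi's `L^{9/2}` Liouville criterion, `ν = 1`** (Galdi 2011, Thm X.9.5, p. 729; restated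
in Wang 2025, Thm 2.2 and in Seregin–Wang 2020, §1 / Remark 1.2 (i)), in the rendering of the route
file `SteadyNSLiouville.lean`: a smooth solution of `−Δu + (u·∇)u + ∇p = 0`, `div u = 0` on `ℝ³`
(`IsLerayProfile 1 0 u p`, `u ∈ C^∞`) with `∫ |∇u|² < ∞`, `u → 0` at infinity and
`u ∈ L^{9/2}(ℝ³)` is identically zero — second, pressure-free proof
(`SteadyLiouvilleL9half.eq_zero_of_memLp_nineHalves`; the tree's discharge of the named fact is
`galdi_liouville_nineHalves_holds`). [cite: Galdi2011, Thm X.9.5] -/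
theorem eq_zero_of_steadyNS_memLp_nineHalves
    {u : EuclideanSpace ℝ (Fin 3) → EuclideanSpace ℝ (Fin 3)} {p : EuclideanSpace ℝ (Fin 3) → ℝ}
    (hprof : IsLerayProfile 1 0 u p) (hu : ContDiff ℝ (⊤ : ℕ∞) u)
    (hD : (∫⁻ x, ENNReal.ofReal (frobeniusNormSq (fderiv ℝ u x))) < ⊤)
    (hlim : Tendsto u (cocompact (EuclideanSpace ℝ (Fin 3))) (𝓝 0))
    (hLp : MemLp u (9 / 2 : ℝ≥0∞) volume) : u = 0 :=
  SteadyLiouvilleL9half.eq_zero_of_memLp_nineHalves hprof hu hD hlim hLp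

end Literature.Analysis.FluidPDE

end
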